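import Literature.MathematicalPhysics.QuantumLattice.FermiRG.BGM2003Sectors
import HarnessLib

/-!
# Benfatto–Giuliani–Mastropietro 2003: the sector counting Lemma 3.1 — PROOF

Topic `Literature/MathematicalPhysics/QuantumLattice/FermiRG`. Companion PROOF file of
`BGM2003Sectors.lean` (statements-first typing of G. Benfatto, A. Giuliani, V. Mastropietro,
*Low temperature analysis of two-dimensional Fermi systems with symmetric Fermi surface*,
Ann. Henri Poincaré 4 (2003) 137–193, arXiv:cond-mat/0207210 [BenfattoGiulianiMastropietro2003];
locators `p.N (Ln)` = N-th 3000-character chunk (line n) of the materialised arXiv TeX, equation /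
lemma numbers as printed). That file is untouched; this one proves its named fact

* `BGM2003.lemma31_sectorCounting` — **Lemma 3.1 [lm4.1] (4.3), the sector counting lemma**, in the
  form (4.3app) of §7.4: for a dispersion relation satisfying the §1.2 hypotheses
  (`BGM2003.DispersionHyp`), the number of strings of scale-`h'` s-sectors refining given scale-`h`
  sectors, one entry fixed, compatible with momentum conservation in `ℝ²`, is
  `≤ c^L γ^{(h-h')(L-3)/2}` for `L ≥ 4` and `≤ c` for `L = 2`,

as `theorem BGM2003.lemma31_sectorCounting_holds : lemma31_sectorCounting`, on top of the tree's
PROVED Lemmas 7.1, 7.2, 7.3, 7.5 (`lemma71_normalAngle_holds`, `lemma72_sectorPolar_holds`,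
`lemma73_sectorBox_holds`, `lemma75_parallelogram_holds` of `BGM2003Sectors`).

## The argument (§7.4, p.27 L150 – p.28 L125, followed step by step)

* `L = 2` (p.28 L6–8): conservation `k⃗^{(2)} = -k⃗^{(1)}` and (A1.4) put the free sector at the
  antipode of the fixed one (Lemma 7.2): `≤ 5` strings (`count_two`).
* `L ≥ 4`, (s1.21)–(s1.22): «by a reordering of the sectors» — formally the strings are covered by
  the `≤ L²` classes «`(i, j)` is the pair of maximal `φ_{i,j}` (s1.21) among the legs `≠ i₁`».
* (s1.23): a scale-`h` sector contains `≤ 3γ^{(h-h')/2}` scale-`h'` sectors (`card_refinements_le`,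
  via Lemma 7.2 applied to the Fermi point at the fine centre) — the factor `γ^{(h-h')(L-3)/2}` from
  the `L - 3` legs `∉ {i₁, i, j}`.
* (s1.24)–(s1.25), `𝒜_<`: if `φ ≤ Φ = K_Φ L γ^{h'/2}`, both solved legs are within `Φ` (mod `π`) of a
  third, fixed, leg: `≤ (cL)²` pairs (`fibre_small`).
* (s1.26)–(s1.42), `𝒜_>`: the reference pair of maximal `φ₀` (s1.32); the wedge estimate
  (s1.33)–(s1.34) `φ_{1,2} ≤ cLφ₀` (`wedge_bound`); the displacement box (s1.38)–(s1.40)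
  `|r₁| ≤ cLφ₀γ^{h'/2}`, `|r₂| ≤ cLγ^{h'/2}` from Lemma 7.3 and `|sin(α_m - α₀)| ≤ c₂φ` (Lemma 7.1)
  (`string_box`); Lemma 7.5 at the reference pair; and the two-to-one property of the chord-sum map
  `F(θ₁,θ₂) = p⃗_F(θ₁) + p⃗_F(θ₂)` on `𝒯` (§7.3 p.27 L81–89, stated there without proof; proved here as
  `fermiSum_eq_cases` from the strict support inequality `fermiPoint_support` by a symmetric-chord /
  support-line argument) pin every completing pair to `O(L)` grid points per leg: `m_L ≤ cL²`
  (`fibre_large`).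

Deviations (bookkeeping, disclosed): the solved legs are located through their sector CENTRES
(grid points), so the projections `k⃗_⊥` of Lemma 7.4 are not needed and all `L` sector
displacements enter `r⃗`; the finitely many scales with `η = cLγ^{h'/2} > η₀` (`η₀` of Lemma 7.5)
are covered by the trivial bound `|O_{h'}|² ≤ cL²`. Constants are explicit but not optimised
(`c = max(48(K+1), 5)`).

Public by-products: `BGM2003.fermiPoint_support` (every point of `Σ_F` lies strictly below every
other tangent line) and `BGM2003.fermiSum_eq_cases` (the chord-sum map is two-to-one on `𝒯`).
Everything else is `private`. No new definitions, no named facts; nothing here asserts anything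
about the Hubbard model, H1, K1 or K3. (Rev 2: proofs split so that every declaration elaborates
within 35 % of the default heartbeat budget; statements unchanged.)
-/

noncomputable section

open Real Set

namespace Literature.MathematicalPhysics.QuantumLattice.FermiRG

namespace BGM2003

section Frame

variable {ε : (Fin 2 → ℝ) → ℝ} {μ e₀ : ℝ} {u : ℝ → ℝ → ℝ}

/-- Components of a point on the ray `ρ e⃗_r(θ)`. [folklore] -/
private theorem smul_dir_apply_zero' (ρ θ : ℝ) : (ρ • dir θ) 0 = ρ * Real.cos θ := by
  simp [dir]

/-- Components of a point on the ray `ρ e⃗_r(θ)`. [folklore] -/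
private theorem smul_dir_apply_one' (ρ θ : ℝ) : (ρ • dir θ) 1 = ρ * Real.sin θ := by
  simp [dir]

/-- Polar coordinates are unique for positive radii: `ρ e⃗_r(θ) = ρ' e⃗_r(θ')` with `ρ, ρ' > 0` forces
`ρ = ρ'` and `θ ≡ θ' (mod 2π)`. [folklore] -/
private theorem polar_unique' {ρ ρ' θ θ' : ℝ} (hρ : 0 < ρ) (hρ' : 0 < ρ') (h : ρ • dir θ = ρ' • dir θ') :
    ρ = ρ' ∧ ∃ k : ℤ, θ - θ' = 2 * π * k := by
  have hc : ρ * Real.cos θ = ρ' * Real.cos θ' := by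
    simpa [smul_dir_apply_zero'] using congrFun h 0
  have hs : ρ * Real.sin θ = ρ' * Real.sin θ' := by
    simpa [smul_dir_apply_one'] using congrFun h 1
  have hsq : ρ ^ 2 = ρ' ^ 2 := by
    have h1 : ρ ^ 2 = (ρ * Real.cos θ) ^ 2 + (ρ * Real.sin θ) ^ 2 := by
      nlinarith [Real.sin_sq_add_cos_sq θ]
    have h2 : ρ' ^ 2 = (ρ' * Real.cos θ') ^ 2 + (ρ' * Real.sin θ') ^ 2 := by
      nlinarith [Real.sin_sq_add_cos_sq θ']
    rw [h1, h2, hc, hs]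
  have hρρ : ρ = ρ' := (pow_left_inj₀ hρ.le hρ'.le two_ne_zero).1 hsq
  refine ⟨hρρ, ?_⟩
  subst hρρ
  have hcos : Real.cos θ = Real.cos θ' := mul_left_cancel₀ hρ.ne' hc
  have hsin : Real.sin θ = Real.sin θ' := mul_left_cancel₀ hρ.ne' hs
  exact Real.Angle.angle_eq_iff_two_pi_dvd_sub.1 (Real.Angle.cos_sin_inj hcos hsin)

/-- `e⃗_r(θ + π) = -e⃗_r(θ)`. [folklore] -/
private theorem dir_add_pi (θ : ℝ) : dir (θ + π) = -dir θ := by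
  ext i; fin_cases i <;> simp [dir, Real.cos_add_pi, Real.sin_add_pi]

/-- `e⃗_r(θ + 2πk) = e⃗_r(θ)`. [folklore] -/
private theorem dir_add_int_mul (θ : ℝ) (k : ℤ) : dir (θ + k * (2 * π)) = dir θ := by
  ext i; fin_cases i
  · simp [dir, Real.cos_add_int_mul_two_pi]
  · simp [dir, Real.sin_add_int_mul_two_pi]

/-- `|0| ≤ e₀`. [folklore] -/
private theorem abs_zero_le_e₀ (hD : DispersionHyp ε μ e₀ u) : |(0 : ℝ)| ≤ e₀ := by
  rw [abs_zero]; exact hD.e₀_pos.le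

/-- (A1.4) on the Fermi curve: `p⃗_F(θ + π) = -p⃗_F(θ)`. [cite: BenfattoGiulianiMastropietro2003, §7.1 (A1.4) p.26 (L24–28)] -/
private theorem fermiPoint_add_pi (hD : DispersionHyp ε μ e₀ u) (θ : ℝ) :
    fermiPoint u (θ + π) = -fermiPoint u θ := by
  rw [fermiPoint, fermiPoint, levelPoint, levelPoint, hD.antipodal θ 0 (abs_zero_le_e₀ hD), dir_add_pi,
    smul_neg]

/-- `p⃗_F(θ + 2πk) = p⃗_F(θ)`. [folklore] -/
private theorem fermiPoint_add_int_mul' (hD : DispersionHyp ε μ e₀ u) (θ : ℝ) (k : ℤ) :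
    fermiPoint u (θ + k * (2 * π)) = fermiPoint u θ := by
  have h0 : u (θ + k * (2 * π)) 0 = u θ 0 := ((hD.periodic_u 0).int_mul k) θ
  rw [fermiPoint, fermiPoint, levelPoint, levelPoint, h0, dir_add_int_mul]

/-- `p⃗_F(θ) = u(θ) e⃗_r(θ)`. [folklore] -/
private theorem fermiPoint_eq (u : ℝ → ℝ → ℝ) (θ : ℝ) : fermiPoint u θ = u θ 0 • dir θ := rfl

/-- `s'(θ,e)² = u'² + u²`. [folklore] -/
private theorem speed_sq' (u : ℝ → ℝ → ℝ) (θ e : ℝ) :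
    speed u θ e ^ 2 = radiusDeriv u θ e ^ 2 + u θ e ^ 2 :=
  Real.sq_sqrt (by positivity)

/-- `s' ≥ u`. [folklore] -/
private theorem le_speed' (u : ℝ → ℝ → ℝ) (θ e : ℝ) (hu : 0 ≤ u θ e) : u θ e ≤ speed u θ e := by
  unfold speed
  calc u θ e = Real.sqrt (u θ e ^ 2) := (Real.sqrt_sq hu).symm
    _ ≤ Real.sqrt (radiusDeriv u θ e ^ 2 + u θ e ^ 2) := Real.sqrt_le_sqrt (by nlinarith)

/-- Components of `n⃗`. [folklore] -/
private theorem unitNormal_eq' (u : ℝ → ℝ → ℝ) (θ e : ℝ) :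
    unitNormal u θ e = ![(speed u θ e)⁻¹ * u θ e * Real.cos θ + (speed u θ e)⁻¹ * radiusDeriv u θ e * Real.sin θ,
      (speed u θ e)⁻¹ * u θ e * Real.sin θ - (speed u θ e)⁻¹ * radiusDeriv u θ e * Real.cos θ] := by
  ext i; fin_cases i <;> simp [unitNormal, dir, tdir] <;> ring

/-- Components of `τ⃗`. [folklore] -/
private theorem unitTangent_eq' (u : ℝ → ℝ → ℝ) (θ e : ℝ) :
    unitTangent u θ e = ![(speed u θ e)⁻¹ * radiusDeriv u θ e * Real.cos θ - (speed u θ e)⁻¹ * u θ e * Real.sin θ,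
      (speed u θ e)⁻¹ * radiusDeriv u θ e * Real.sin θ + (speed u θ e)⁻¹ * u θ e * Real.cos θ] := by
  ext i; fin_cases i <;> simp [unitTangent, dir, tdir] <;> ring

/-- `cos(arctan(b/a)) = a/√(b² + a²)` and `sin(arctan(b/a)) = b/√(b² + a²)` for `a > 0`. [folklore] -/
private theorem cos_sin_arctan_ratio' {a b : ℝ} (ha : 0 < a) :
    Real.cos (Real.arctan (b / a)) = a / Real.sqrt (b ^ 2 + a ^ 2) ∧
      Real.sin (Real.arctan (b / a)) = b / Real.sqrt (b ^ 2 + a ^ 2) := by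
  have hsq : Real.sqrt (1 + (b / a) ^ 2) = Real.sqrt (b ^ 2 + a ^ 2) / a := by
    rw [show 1 + (b / a) ^ 2 = (b ^ 2 + a ^ 2) / a ^ 2 by field_simp; ring,
      Real.sqrt_div (by positivity), Real.sqrt_sq ha.le]
  have hpos : 0 < Real.sqrt (b ^ 2 + a ^ 2) := Real.sqrt_pos.2 (by positivity)
  rw [Real.cos_arctan, Real.sin_arctan, hsq]
  constructor
  · field_simp
  · field_simp

/-- `n⃗(θ,e) = (cos α(θ,e), sin α(θ,e))` (`u > 0`). [cite: BenfattoGiulianiMastropietro2003, §7.1 Lemma 7.1 p.26 (L54–58)] -/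
private theorem unitNormal_angle' {θ e : ℝ} (hu : 0 < u θ e) :
    unitNormal u θ e = ![Real.cos (normalAngle u θ e), Real.sin (normalAngle u θ e)] := by
  obtain ⟨hc, hs⟩ := cos_sin_arctan_ratio' (b := radiusDeriv u θ e) hu
  rw [unitNormal_eq', normalAngle, Real.cos_sub, Real.sin_sub, hc, hs, speed]
  ext i; fin_cases i <;> simp <;> ring

/-- `τ⃗(θ,e) = (-sin α(θ,e), cos α(θ,e))` (`u > 0`). [cite: BenfattoGiulianiMastropietro2003, §7.1 (A1.6)–(A1.7) p.26 (L35–52)] -/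
private theorem unitTangent_angle' {θ e : ℝ} (hu : 0 < u θ e) :
    unitTangent u θ e = ![-Real.sin (normalAngle u θ e), Real.cos (normalAngle u θ e)] := by
  obtain ⟨hc, hs⟩ := cos_sin_arctan_ratio' (b := radiusDeriv u θ e) hu
  rw [unitTangent_eq', normalAngle, Real.cos_sub, Real.sin_sub, hc, hs, speed]
  ext i; fin_cases i <;> simp <;> ring

/-- `n⃗(t) · n⃗(θ') = cos(α(t) - α(θ'))`. [folklore] -/
private theorem normal_dot_normal' {t θ' : ℝ} (ht : 0 < u t 0) (hθ' : 0 < u θ' 0) :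
    unitNormal u t 0 ⬝ᵥ unitNormal u θ' 0 = Real.cos (normalAngle u t 0 - normalAngle u θ' 0) := by
  rw [unitNormal_angle' ht, unitNormal_angle' hθ', Real.cos_sub]
  simp [dotProduct, Fin.sum_univ_two]

/-- `τ⃗(t) · n⃗(θ') = -sin(α(t) - α(θ'))`. [cite: BenfattoGiulianiMastropietro2003, §7.1 (A1.10) p.26 (L64–66)] -/
private theorem tangent_dot_normal' {t θ' : ℝ} (ht : 0 < u t 0) (hθ' : 0 < u θ' 0) :
    unitTangent u t 0 ⬝ᵥ unitNormal u θ' 0 = -Real.sin (normalAngle u t 0 - normalAngle u θ' 0) := by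
  rw [unitTangent_angle' ht, unitNormal_angle' hθ', Real.sin_sub]
  simp [dotProduct, Fin.sum_univ_two]; ring

/-- `n⃗(t) · τ⃗(θ') = sin(α(t) - α(θ'))`. [folklore] -/
private theorem normal_dot_tangent' {t θ' : ℝ} (ht : 0 < u t 0) (hθ' : 0 < u θ' 0) :
    unitNormal u t 0 ⬝ᵥ unitTangent u θ' 0 = Real.sin (normalAngle u t 0 - normalAngle u θ' 0) := by
  rw [unitNormal_angle' ht, unitTangent_angle' hθ', Real.sin_sub]
  simp [dotProduct, Fin.sum_univ_two]; ring

/-- `τ⃗(t) · τ⃗(θ') = cos(α(t) - α(θ'))`. [folklore] -/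
private theorem tangent_dot_tangent' {t θ' : ℝ} (ht : 0 < u t 0) (hθ' : 0 < u θ' 0) :
    unitTangent u t 0 ⬝ᵥ unitTangent u θ' 0 = Real.cos (normalAngle u t 0 - normalAngle u θ' 0) := by
  rw [unitTangent_angle' ht, unitTangent_angle' hθ', Real.cos_sub]
  simp [dotProduct, Fin.sum_univ_two]; ring

/-- Orthonormal decomposition in the frame `(n⃗(θ), τ⃗(θ))` at `e = 0`: `v = (v·n⃗)n⃗ + (v·τ⃗)τ⃗`. [folklore] -/
private theorem frame_decomp' {θ : ℝ} (hu : 0 < u θ 0) (v : Fin 2 → ℝ) :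
    v = (v ⬝ᵥ unitNormal u θ 0) • unitNormal u θ 0 + (v ⬝ᵥ unitTangent u θ 0) • unitTangent u θ 0 := by
  have hcs := Real.sin_sq_add_cos_sq (normalAngle u θ 0)
  rw [unitNormal_angle' hu, unitTangent_angle' hu]
  ext i; fin_cases i
  · simp [dotProduct, Fin.sum_univ_two]
    linear_combination (-(v 0)) * hcs
  · simp [dotProduct, Fin.sum_univ_two]
    linear_combination (-(v 1)) * hcs

/-- `|v · n⃗(θ)| ≤ |v 0| + |v 1|` and the same for `τ⃗`. [folklore] -/
private theorem abs_dot_frame_le {θ : ℝ} (hu : 0 < u θ 0) (v : Fin 2 → ℝ) :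
    |v ⬝ᵥ unitNormal u θ 0| ≤ |v 0| + |v 1| ∧ |v ⬝ᵥ unitTangent u θ 0| ≤ |v 0| + |v 1| := by
  rw [unitNormal_angle' hu, unitTangent_angle' hu]
  have hc := Real.abs_cos_le_one (normalAngle u θ 0)
  have hs := Real.abs_sin_le_one (normalAngle u θ 0)
  constructor
  · simp only [dotProduct, Fin.sum_univ_two, Matrix.cons_val_zero, Matrix.cons_val_one]
    calc |v 0 * Real.cos (normalAngle u θ 0) + v 1 * Real.sin (normalAngle u θ 0)|
        ≤ |v 0 * Real.cos (normalAngle u θ 0)| + |v 1 * Real.sin (normalAngle u θ 0)| := abs_add_le _ _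
      _ ≤ |v 0| + |v 1| := by
        rw [abs_mul, abs_mul]
        exact add_le_add (mul_le_of_le_one_right (abs_nonneg _) hc)
          (mul_le_of_le_one_right (abs_nonneg _) hs)
  · simp only [dotProduct, Fin.sum_univ_two, Matrix.cons_val_zero, Matrix.cons_val_one]
    calc |v 0 * -Real.sin (normalAngle u θ 0) + v 1 * Real.cos (normalAngle u θ 0)|
        ≤ |v 0 * -Real.sin (normalAngle u θ 0)| + |v 1 * Real.cos (normalAngle u θ 0)| := abs_add_le _ _
      _ ≤ |v 0| + |v 1| := by
        rw [abs_mul, abs_mul, abs_neg]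
        exact add_le_add (mul_le_of_le_one_right (abs_nonneg _) hs)
          (mul_le_of_le_one_right (abs_nonneg _) hc)

/-! #### Regularity of the polar radius at `e = 0` -/

/-- Each slice `θ ↦ u(θ,e)`, `|e| ≤ e₀`, is `C^∞`. [folklore] -/
private theorem contDiff_slice' (hD : DispersionHyp ε μ e₀ u) {e : ℝ} (he : |e| ≤ e₀) :
    ContDiff ℝ ((⊤ : ℕ∞) : WithTop ℕ∞) (fun θ => u θ e) := by
  obtain ⟨e₁, he₁, hsm⟩ := hD.smooth_u
  have hmem : ∀ θ : ℝ, (θ, e) ∈ univ ×ˢ Ioo (-e₁) e₁ := fun θ =>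
    ⟨mem_univ _, ⟨by linarith [(abs_le.1 he).1], by linarith [(abs_le.1 he).2]⟩⟩
  exact hsm.comp_contDiff (contDiff_id.prodMk contDiff_const) hmem

/-- `θ ↦ u(θ,e)` has derivative `u'(θ,e)`. [folklore] -/
private theorem hasDerivAt_u' (hD : DispersionHyp ε μ e₀ u) {e : ℝ} (he : |e| ≤ e₀) (θ : ℝ) :
    HasDerivAt (fun ϑ => u ϑ e) (radiusDeriv u θ e) θ :=
  (((contDiff_slice' hD he).differentiable (by simp)).differentiableAt).hasDerivAt

/-- A continuous `2π`-periodic real function is bounded. [folklore] -/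
private theorem periodic_bound' {f : ℝ → ℝ} (hf : Continuous f) (hp : Function.Periodic f (2 * π)) :
    ∃ M : ℝ, 0 ≤ M ∧ ∀ θ : ℝ, |f θ| ≤ M := by
  obtain ⟨C, hC⟩ := isBounded_iff_forall_norm_le.1 (hp.isBounded_of_continuous (by positivity) hf)
  refine ⟨max C 0, le_max_right _ _, fun θ => ?_⟩
  exact (Real.norm_eq_abs _ ▸ hC (f θ) ⟨θ, rfl⟩).trans (le_max_left _ _)

/-- Uniform bounds `c_u ≤ u(θ,0) ≤ M` on the Fermi radius. [folklore] -/
private theorem fermiRadius_bounds (hD : DispersionHyp ε μ e₀ u) :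
    ∃ cu M : ℝ, 0 < cu ∧ cu ≤ M ∧ ∀ θ : ℝ, cu ≤ u θ 0 ∧ u θ 0 ≤ M := by
  obtain ⟨cu, hcu, hu⟩ := hD.u_pos
  obtain ⟨M, -, hM⟩ := periodic_bound' ((contDiff_slice' hD (abs_zero_le_e₀ hD)).continuous) (hD.periodic_u 0)
  refine ⟨cu, max cu M, hcu, le_max_left _ _, fun θ => ⟨hu θ 0 (abs_zero_le_e₀ hD), ?_⟩⟩
  exact ((le_abs_self _).trans (hM θ)).trans (le_max_right _ _)

/-- The derivative of `θ ↦ e⃗_r(θ) · w` is `e⃗_t(θ) · w`. [folklore] -/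
private theorem hasDerivAt_dir_dot' (w : Fin 2 → ℝ) (θ : ℝ) :
    HasDerivAt (fun ϑ => dir ϑ ⬝ᵥ w) (tdir θ ⬝ᵥ w) θ := by
  have h : HasDerivAt (fun ϑ => Real.cos ϑ * w 0 + Real.sin ϑ * w 1)
      (-Real.sin θ * w 0 + Real.cos θ * w 1) θ :=
    ((Real.hasDerivAt_cos θ).mul_const _).add ((Real.hasDerivAt_sin θ).mul_const _)
  have h1 : (fun ϑ => dir ϑ ⬝ᵥ w) = fun ϑ => Real.cos ϑ * w 0 + Real.sin ϑ * w 1 := by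
    funext ϑ; simp [dotProduct, Fin.sum_univ_two, dir]
  have h2 : tdir θ ⬝ᵥ w = -Real.sin θ * w 0 + Real.cos θ * w 1 := by
    simp [dotProduct, Fin.sum_univ_two, tdir]
  rw [h1, h2]; exact h

/-- `d/dt [p⃗_F(t) · w] = s'(t) τ⃗(t) · w` ((A1.6): `dp⃗_F/dθ = s'τ⃗`). [cite: BenfattoGiulianiMastropietro2003, §7.1 (A1.6) p.26 (L35–41)] -/
private theorem hasDerivAt_fermi_dot' (hD : DispersionHyp ε μ e₀ u) (w : Fin 2 → ℝ) (t : ℝ) :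
    HasDerivAt (fun s => fermiPoint u s ⬝ᵥ w) (speed u t 0 * (unitTangent u t 0 ⬝ᵥ w)) t := by
  have h0 := abs_zero_le_e₀ hD
  obtain ⟨cu, hcu, hu⟩ := hD.u_pos
  have hupos : 0 < u t 0 := lt_of_lt_of_le hcu (hu t 0 h0)
  have hs : speed u t 0 ≠ 0 := (lt_of_lt_of_le hupos (le_speed' u t 0 hupos.le)).ne'
  have h1 : (fun s => fermiPoint u s ⬝ᵥ w) = fun s => u s 0 * (dir s ⬝ᵥ w) := by
    funext s; simp [fermiPoint, levelPoint, smul_dotProduct]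
  have h2 : speed u t 0 * (unitTangent u t 0 ⬝ᵥ w) =
      radiusDeriv u t 0 * (dir t ⬝ᵥ w) + u t 0 * (tdir t ⬝ᵥ w) := by
    rw [unitTangent, smul_dotProduct, smul_eq_mul, add_dotProduct, smul_dotProduct, smul_dotProduct,
      smul_eq_mul, smul_eq_mul, ← mul_assoc, mul_inv_cancel₀ hs, one_mul]
  rw [h1, h2]
  exact (hasDerivAt_u' hD h0 t).mul (hasDerivAt_dir_dot' w t)

/-! #### Torus-distance bookkeeping -/

/-- `‖θ‖_{𝕋¹} ≤ π`. [folklore] -/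
private theorem torusDist_le_pi' (x : ℝ) : torusDist x ≤ π := by
  have h := AddCircle.norm_le_half_period (2 * π) (x := ((x : ℝ) : AddCircle (2 * π))) two_pi_pos.ne'
  rw [abs_of_pos two_pi_pos] at h
  unfold torusDist
  linarith

/-- `0 ≤ ‖θ‖_{𝕋¹}`. [folklore] -/
private theorem torusDist_nonneg (x : ℝ) : 0 ≤ torusDist x := norm_nonneg _

/-- `‖θ‖_{𝕋¹} = |θ|` when `|θ| ≤ π`. [folklore] -/
private theorem torusDist_eq_abs' {x : ℝ} (hx : |x| ≤ π) : torusDist x = |x| := by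
  rw [torusDist, AddCircle.norm_coe_eq_abs_iff (2 * π) two_pi_pos.ne', abs_of_pos two_pi_pos]
  linarith

/-- The representative of `θ` in `[-π, π]` modulo `2π`: `‖θ‖_{𝕋¹} = |θ - 2πk|` with
`k = round(θ/2π)`. [folklore] -/
private theorem torusDist_eq_abs_sub_round' (x : ℝ) :
    torusDist x = |x - round ((2 * π)⁻¹ * x) * (2 * π)| := by
  rw [torusDist, AddCircle.norm_eq]

/-- `‖θ + 2πk‖_{𝕋¹} = ‖θ‖_{𝕋¹}`. [folklore] -/
private theorem torusDist_add_int_mul' (x : ℝ) (k : ℤ) : torusDist (x + k * (2 * π)) = torusDist x := by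
  unfold torusDist
  have h : ((x + k * (2 * π) : ℝ) : AddCircle (2 * π)) = ((x : ℝ) : AddCircle (2 * π)) := by
    rw [← sub_eq_zero, ← AddCircle.coe_sub, AddCircle.coe_eq_zero_iff]
    exact ⟨k, by rw [zsmul_eq_mul]; ring⟩
  rw [h]

/-- `‖-θ‖_{𝕋¹} = ‖θ‖_{𝕋¹}`. [folklore] -/
private theorem torusDist_neg' (x : ℝ) : torusDist (-x) = torusDist x := by
  unfold torusDist
  rw [AddCircle.coe_neg, norm_neg]

/-- `‖θ‖_{𝕋¹} ≤ |θ|`. [folklore] -/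
private theorem torusDist_le_abs' (x : ℝ) : torusDist x ≤ |x| := by
  unfold torusDist
  exact QuotientAddGroup.norm_mk_le_norm.trans (le_of_eq (Real.norm_eq_abs _))

/-- `‖θ‖_{𝕋¹} ≤ |θ - 2πk|` for every integer `k`. [folklore] -/
private theorem torusDist_le_abs_sub_int_mul (x : ℝ) (k : ℤ) : torusDist x ≤ |x - k * (2 * π)| := by
  have h := torusDist_le_abs' (x + (-k : ℤ) * (2 * π))
  rw [torusDist_add_int_mul'] at h
  simpa [sub_eq_add_neg] using h

/-- `‖θ‖_{𝕋¹} = 0` iff `θ ∈ 2πℤ`. [folklore] -/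
private theorem torusDist_eq_zero_iff (x : ℝ) : torusDist x = 0 ↔ ∃ k : ℤ, x = k * (2 * π) := by
  unfold torusDist
  rw [norm_eq_zero, AddCircle.coe_eq_zero_iff]
  constructor
  · rintro ⟨k, hk⟩; exact ⟨k, by rw [← hk, zsmul_eq_mul]⟩
  · rintro ⟨k, hk⟩; exact ⟨k, by rw [hk, zsmul_eq_mul]⟩

/-- A decomposition `θ = 2πk + d̃` with `|d̃| = ‖θ‖_{𝕋¹} ≤ π`. [folklore] -/
private theorem torusDist_rep (x : ℝ) : ∃ (k : ℤ) (d : ℝ), x = d + k * (2 * π) ∧ |d| ≤ π ∧ torusDist x = |d| := by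
  refine ⟨round ((2 * π)⁻¹ * x), x - round ((2 * π)⁻¹ * x) * (2 * π), by ring, ?_, torusDist_eq_abs_sub_round' x⟩
  rw [← torusDist_eq_abs_sub_round']; exact torusDist_le_pi' x

/-- `|sin θ| ≤ ‖θ‖_{𝕋¹}`. [folklore] -/
private theorem abs_sin_le_torusDist (x : ℝ) : |Real.sin x| ≤ torusDist x := by
  obtain ⟨k, d, hx, -, hd⟩ := torusDist_rep x
  rw [hd, hx, Real.sin_add_int_mul_two_pi]
  exact Real.abs_sin_le_abs

end Frame

section Support

variable {ε : (Fin 2 → ℝ) → ℝ} {μ e₀ : ℝ} {u : ℝ → ℝ → ℝ}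

/-- Lemma 7.1 at `e = 0`, unpacked from the tree theorem `lemma71_normalAngle_holds`: `α(·,0)` is
monotone, bi-Lipschitz for the distances on `𝕋¹`, and `α(θ + π) = α(θ) + π`. [cite: BenfattoGiulianiMastropietro2003, §7.1 Lemma 7.1 (A1.9) p.26 (L54–63)] -/
private theorem normalAngle_facts (hD : DispersionHyp ε μ e₀ u) :
    ∃ c₁ c₂ : ℝ, 0 < c₁ ∧ c₁ ≤ c₂ ∧ Monotone (fun θ => normalAngle u θ 0) ∧
      (∀ θ₁ θ₂ : ℝ,
        c₁ * torusDist (θ₂ - θ₁) ≤ torusDist (normalAngle u θ₂ 0 - normalAngle u θ₁ 0) ∧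
        torusDist (normalAngle u θ₂ 0 - normalAngle u θ₁ 0) ≤ c₂ * torusDist (θ₂ - θ₁)) ∧
      ∀ θ : ℝ, normalAngle u (θ + π) 0 = normalAngle u θ 0 + π := by
  obtain ⟨c₁, c₂, hc₁, hc₁₂, h⟩ := lemma71_normalAngle_holds ε μ e₀ u hD
  obtain ⟨hmono, hlip, hpi⟩ := h 0 (abs_zero_le_e₀ hD)
  exact ⟨c₁, c₂, hc₁, hc₁₂, hmono, hlip, fun θ => by linarith [hpi θ]⟩

/-- `‖0‖_{𝕋¹} = 0`. [folklore] -/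
private theorem torusDist_zero : torusDist 0 = 0 := by
  rw [torusDist_eq_zero_iff]; exact ⟨0, by simp⟩

/-- Strict form of Lemma 7.1 on a half-turn: for `ψ < s < ψ + π`, `0 < α(s) - α(ψ) < π`. [cite: BenfattoGiulianiMastropietro2003, §7.1 Lemma 7.1 (A1.9) p.26 (L54–63)] -/
private theorem normalAngle_strict (hD : DispersionHyp ε μ e₀ u) {ψ s : ℝ} (h1 : ψ < s) (h2 : s < ψ + π) :
    0 < normalAngle u s 0 - normalAngle u ψ 0 ∧ normalAngle u s 0 - normalAngle u ψ 0 < π := by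
  obtain ⟨c₁, c₂, hc₁, -, hmono, hlip, hpi⟩ := normalAngle_facts hD
  have hle1 : normalAngle u ψ 0 ≤ normalAngle u s 0 := hmono h1.le
  have hle2 : normalAngle u s 0 ≤ normalAngle u ψ 0 + π := by rw [← hpi ψ]; exact hmono h2.le
  have hd1 : 0 < torusDist (s - ψ) := by
    rw [torusDist_eq_abs' (by rw [abs_of_pos (sub_pos.2 h1)]; linarith)]
    exact abs_pos.2 (sub_ne_zero.2 h1.ne')
  have hd2 : 0 < torusDist (ψ + π - s) := by
    rw [torusDist_eq_abs' (by rw [abs_of_pos (sub_pos.2 h2)]; linarith)]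
    exact abs_pos.2 (sub_ne_zero.2 h2.ne')
  have hne1 : normalAngle u s 0 - normalAngle u ψ 0 ≠ 0 := by
    intro h0
    have := (hlip ψ s).1
    rw [h0, torusDist_zero] at this
    nlinarith
  have hne2 : normalAngle u (ψ + π) 0 - normalAngle u s 0 ≠ 0 := by
    intro h0
    have := (hlip s (ψ + π)).1
    rw [h0, torusDist_zero] at this
    nlinarith
  rw [hpi ψ] at hne2
  constructor
  · exact lt_of_le_of_ne (sub_nonneg.2 hle1) (Ne.symm hne1)
  · have : normalAngle u s 0 - normalAngle u ψ 0 ≠ π := fun h => hne2 (by linarith)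
    exact lt_of_le_of_ne (by linarith) this

/-- **Strict convexity of the Fermi curve (global support inequality).** Under the §1.2 hypotheses,
every point of `Σ_F` lies weakly below every tangent line, `[p⃗_F(t) - p⃗_F(ψ)]·n⃗(ψ) ≤ 0`, and
strictly below unless `t ≡ ψ (mod 2π)`. Proof: the height `F(t) = [p⃗_F(t) - p⃗_F(ψ)]·n⃗(ψ)` has
`F' = s'(t) τ⃗(t)·n⃗(ψ) = -s'(t) sin(α(t) - α(ψ))` ((A1.6), (A1.10)), and by Lemma 7.1
`0 < α(t) - α(ψ) < π` on `(ψ, ψ + π)`, so `F` decreases strictly on `[ψ, ψ+π]` and increases strictly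
on `[ψ-π, ψ]`, with `F(ψ) = 0`. (The paper uses this as «`F` is invertible … in a one to one
correspondence» in §7.3, p.27 L75–89.) [cite: BenfattoGiulianiMastropietro2003, §7.1 Lemma 7.1 (A1.9)–(A1.10) p.26 (L54–74) and §7.3 p.27 (L75–89)] -/
theorem fermiPoint_support (hD : DispersionHyp ε μ e₀ u) (ψ t : ℝ) :
    (fermiPoint u t - fermiPoint u ψ) ⬝ᵥ unitNormal u ψ 0 ≤ 0 ∧
      (0 < torusDist (t - ψ) → (fermiPoint u t - fermiPoint u ψ) ⬝ᵥ unitNormal u ψ 0 < 0) := by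
  have h0 := abs_zero_le_e₀ hD
  obtain ⟨cu, hcu, hu⟩ := hD.u_pos
  have hupos : ∀ s, 0 < u s 0 := fun s => lt_of_lt_of_le hcu (hu s 0 h0)
  have hspos : ∀ s, 0 < speed u s 0 := fun s => lt_of_lt_of_le (hupos s) (le_speed' u s 0 (hupos s).le)
  -- the height function and its derivative
  set F : ℝ → ℝ := fun s => (fermiPoint u s - fermiPoint u ψ) ⬝ᵥ unitNormal u ψ 0 with hFdef
  have hF0 : F ψ = 0 := by simp [hFdef]
  have hFder : ∀ s, HasDerivAt F (-(speed u s 0 * Real.sin (normalAngle u s 0 - normalAngle u ψ 0))) s := by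
    intro s
    have h := (hasDerivAt_fermi_dot' hD (unitNormal u ψ 0) s).sub_const (fermiPoint u ψ ⬝ᵥ unitNormal u ψ 0)
    rw [tangent_dot_normal' (hupos s) (hupos ψ), mul_neg] at h
    have hF' : F = fun s => fermiPoint u s ⬝ᵥ unitNormal u ψ 0 - fermiPoint u ψ ⬝ᵥ unitNormal u ψ 0 := by
      funext s; simp [hFdef, sub_dotProduct]
    rw [hF']; exact h
  have hFcont : Continuous F := by
    have : Differentiable ℝ F := fun s => (hFder s).differentiableAt
    exact this.continuous
  -- strict monotonicity on the two half-turns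
  have hanti : StrictAntiOn F (Icc ψ (ψ + π)) := by
    refine strictAntiOn_of_deriv_neg (convex_Icc _ _) hFcont.continuousOn fun s hs => ?_
    rw [interior_Icc] at hs
    rw [(hFder s).deriv]
    obtain ⟨hlo, hhi⟩ := normalAngle_strict hD hs.1 hs.2
    have hsin : 0 < Real.sin (normalAngle u s 0 - normalAngle u ψ 0) := Real.sin_pos_of_pos_of_lt_pi hlo hhi
    have := mul_pos (hspos s) hsin
    linarith
  have hmono : StrictMonoOn F (Icc (ψ - π) ψ) := by
    refine strictMonoOn_of_deriv_pos (convex_Icc _ _) hFcont.continuousOn fun s hs => ?_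
    rw [interior_Icc] at hs
    rw [(hFder s).deriv]
    obtain ⟨hlo, hhi⟩ := normalAngle_strict hD hs.2 (by linarith [hs.1])
    have hsin : 0 < Real.sin (normalAngle u ψ 0 - normalAngle u s 0) := Real.sin_pos_of_pos_of_lt_pi hlo hhi
    have hodd : Real.sin (normalAngle u s 0 - normalAngle u ψ 0) =
        -Real.sin (normalAngle u ψ 0 - normalAngle u s 0) := by rw [← Real.sin_neg, neg_sub]
    rw [hodd]
    have := mul_pos (hspos s) hsin
    linarith
  -- reduce `t` to the representative `ψ + d̃`, `|d̃| = ‖t - ψ‖ ≤ π`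
  obtain ⟨k, d, hkd, hdπ, htd⟩ := torusDist_rep (t - ψ)
  have hpt : fermiPoint u t = fermiPoint u (ψ + d) := by
    have : t = (ψ + d) + k * (2 * π) := by linarith
    rw [this, fermiPoint_add_int_mul' hD]
  have hFt : (fermiPoint u t - fermiPoint u ψ) ⬝ᵥ unitNormal u ψ 0 = F (ψ + d) := by
    simp [hFdef, hpt]
  rw [hFt, htd]
  rcases le_or_gt 0 d with hd | hd
  · have hmem1 : ψ ∈ Icc ψ (ψ + π) := ⟨le_rfl, by linarith [pi_pos]⟩
    have hmem2 : ψ + d ∈ Icc ψ (ψ + π) := ⟨by linarith, by linarith [(abs_le.1 hdπ).2]⟩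
    constructor
    · rcases hd.lt_or_eq with hlt | heq
      · have := hanti hmem1 hmem2 (by linarith); rw [hF0] at this; exact this.le
      · rw [← heq, add_zero, hF0]
    · intro hpos
      have hlt : 0 < d := by
        rcases hd.lt_or_eq with hlt | heq
        · exact hlt
        · rw [← heq, abs_zero] at hpos; exact absurd hpos (lt_irrefl _)
      have := hanti hmem1 hmem2 (by linarith); rw [hF0] at this; exact this
  · have hmem1 : ψ ∈ Icc (ψ - π) ψ := ⟨by linarith [pi_pos], le_rfl⟩
    have hmem2 : ψ + d ∈ Icc (ψ - π) ψ := ⟨by linarith [(abs_le.1 hdπ).1], by linarith⟩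
    have := hmono hmem2 hmem1 (by linarith); rw [hF0] at this
    exact ⟨this.le, fun _ => this⟩

/-- Injectivity of the Fermi parametrisation modulo `2π`, in support form: if
`[p⃗_F(t) - p⃗_F(ψ)]·n⃗(ψ) = 0` (in particular if `p⃗_F(t) = p⃗_F(ψ)`) then `t ≡ ψ (mod 2π)`. [folklore] -/
private theorem eq_mod_of_support_eq_zero (hD : DispersionHyp ε μ e₀ u) {ψ t : ℝ}
    (h : (fermiPoint u t - fermiPoint u ψ) ⬝ᵥ unitNormal u ψ 0 = 0) : ∃ k : ℤ, t - ψ = k * (2 * π) := by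
  rw [← torusDist_eq_zero_iff]
  rcases (torusDist_nonneg (t - ψ)).lt_or_eq with hpos | hzero
  · have := (fermiPoint_support hD ψ t).2 hpos; rw [h] at this; exact absurd this (lt_irrefl _)
  · exact hzero.symm

/-- `p⃗_F(t) = p⃗_F(ψ)` forces `t ≡ ψ (mod 2π)`. [folklore] -/
private theorem eq_mod_of_fermiPoint_eq (hD : DispersionHyp ε μ e₀ u) {ψ t : ℝ}
    (h : fermiPoint u t = fermiPoint u ψ) : ∃ k : ℤ, t - ψ = k * (2 * π) :=
  eq_mod_of_support_eq_zero hD (by rw [h, sub_self, zero_dotProduct])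

end Support

section Injectivity

variable {ε : (Fin 2 → ℝ) → ℝ} {μ e₀ : ℝ} {u : ℝ → ℝ → ℝ}

/-- In `ℝ²`: a vector with vanishing cross product against `v ≠ 0` is a multiple of `v`. [folklore] -/
private theorem exists_smul_of_cross_eq_zero {x v : Fin 2 → ℝ} (hv : v ≠ 0)
    (h : x 1 * v 0 - x 0 * v 1 = 0) : ∃ m : ℝ, x = m • v := by
  by_cases hv0 : v 0 = 0
  · have hv1 : v 1 ≠ 0 := by
      intro hv1; apply hv; ext i; fin_cases i <;> simp [hv0, hv1]
    refine ⟨x 1 / v 1, ?_⟩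
    have hx0 : x 0 = 0 := by
      rw [hv0, mul_zero, zero_sub, neg_eq_zero] at h
      rcases mul_eq_zero.1 h with h' | h'
      · exact h'
      · exact absurd h' hv1
    ext i; fin_cases i
    · simp [hx0, hv0]
    · simp [div_mul_cancel₀ _ hv1]
  · refine ⟨x 0 / v 0, ?_⟩
    ext i; fin_cases i
    · simp [div_mul_cancel₀ _ hv0]
    · simp
      field_simp
      linarith

/-- `sin(a - b) ≠ 0` excludes `a ≡ b + π (mod 2π)`: `‖b + π - a‖_{𝕋¹} > 0`. [folklore] -/
private theorem torusDist_add_pi_pos {a b : ℝ} (hab : Real.sin (a - b) ≠ 0) : 0 < torusDist (b + π - a) := by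
  rcases (torusDist_nonneg (b + π - a)).lt_or_eq with hpos | hzero
  · exact hpos
  · exfalso; apply hab
    obtain ⟨k, hk⟩ := (torusDist_eq_zero_iff _).1 hzero.symm
    have : a - b = π + (-k : ℤ) * (2 * π) := by push_cast; linarith
    rw [this, Real.sin_add_int_mul_two_pi, Real.sin_pi]

/-- `sin(a - b) ≠ 0` excludes `a ≡ b (mod 2π)`: `‖b - a‖_{𝕋¹} > 0`. [folklore] -/
private theorem torusDist_pos_of_sin_ne {a b : ℝ} (hab : Real.sin (a - b) ≠ 0) : 0 < torusDist (b - a) := by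
  rcases (torusDist_nonneg (b - a)).lt_or_eq with hpos | hzero
  · exact hpos
  · exfalso; apply hab
    obtain ⟨k, hk⟩ := (torusDist_eq_zero_iff _).1 hzero.symm
    have : a - b = 0 + (-k : ℤ) * (2 * π) := by push_cast; linarith
    rw [this, Real.sin_add_int_mul_two_pi, Real.sin_zero]

/-- The level of `p⃗_F(a)` across the chord direction `v = p⃗_F(a) + p⃗_F(b)`:
`p⃗_F(a) ∧ v = u(a)u(b) sin(a - b)`. [folklore] -/
private theorem cross_fermi_sum (u : ℝ → ℝ → ℝ) (a b : ℝ) :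
    (fermiPoint u a) 1 * (fermiPoint u a + fermiPoint u b) 0 -
      (fermiPoint u a) 0 * (fermiPoint u a + fermiPoint u b) 1 = u a 0 * u b 0 * Real.sin (a - b) := by
  simp [fermiPoint, levelPoint, dir, Real.sin_sub]; ring

/-- Affine-combination bookkeeping in `ℝ²`. [folklore] -/
private theorem combo_sub_eq (s : ℝ) (pa pb pc : Fin 2 → ℝ) :
    ((1 - s) • pb + s • pc) - pa = (1 - s) • (pb - pa) + s • (pc - pa) := by
  module

/-- Affine-combination bookkeeping in `ℝ²`, antipodal form. [folklore] -/
private theorem combo_sub_eq' (s : ℝ) (pa pb pc : Fin 2 → ℝ) :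
    ((1 - s) • pb + s • pc) - pa = (1 - s) • (-pa - -pb) + s • (-(pa + pb - pc) - -pb) := by
  module

/-- The cross-product functional `X ↦ X ∧ v` is linear. [folklore] -/
private theorem cross_sub (v X Y : Fin 2 → ℝ) :
    (X - Y) 1 * v 0 - (X - Y) 0 * v 1 = (X 1 * v 0 - X 0 * v 1) - (Y 1 * v 0 - Y 0 * v 1) := by
  simp only [Pi.sub_apply]; ring

/-- The cross-product functional on an affine combination. [folklore] -/
private theorem cross_comb (v X Y : Fin 2 → ℝ) (r t : ℝ) :
    (r • X + t • Y) 1 * v 0 - (r • X + t • Y) 0 * v 1 =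
      r * (X 1 * v 0 - X 0 * v 1) + t * (Y 1 * v 0 - Y 0 * v 1) := by
  simp only [Pi.add_apply, Pi.smul_apply, smul_eq_mul]; ring

/-- The core of the injectivity argument (symmetric-chord/support-line): two solutions `(a,b)`,
`(c,d)` of `p⃗_F(a) + p⃗_F(b) = p⃗_F(c) + p⃗_F(d) = v⃗` in the SAME half of `𝒯` (`sin(a-b), sin(c-d) > 0`),
ordered so that the chord `{p⃗_F(a), -p⃗_F(b)}` is not farther from the centre than
`{p⃗_F(c), -p⃗_F(d)}`, have `c ≡ a`. With `s = 2λ_a/(λ_a + λ_c)` the point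
`M = (1-s)p⃗_F(b) + s p⃗_F(c)` lies on the line of the first chord; the support inequalities at
`p⃗_F(a)` and at `p⃗_F(b+π) = -p⃗_F(b)` force `M = p⃗_F(a)`, and then strict convexity at `p⃗_F(a)`
forces `p⃗_F(c) = p⃗_F(a)`. [cite: BenfattoGiulianiMastropietro2003, §7.3 p.27 (L81–89)] -/
private theorem fermiSum_inj_aux (hD : DispersionHyp ε μ e₀ u) {a b c d : ℝ}
    (hab : 0 < Real.sin (a - b)) (hcd : 0 < Real.sin (c - d))
    (h : fermiPoint u a + fermiPoint u b = fermiPoint u c + fermiPoint u d)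
    (hle : u a 0 * u b 0 * Real.sin (a - b) ≤ u c 0 * u d 0 * Real.sin (c - d)) :
    ∃ k : ℤ, c - a = k * (2 * π) := by
  have h0 := abs_zero_le_e₀ hD
  obtain ⟨cu, hcu, hu⟩ := hD.u_pos
  have hupos : ∀ s, 0 < u s 0 := fun s => lt_of_lt_of_le hcu (hu s 0 h0)
  set pa := fermiPoint u a with hpa
  set pb := fermiPoint u b with hpb
  set pc := fermiPoint u c with hpc
  set pd := fermiPoint u d with hpd
  obtain ⟨v, hv⟩ : ∃ v : Fin 2 → ℝ, v = pa + pb := ⟨_, rfl⟩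
  have hv' : v = pc + pd := hv.trans h
  set la := u a 0 * u b 0 * Real.sin (a - b) with hla
  set lc := u c 0 * u d 0 * Real.sin (c - d) with hlc
  have hla_pos : 0 < la := mul_pos (mul_pos (hupos a) (hupos b)) hab
  have hlc_pos : 0 < lc := mul_pos (mul_pos (hupos c) (hupos d)) hcd
  -- the level functional `λ(X) = X ∧ v`
  obtain ⟨lam, hlam⟩ : ∃ lam : (Fin 2 → ℝ) → ℝ, ∀ X, lam X = X 1 * v 0 - X 0 * v 1 :=
    ⟨fun X => X 1 * v 0 - X 0 * v 1, fun X => rfl⟩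
  have hlam_sub : ∀ X Y, lam (X - Y) = lam X - lam Y := by
    intro X Y; simp only [hlam]; exact cross_sub v X Y
  have hlam_comb : ∀ (r t : ℝ) X Y, lam (r • X + t • Y) = r * lam X + t * lam Y := by
    intro r t X Y; simp only [hlam]; exact cross_comb v X Y r t
  have hlam_a : lam pa = la := by rw [hlam, hla, hv]; exact cross_fermi_sum u a b
  have hlam_c : lam pc = lc := by
    rw [hlam, hlc, hv']; exact cross_fermi_sum u c d
  have hlam_v : lam v = 0 := by rw [hlam]; ring
  have hlam_b : lam pb = -la := by
    have : pb = v - pa := by rw [hv]; abel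
    rw [this, hlam_sub, hlam_v, hlam_a, zero_sub]
  have hv0 : v ≠ 0 := by
    intro hz
    have : lam pa = 0 := by rw [hlam, hz]; simp
    rw [hlam_a] at this; exact hla_pos.ne' this
  -- the interpolation parameter
  set s := 2 * la / (la + lc) with hs
  have hsum_pos : 0 < la + lc := by linarith
  have hs_pos : 0 < s := by positivity
  have hs_le : s ≤ 1 := by rw [hs, div_le_one hsum_pos]; linarith
  -- the point `M` on the segment `[p_F(b), p_F(c)]`
  obtain ⟨M, hM⟩ : ∃ M : Fin 2 → ℝ, M = (1 - s) • pb + s • pc := ⟨_, rfl⟩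
  have hlam_M : lam M = la := by
    rw [hM, hlam_comb, hlam_b, hlam_c, hs]; field_simp; ring
  -- `M - p_F(a)` is parallel to `v`
  obtain ⟨m, hm⟩ : ∃ m : ℝ, M - pa = m • v := by
    apply exists_smul_of_cross_eq_zero hv0
    have := hlam_sub M pa; rw [hlam_M, hlam_a, sub_self, hlam] at this
    linarith
  -- support inequalities at `a`
  have hSa_b := (fermiPoint_support hD a b).1
  have hSa_c := (fermiPoint_support hD a c).1
  have hMa : (M - pa) ⬝ᵥ unitNormal u a 0 =
      (1 - s) * ((pb - pa) ⬝ᵥ unitNormal u a 0) + s * ((pc - pa) ⬝ᵥ unitNormal u a 0) := by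
    have : M - pa = (1 - s) • (pb - pa) + s • (pc - pa) := by
      rw [hM]; exact combo_sub_eq s pa pb pc
    rw [this, add_dotProduct, smul_dotProduct, smul_dotProduct, smul_eq_mul, smul_eq_mul]
  have hMa_le : (M - pa) ⬝ᵥ unitNormal u a 0 ≤ 0 := by
    rw [hMa]
    exact add_nonpos (mul_nonpos_of_nonneg_of_nonpos (by linarith) hSa_b)
      (mul_nonpos_of_nonneg_of_nonpos hs_pos.le hSa_c)
  -- support inequalities at `b + π` (`p_F(b+π) = -p_F(b)`, curve points `-p_F(a)`, `-p_F(d)`)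
  have hpbπ : fermiPoint u (b + π) = -pb := fermiPoint_add_pi hD b
  have hpaπ : fermiPoint u (a + π) = -pa := fermiPoint_add_pi hD a
  have hpdπ : fermiPoint u (d + π) = -pd := fermiPoint_add_pi hD d
  have hSb_a := (fermiPoint_support hD (b + π) (a + π)).1
  have hSb_d := (fermiPoint_support hD (b + π) (d + π)).1
  rw [hpbπ, hpaπ] at hSb_a
  rw [hpbπ, hpdπ] at hSb_d
  have hMb : (M - pa) ⬝ᵥ unitNormal u (b + π) 0 =
      (1 - s) * ((-pa - -pb) ⬝ᵥ unitNormal u (b + π) 0) + s * ((-pd - -pb) ⬝ᵥ unitNormal u (b + π) 0) := by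
    have hpd' : pd = pa + pb - pc := by rw [← hv, hv']; abel
    have : M - pa = (1 - s) • (-pa - -pb) + s • (-pd - -pb) := by
      rw [hM, hpd']; exact combo_sub_eq' s pa pb pc
    rw [this, add_dotProduct, smul_dotProduct, smul_dotProduct, smul_eq_mul, smul_eq_mul]
  have hMb_le : (M - pa) ⬝ᵥ unitNormal u (b + π) 0 ≤ 0 := by
    rw [hMb]
    exact add_nonpos (mul_nonpos_of_nonneg_of_nonpos (by linarith) hSb_a)
      (mul_nonpos_of_nonneg_of_nonpos hs_pos.le hSb_d)
  -- signs of `v · n(a)` and `v · n(b+π)`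
  have hne : Real.sin (a - b) ≠ 0 := hab.ne'
  have hva : 0 < v ⬝ᵥ unitNormal u a 0 := by
    have h1 := (fermiPoint_support hD a (b + π)).2 (torusDist_add_pi_pos hne)
    rw [hpbπ] at h1
    have : -pb - pa = -v := by rw [hv]; abel
    rw [this, neg_dotProduct] at h1
    linarith
  have hvb : v ⬝ᵥ unitNormal u (b + π) 0 < 0 := by
    have hd' : 0 < torusDist (a - (b + π)) := by
      rw [← torusDist_neg']; have := torusDist_add_pi_pos hne
      rwa [show -(a - (b + π)) = b + π - a by ring]
    have h1 := (fermiPoint_support hD (b + π) a).2 hd'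
    rw [hpbπ] at h1
    have : pa - -pb = v := by rw [hv]; abel
    rwa [this] at h1
  -- hence `m = 0` and `M = p_F(a)`
  have hm0 : m = 0 := by
    have h1 : m * (v ⬝ᵥ unitNormal u a 0) ≤ 0 := by
      have := hMa_le; rwa [hm, smul_dotProduct, smul_eq_mul] at this
    have h2 : m * (v ⬝ᵥ unitNormal u (b + π) 0) ≤ 0 := by
      have := hMb_le; rwa [hm, smul_dotProduct, smul_eq_mul] at this
    have hm_le : m ≤ 0 := by
      by_contra hcon
      have := mul_pos (not_le.1 hcon) hva
      linarith
    have hm_ge : 0 ≤ m := by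
      by_contra hcon
      have := mul_pos_of_neg_of_neg (not_le.1 hcon) hvb
      linarith
    linarith
  have hMa0 : (M - pa) ⬝ᵥ unitNormal u a 0 = 0 := by
    rw [hm, hm0, zero_smul, zero_dotProduct]
  -- strict convexity at `a` forces `p_F(c)·` term to vanish
  have hca : (pc - pa) ⬝ᵥ unitNormal u a 0 = 0 := by
    rw [hMa] at hMa0
    have h1 : (1 - s) * ((pb - pa) ⬝ᵥ unitNormal u a 0) ≤ 0 :=
      mul_nonpos_of_nonneg_of_nonpos (by linarith) hSa_b
    have h2 : s * ((pc - pa) ⬝ᵥ unitNormal u a 0) = 0 := by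
      have h3 : s * ((pc - pa) ⬝ᵥ unitNormal u a 0) ≤ 0 := mul_nonpos_of_nonneg_of_nonpos hs_pos.le hSa_c
      linarith
    rcases mul_eq_zero.1 h2 with h4 | h4
    · exact absurd h4 hs_pos.ne'
    · exact h4
  exact eq_mod_of_support_eq_zero hD hca

/-- Injectivity on one half of `𝒯`: two solutions of `p⃗_F(a) + p⃗_F(b) = p⃗_F(c) + p⃗_F(d)` with
`sin(a - b) > 0` and `sin(c - d) > 0` coincide modulo `2π`. [cite: BenfattoGiulianiMastropietro2003, §7.3 p.27 (L81–89)] -/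
private theorem fermiSum_inj_pos (hD : DispersionHyp ε μ e₀ u) {a b c d : ℝ}
    (hab : 0 < Real.sin (a - b)) (hcd : 0 < Real.sin (c - d))
    (h : fermiPoint u a + fermiPoint u b = fermiPoint u c + fermiPoint u d) :
    (∃ k : ℤ, c - a = k * (2 * π)) ∧ ∃ k : ℤ, d - b = k * (2 * π) := by
  have hca : ∃ k : ℤ, c - a = k * (2 * π) := by
    rcases le_total (u a 0 * u b 0 * Real.sin (a - b)) (u c 0 * u d 0 * Real.sin (c - d)) with hle | hle
    · exact fermiSum_inj_aux hD hab hcd h hle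
    · obtain ⟨k, hk⟩ := fermiSum_inj_aux hD hcd hab h.symm hle
      exact ⟨-k, by push_cast; linarith⟩
  obtain ⟨k, hk⟩ := hca
  refine ⟨⟨k, hk⟩, ?_⟩
  have hpc : fermiPoint u c = fermiPoint u a := by
    rw [show c = a + k * (2 * π) by linarith, fermiPoint_add_int_mul' hD]
  have hpd : fermiPoint u d = fermiPoint u b := by
    have := h; rw [hpc] at this; exact (add_left_cancel this).symm
  exact eq_mod_of_fermiPoint_eq hD hpd

/-- **The chord-sum map is two-to-one on `𝒯`** (§7.3, p.27 L81–89: each half of `𝒯` «is in a one to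
one correspondence through `F` with the open set `𝒟`»): if `(a, b) ∈ 𝒯` and
`p⃗_F(c) + p⃗_F(d) = p⃗_F(a) + p⃗_F(b)`, then `(c, d) ≡ (a, b)` or `(c, d) ≡ (b, a)` modulo `2π`
(no hypothesis on `(c, d)`: the degenerate sums `2p⃗_F(c)` and `0` are not chord sums of a proper
pair, by strict convexity and (A1.4)). [cite: BenfattoGiulianiMastropietro2003, §7.3 (A1.19)–(A1.21) p.27 (L68–89)] -/
theorem fermiSum_eq_cases (hD : DispersionHyp ε μ e₀ u) {a b c d : ℝ}
    (hab : (a, b) ∈ pairChartDomain)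
    (h : fermiPoint u c + fermiPoint u d = fermiPoint u a + fermiPoint u b) :
    ((∃ k : ℤ, c - a = k * (2 * π)) ∧ ∃ k : ℤ, d - b = k * (2 * π)) ∨
      ((∃ k : ℤ, c - b = k * (2 * π)) ∧ ∃ k : ℤ, d - a = k * (2 * π)) := by
  have hsin : Real.sin (a - b) ≠ 0 := hab
  by_cases hcd : Real.sin (c - d) = 0
  · -- degenerate `(c, d)`: impossible
    exfalso
    obtain ⟨n, hn⟩ := Real.sin_eq_zero_iff.1 hcd
    obtain ⟨m, hm | hm⟩ := Int.even_or_odd' n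
    · -- `c = d + 2πm`: `p_F(a) + p_F(b) = 2 p_F(d)`
      have hc : c = d + m * (2 * π) := by
        have : (n : ℝ) = 2 * m := by rw [hm]; push_cast; ring
        rw [this] at hn; linarith
      have hpc : fermiPoint u c = fermiPoint u d := by rw [hc, fermiPoint_add_int_mul' hD]
      have hS := (fermiPoint_support hD d a).1
      have hS' := (fermiPoint_support hD d b).1
      have hsum : (fermiPoint u a - fermiPoint u d) ⬝ᵥ unitNormal u d 0 +
          (fermiPoint u b - fermiPoint u d) ⬝ᵥ unitNormal u d 0 = 0 := by
        rw [← add_dotProduct]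
        have : fermiPoint u a - fermiPoint u d + (fermiPoint u b - fermiPoint u d) = 0 := by
          rw [← hpc]
          have := h; rw [hpc] at this ⊢
          rw [show fermiPoint u a - fermiPoint u d + (fermiPoint u b - fermiPoint u d) =
            (fermiPoint u a + fermiPoint u b) - (fermiPoint u d + fermiPoint u d) by abel, ← this, sub_self]
        rw [this, zero_dotProduct]
      have ha0 : (fermiPoint u a - fermiPoint u d) ⬝ᵥ unitNormal u d 0 = 0 := by linarith
      have hb0 : (fermiPoint u b - fermiPoint u d) ⬝ᵥ unitNormal u d 0 = 0 := by linarith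
      obtain ⟨ka, hka⟩ := eq_mod_of_support_eq_zero hD ha0
      obtain ⟨kb, hkb⟩ := eq_mod_of_support_eq_zero hD hb0
      apply hsin
      rw [show a - b = 0 + ((ka - kb : ℤ) : ℝ) * (2 * π) by push_cast; linarith,
        Real.sin_add_int_mul_two_pi, Real.sin_zero]
    · -- `c = d + π + 2πm`: `p_F(a) + p_F(b) = 0`
      have hc : c = d + π + m * (2 * π) := by
        have : (n : ℝ) = 2 * m + 1 := by rw [hm]; push_cast; ring
        rw [this] at hn; linarith
      have hpc : fermiPoint u c = -fermiPoint u d := by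
        rw [hc, fermiPoint_add_int_mul' hD, fermiPoint_add_pi hD]
      have hab0 : fermiPoint u a = fermiPoint u (b + π) := by
        rw [fermiPoint_add_pi hD]
        have := h; rw [hpc, neg_add_cancel] at this
        exact eq_neg_of_add_eq_zero_left this.symm
      obtain ⟨k, hk⟩ := eq_mod_of_fermiPoint_eq hD hab0
      apply hsin
      rw [show a - b = π + (k : ℝ) * (2 * π) by linarith, Real.sin_add_int_mul_two_pi, Real.sin_pi]
  · rcases lt_or_gt_of_ne hsin with hab_neg | hab_pos
    · rcases lt_or_gt_of_ne hcd with hcd_neg | hcd_pos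
      · -- both negative: apply the positive case to `(b, a)` and `(d, c)`
        left
        have hba : 0 < Real.sin (b - a) := by rw [← neg_sub, Real.sin_neg]; linarith
        have hdc : 0 < Real.sin (d - c) := by rw [← neg_sub, Real.sin_neg]; linarith
        obtain ⟨h1, h2⟩ := fermiSum_inj_pos hD hba hdc (by rw [add_comm, ← h, add_comm])
        exact ⟨h2, h1⟩
      · -- opposite signs: `(d, c)` is in the half of `(a, b)`… no: `(c,d)` positive, `(a,b)` negative;
        -- compare `(b, a)` (positive) with `(c, d)` (positive)
        right
        have hba : 0 < Real.sin (b - a) := by rw [← neg_sub, Real.sin_neg]; linarith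
        obtain ⟨h1, h2⟩ := fermiSum_inj_pos hD hba hcd_pos (by rw [add_comm, ← h])
        exact ⟨h1, h2⟩
    · rcases lt_or_gt_of_ne hcd with hcd_neg | hcd_pos
      · right
        have hdc : 0 < Real.sin (d - c) := by rw [← neg_sub, Real.sin_neg]; linarith
        obtain ⟨h1, h2⟩ := fermiSum_inj_pos hD hab_pos hdc (by rw [← h, add_comm])
        exact ⟨h2, h1⟩
      · left
        exact fermiSum_inj_pos hD hab_pos hcd_pos h.symm

end Injectivity

section Angles

variable {ε : (Fin 2 → ℝ) → ℝ} {μ e₀ : ℝ} {u : ℝ → ℝ → ℝ}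

/-- `‖θ - π‖_{𝕋¹} = π - ‖θ‖_{𝕋¹}`. [folklore] -/
private theorem torusDist_sub_pi (x : ℝ) : torusDist (x - π) = π - torusDist x := by
  obtain ⟨k, d, hx, hdπ, hd⟩ := torusDist_rep x
  rw [hd]
  rcases le_or_gt 0 d with h | h
  · have : x - π = (d - π) + k * (2 * π) := by rw [hx]; ring
    rw [this, torusDist_add_int_mul', torusDist_eq_abs' (by rw [abs_of_nonpos (by linarith [(abs_le.1 hdπ).2])]; linarith [(abs_le.1 hdπ).2]),
      abs_of_nonneg h, abs_of_nonpos (by linarith [(abs_le.1 hdπ).2])]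
    ring
  · have : x - π = (d + π) + (k - 1 : ℤ) * (2 * π) := by rw [hx]; push_cast; ring
    rw [this, torusDist_add_int_mul', torusDist_eq_abs' (by rw [abs_of_nonneg (by linarith [(abs_le.1 hdπ).1])]; linarith),
      abs_of_neg h, abs_of_nonneg (by linarith [(abs_le.1 hdπ).1])]
    ring

/-- `‖a + b‖_{𝕋¹} ≤ ‖a‖_{𝕋¹} + ‖b‖_{𝕋¹}`. [folklore] -/
private theorem torusDist_add_le' (a b : ℝ) : torusDist (a + b) ≤ torusDist a + torusDist b := by
  unfold torusDist; rw [AddCircle.coe_add]; exact norm_add_le _ _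

/-- `φ(θ₁,θ₂) = φ(θ₂,θ₁)`. [folklore] -/
private theorem pairAngle_comm' (θ₁ θ₂ : ℝ) : pairAngle θ₁ θ₂ = pairAngle θ₂ θ₁ := by
  rw [pairAngle, pairAngle, ← torusDist_neg' (θ₁ - θ₂), neg_sub]

/-- `0 ≤ φ ≤ π/2`, `φ ≤ ‖θ₁ - θ₂‖`. [folklore] -/
private theorem pairAngle_bounds (θ₁ θ₂ : ℝ) :
    0 ≤ pairAngle θ₁ θ₂ ∧ pairAngle θ₁ θ₂ ≤ π / 2 ∧ pairAngle θ₁ θ₂ ≤ torusDist (θ₁ - θ₂) := by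
  refine ⟨le_min (torusDist_nonneg _) (by linarith [torusDist_le_pi' (θ₁ - θ₂)]), ?_, min_le_left _ _⟩
  rw [pairAngle]
  rcases le_or_gt (torusDist (θ₁ - θ₂)) (π / 2) with h | h
  · exact (min_le_left _ _).trans h
  · exact (min_le_right _ _).trans (by linarith)

/-- `φ(θ, θ) = 0`. [folklore] -/
private theorem pairAngle_self' (θ : ℝ) : pairAngle θ θ = 0 := by
  have h := pairAngle_bounds θ θ
  rw [sub_self, torusDist_zero] at h
  linarith [h.1, h.2.2]

/-- `φ(θ₁ + 2πk, θ₂) = φ(θ₁, θ₂)`. [folklore] -/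
private theorem pairAngle_add_int_mul (θ₁ θ₂ : ℝ) (k : ℤ) : pairAngle (θ₁ + k * (2 * π)) θ₂ = pairAngle θ₁ θ₂ := by
  rw [pairAngle, pairAngle, show θ₁ + k * (2 * π) - θ₂ = (θ₁ - θ₂) + k * (2 * π) by ring, torusDist_add_int_mul']

/-- `|sin(θ₁ - θ₂)| ≤ φ(θ₁, θ₂)`. [folklore] -/
private theorem abs_sin_le_pairAngle (θ₁ θ₂ : ℝ) : |Real.sin (θ₁ - θ₂)| ≤ pairAngle θ₁ θ₂ := by
  refine le_min (abs_sin_le_torusDist _) ?_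
  have h := abs_sin_le_torusDist (θ₁ - θ₂ - π)
  rw [torusDist_sub_pi, Real.sin_sub_pi, abs_neg] at h
  exact h

/-- Jordan's inequality on the circle of length `π`: `(2/π) φ(θ₁,θ₂) ≤ |sin(θ₁ - θ₂)|`. [folklore] -/
private theorem pairAngle_le_abs_sin (θ₁ θ₂ : ℝ) : 2 / π * pairAngle θ₁ θ₂ ≤ |Real.sin (θ₁ - θ₂)| := by
  obtain ⟨k, d, hx, hdπ, hd⟩ := torusDist_rep (θ₁ - θ₂)
  rw [pairAngle, hd, hx, Real.sin_add_int_mul_two_pi]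
  -- `|sin d| = sin |d|` and Jordan on `[0, π]`
  have hsin : |Real.sin d| = Real.sin |d| := by
    rcases le_or_gt 0 d with h | h
    · rw [abs_of_nonneg h]
      exact abs_of_nonneg (Real.sin_nonneg_of_nonneg_of_le_pi h (by linarith [(abs_le.1 hdπ).2]))
    · rw [abs_of_neg h, Real.sin_neg]
      exact abs_of_nonpos (by
        have := Real.sin_nonneg_of_nonneg_of_le_pi (by linarith : 0 ≤ -d) (by linarith [(abs_le.1 hdπ).1])
        rw [Real.sin_neg] at this; linarith)
  rw [hsin]
  set y := |d| with hy
  have hy0 : 0 ≤ y := abs_nonneg _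
  rcases le_or_gt y (π / 2) with h | h
  · calc 2 / π * min y (π - y) ≤ 2 / π * y := mul_le_mul_of_nonneg_left (min_le_left _ _) (by positivity)
      _ ≤ Real.sin y := Real.mul_le_sin hy0 h
  · have h1 : 0 ≤ π - y := by linarith
    have h2 : π - y ≤ π / 2 := by linarith
    calc 2 / π * min y (π - y) ≤ 2 / π * (π - y) := mul_le_mul_of_nonneg_left (min_le_right _ _) (by positivity)
      _ ≤ Real.sin (π - y) := Real.mul_le_sin h1 h2
      _ = Real.sin y := Real.sin_pi_sub y

/-- `φ(θ₁, θ₂) > 0 ⟹ (θ₁, θ₂) ∈ 𝒯`. [folklore] -/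
private theorem mem_pairChartDomain_of_pos {θ₁ θ₂ : ℝ} (h : 0 < pairAngle θ₁ θ₂) : (θ₁, θ₂) ∈ pairChartDomain := by
  have h1 := pairAngle_le_abs_sin θ₁ θ₂
  have : 0 < |Real.sin (θ₁ - θ₂)| := lt_of_lt_of_le (by positivity) h1
  exact abs_pos.1 this

/-- `φ` is `1`-Lipschitz in its first argument modulo `2π`: `φ(θ₁', θ₂) ≤ φ(θ₁, θ₂) + ‖θ₁' - θ₁‖`. [folklore] -/
private theorem pairAngle_le_add_torusDist (θ₁ θ₁' θ₂ : ℝ) :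
    pairAngle θ₁' θ₂ ≤ pairAngle θ₁ θ₂ + torusDist (θ₁' - θ₁) := by
  have h1 : torusDist (θ₁' - θ₂) ≤ torusDist (θ₁ - θ₂) + torusDist (θ₁' - θ₁) := by
    have := torusDist_add_le' (θ₁ - θ₂) (θ₁' - θ₁)
    rwa [show θ₁ - θ₂ + (θ₁' - θ₁) = θ₁' - θ₂ by ring] at this
  have h2 : torusDist (θ₁ - θ₂) ≤ torusDist (θ₁' - θ₂) + torusDist (θ₁' - θ₁) := by
    have := torusDist_add_le' (θ₁' - θ₂) (-(θ₁' - θ₁))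
    rw [torusDist_neg'] at this
    rwa [show θ₁' - θ₂ + -(θ₁' - θ₁) = θ₁ - θ₂ by ring] at this
  unfold pairAngle
  rcases le_or_gt (torusDist (θ₁ - θ₂)) (π - torusDist (θ₁ - θ₂)) with h | h
  · rw [min_eq_left h]
    exact (min_le_left _ _).trans h1
  · rw [min_eq_right h.le]
    exact (min_le_right _ _).trans (by linarith)

/-- With `α` `c₂`-Lipschitz on `𝕋¹` and `α(θ+π) = α(θ)+π` (Lemma 7.1):
`|sin(α(t) - α(θ'))| ≤ c₂ φ(t, θ')`. [cite: BenfattoGiulianiMastropietro2003, §7.1 Lemma 7.1 (A1.9) p.26 (L54–63)] -/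
private theorem abs_sin_normalAngle_sub_le {c₂ : ℝ}
    (hlip : ∀ θ₁ θ₂ : ℝ, torusDist (normalAngle u θ₂ 0 - normalAngle u θ₁ 0) ≤ c₂ * torusDist (θ₂ - θ₁))
    (hpi : ∀ θ : ℝ, normalAngle u (θ + π) 0 = normalAngle u θ 0 + π) (t θ' : ℝ) :
    |Real.sin (normalAngle u t 0 - normalAngle u θ' 0)| ≤ c₂ * pairAngle t θ' := by
  have hc₂ : 0 ≤ c₂ := by
    have h := hlip 0 π
    have hπ : torusDist (π - 0) = π := by
      rw [sub_zero, torusDist_eq_abs' (by rw [abs_of_pos pi_pos]), abs_of_pos pi_pos]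
    rw [hπ] at h
    nlinarith [torusDist_nonneg (normalAngle u π 0 - normalAngle u 0 0), pi_pos]
  have h1 : |Real.sin (normalAngle u t 0 - normalAngle u θ' 0)| ≤ c₂ * torusDist (t - θ') :=
    (abs_sin_le_torusDist _).trans (hlip θ' t)
  have h2 : |Real.sin (normalAngle u t 0 - normalAngle u θ' 0)| ≤ c₂ * (π - torusDist (t - θ')) := by
    have h := (abs_sin_le_torusDist _).trans (hlip (θ' + π) t)
    rw [hpi θ', show normalAngle u t 0 - (normalAngle u θ' 0 + π) = normalAngle u t 0 - normalAngle u θ' 0 - π by ring,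
      Real.sin_sub_pi, abs_neg, show t - (θ' + π) = t - θ' - π by ring, torusDist_sub_pi] at h
    exact h
  unfold pairAngle
  rcases le_or_gt (torusDist (t - θ')) (π - torusDist (t - θ')) with h | h
  · rw [min_eq_left h]; exact h1
  · rw [min_eq_right h.le]; exact h2

end Angles

section Grid

variable {ε : (Fin 2 → ℝ) → ℝ} {μ e₀ : ℝ} {u : ℝ → ℝ → ℝ}

/-- `N w_n = 2^{n+1} · π/2^n = 2π`. [folklore] -/
private theorem sectorCount_mul_sectorWidth (n : ℕ) : (sectorCount n : ℝ) * sectorWidth n = 2 * π := by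
  rw [sectorCount, sectorWidth]; push_cast; rw [pow_succ]; field_simp

/-- `w_n = π 2^{-n} = π γ^{h/2}` (`γ = 4`, `h = -n`). [folklore] -/
private theorem sectorWidth_eq_zpow (n : ℕ) : sectorWidth n = π * (2 : ℝ) ^ (-(n : ℤ)) := by
  rw [sectorWidth, zpow_neg, zpow_natCast, div_eq_mul_inv]

open Classical in
/-- **Grid counting on the circle.** The number of sector centres `θ_{n,ω} = (ω + ½)w_n`,
`ω < N = 2^{n+1}`, within distance `D` of `θ*` modulo `2π` is at most `2D/w_n + 1`. [folklore] -/
private theorem card_centres_near_le (n : ℕ) (θs D : ℝ) (hD0 : 0 ≤ D) :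
    ((Finset.univ.filter (fun a : Fin (sectorCount n) =>
        ∃ k : ℤ, |sectorCenter n a - θs - k * (2 * π)| ≤ D)).card : ℝ) ≤ 2 * D / sectorWidth n + 1 := by
  classical
  set w := sectorWidth n with hw
  have hwpos : 0 < w := sectorWidth_pos n
  set N := sectorCount n with hN
  have hNw : (N : ℝ) * w = 2 * π := sectorCount_mul_sectorWidth n
  set W := Finset.univ.filter (fun a : Fin (sectorCount n) => ∃ k : ℤ, |sectorCenter n a - θs - k * (2 * π)| ≤ D)
    with hW
  -- the chosen winding numbers
  have hk : ∀ a ∈ W, ∃ k : ℤ, |sectorCenter n a - θs - k * (2 * π)| ≤ D := fun a ha =>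
    (Finset.mem_filter.1 ha).2
  choose! kf hkf using hk
  -- the injection into an integer interval
  set lo : ℤ := ⌈(θs - D) / w - 1 / 2⌉ with hlo
  set hi : ℤ := ⌊(θs + D) / w - 1 / 2⌋ with hhi
  set f : Fin (sectorCount n) → ℤ := fun a => (a : ℤ) - kf a * N with hf
  have hcen : ∀ a : Fin (sectorCount n), sectorCenter n a = ((a : ℕ) + 1 / 2 : ℝ) * w := fun a => rfl
  have hmaps : Set.MapsTo f W (Finset.Icc lo hi) := by
    intro a ha
    have h := hkf a ha
    rw [hcen] at h
    have hval : ((f a : ℝ) + 1 / 2) * w = ((a : ℕ) + 1 / 2 : ℝ) * w - kf a * (2 * π) := by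
      rw [hf]; push_cast; rw [← hNw]; ring
    have h1 : θs - D ≤ ((f a : ℝ) + 1 / 2) * w := by rw [hval]; linarith [(abs_le.1 h).1]
    have h2 : ((f a : ℝ) + 1 / 2) * w ≤ θs + D := by rw [hval]; linarith [(abs_le.1 h).2]
    rw [Finset.coe_Icc, Set.mem_Icc]
    constructor
    · rw [hlo]
      apply Int.ceil_le.2
      have : (θs - D) / w ≤ (f a : ℝ) + 1 / 2 := by rw [div_le_iff₀ hwpos]; exact h1
      linarith
    · rw [hhi]
      apply Int.le_floor.2
      have : (f a : ℝ) + 1 / 2 ≤ (θs + D) / w := by rw [le_div_iff₀ hwpos]; exact h2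
      linarith
  have hinj : Set.InjOn f W := by
    intro a ha b hb hab
    simp only [hf] at hab
    have hlt_a : ((a : ℕ) : ℤ) < N := by exact_mod_cast a.isLt
    have hlt_b : ((b : ℕ) : ℤ) < N := by exact_mod_cast b.isLt
    have h0a : (0 : ℤ) ≤ (a : ℕ) := by positivity
    have h0b : (0 : ℤ) ≤ (b : ℕ) := by positivity
    have hdiff : ((a : ℕ) : ℤ) - (b : ℕ) = (kf a - kf b) * N := by linarith
    have hk0 : kf a - kf b = 0 := by
      have hNpos : (0 : ℤ) < N := by exact_mod_cast sectorCount_pos n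
      have h1 : |(kf a - kf b) * (N : ℤ)| < N := by
        rw [← hdiff, abs_lt]; constructor <;> linarith
      rw [abs_mul, abs_of_pos hNpos] at h1
      have : |kf a - kf b| < 1 := by
        by_contra hcon
        have h2 := not_lt.1 hcon
        nlinarith
      exact Int.abs_lt_one_iff.1 this
    have : ((a : ℕ) : ℤ) = (b : ℕ) := by rw [hk0, zero_mul] at hdiff; linarith
    exact Fin.ext (by exact_mod_cast this)
  have hcard := Finset.card_le_card_of_injOn f hmaps hinj
  rw [Int.card_Icc] at hcard
  have hreal : ((hi + 1 - lo).toNat : ℝ) ≤ 2 * D / w + 1 := by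
    rcases le_or_gt (hi + 1 - lo) 0 with hneg | hpos
    · rw [Int.toNat_of_nonpos hneg]; push_cast; positivity
    · have : ((hi + 1 - lo).toNat : ℤ) = hi + 1 - lo := Int.toNat_of_nonneg hpos.le
      have h1 : ((hi + 1 - lo).toNat : ℝ) = (hi : ℝ) + 1 - lo := by exact_mod_cast this
      rw [h1]
      have hhi' : (hi : ℝ) ≤ (θs + D) / w - 1 / 2 := Int.floor_le _
      have hlo' : (θs - D) / w - 1 / 2 ≤ (lo : ℝ) := Int.le_ceil _
      have : (θs + D) / w - 1 / 2 - ((θs - D) / w - 1 / 2) = 2 * D / w := by field_simp; ring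
      linarith
  exact (Nat.cast_le.2 hcard).trans hreal

end Grid

section GridMore

variable {ε : (Fin 2 → ℝ) → ℝ} {μ e₀ : ℝ} {u : ℝ → ℝ → ℝ}

open Classical in
/-- Grid counting, torus-distance form: at most `2D/w_n + 1` centres within `‖·‖_{𝕋¹}`-distance `D`
of `θ*`. [folklore] -/
private theorem card_centres_torus_le (n : ℕ) (θs D : ℝ) (hD0 : 0 ≤ D) :
    ((Finset.univ.filter (fun a : Fin (sectorCount n) =>
        torusDist (sectorCenter n a - θs) ≤ D)).card : ℝ) ≤ 2 * D / sectorWidth n + 1 := by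
  refine le_trans ?_ (card_centres_near_le n θs D hD0)
  have hsub : Finset.univ.filter (fun a : Fin (sectorCount n) => torusDist (sectorCenter n a - θs) ≤ D) ⊆
      Finset.univ.filter (fun a : Fin (sectorCount n) =>
        ∃ k : ℤ, |sectorCenter n a - θs - k * (2 * π)| ≤ D) := by
    intro a ha
    rw [Finset.mem_filter] at ha ⊢
    exact ⟨ha.1, round ((2 * π)⁻¹ * (sectorCenter n a - θs)), by rw [← torusDist_eq_abs_sub_round']; exact ha.2⟩
  exact_mod_cast Finset.card_le_card hsub

open Classical in
/-- Grid counting modulo `π`: at most `2(2D/w_n + 1)` centres with `φ(θ_{n,ω}, θ*) ≤ D`. [folklore] -/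
private theorem card_centres_modpi_le (n : ℕ) (θs D : ℝ) (hD0 : 0 ≤ D) :
    ((Finset.univ.filter (fun a : Fin (sectorCount n) =>
        pairAngle (sectorCenter n a) θs ≤ D)).card : ℝ) ≤ 2 * (2 * D / sectorWidth n + 1) := by
  have h1 := card_centres_torus_le n θs D hD0
  have h2 := card_centres_torus_le n (θs + π) D hD0
  have hsub : Finset.univ.filter (fun a : Fin (sectorCount n) => pairAngle (sectorCenter n a) θs ≤ D) ⊆
      Finset.univ.filter (fun a : Fin (sectorCount n) => torusDist (sectorCenter n a - θs) ≤ D) ∪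
      Finset.univ.filter (fun a : Fin (sectorCount n) => torusDist (sectorCenter n a - (θs + π)) ≤ D) := by
    intro a ha
    rw [Finset.mem_filter] at ha
    rw [Finset.mem_union, Finset.mem_filter, Finset.mem_filter]
    have h := ha.2
    unfold pairAngle at h
    rcases min_le_iff.1 h with h' | h'
    · exact Or.inl ⟨Finset.mem_univ _, h'⟩
    · right
      refine ⟨Finset.mem_univ _, ?_⟩
      rw [show sectorCenter n a - (θs + π) = sectorCenter n a - θs - π by ring, torusDist_sub_pi]
      exact h'
  calc ((Finset.univ.filter (fun a : Fin (sectorCount n) => pairAngle (sectorCenter n a) θs ≤ D)).card : ℝ)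
      ≤ ((Finset.univ.filter (fun a : Fin (sectorCount n) => torusDist (sectorCenter n a - θs) ≤ D) ∪
          Finset.univ.filter (fun a : Fin (sectorCount n) =>
            torusDist (sectorCenter n a - (θs + π)) ≤ D)).card : ℝ) := by
        exact_mod_cast Finset.card_le_card hsub
    _ ≤ ((Finset.univ.filter (fun a : Fin (sectorCount n) => torusDist (sectorCenter n a - θs) ≤ D)).card : ℝ) +
          ((Finset.univ.filter (fun a : Fin (sectorCount n) =>
            torusDist (sectorCenter n a - (θs + π)) ≤ D)).card : ℝ) := by
        exact_mod_cast Finset.card_union_le _ _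
    _ ≤ 2 * (2 * D / sectorWidth n + 1) := by linarith

/-- The Fermi point at a sector centre belongs to that sector: `p⃗_F(θ_{h,ω}) ∈ S_{h,ω}`
(`ζ_{h,ω}(θ_{h,ω}) = 1`, plateau of the partition of unity). [cite: BenfattoGiulianiMastropietro2003, §2.6 (3.44a) p.13 (L101–106)] -/
private theorem fermiPoint_centre_mem_sSector (hD : DispersionHyp ε μ e₀ u) (n a : ℕ) :
    fermiPoint u (sectorCenter n a) ∈ sSector u e₀ n a := by
  refine ⟨sectorCenter n a, 0, ?_, ?_, rfl⟩
  · rw [abs_zero]; exact mul_nonneg (zpow_nonneg (by norm_num) _) hD.e₀_pos.le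
  · have h1 : sectorWeightCirc n (a : ℤ) (sectorCenter n a) = 1 := by
      apply sectorWeightCirc_eq_one (k := 0)
      rw [sectorCenter, Int.cast_natCast]
      have := (sectorWidth_pos n).le
      simp only [Int.cast_zero, mul_zero, sub_self, abs_zero]
      positivity
    rw [h1]; exact one_ne_zero

/-- `γ^{-h'/2}`-bookkeeping: `2^{-n} = 2^{n'-n} · 2^{-n'}` for `n ≤ n'`. [folklore] -/
private theorem zpow_split {n n' : ℕ} (hn : n ≤ n') :
    (2 : ℝ) ^ (-(n : ℤ)) = (2 : ℝ) ^ (n' - n) * (2 : ℝ) ^ (-(n' : ℤ)) := by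
  obtain ⟨d, rfl⟩ := Nat.exists_eq_add_of_le hn
  rw [Nat.add_sub_cancel_left, ← zpow_natCast, ← zpow_add₀ (by norm_num : (2 : ℝ) ≠ 0)]
  congr 1; push_cast; ring

open Classical in
/-- **(s1.23), counting form.** The number of scale-`h'` sectors contained in a given scale-`h`
sector is at most `3 γ^{(h-h')/2} = 3 · 2^{n'-n}`: such a sector contains its own Fermi centre point,
which by Lemma 7.2 lies within `πγ^{h/2}` of the coarse centre. [cite: BenfattoGiulianiMastropietro2003, §7.4 (s1.23) p.28 (L33–36)] -/
private theorem card_refinements_le (hD : DispersionHyp ε μ e₀ u) {n n' : ℕ} (hn : n ≤ n') {ωc : ℕ}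
    (hωc : ωc < sectorCount n) :
    (Finset.univ.filter (fun a : Fin (sectorCount n') => sSector u e₀ n' a ⊆ sSector u e₀ n ωc)).card ≤
      3 * 2 ^ (n' - n) := by
  obtain ⟨c, -, h72⟩ := lemma72_sectorPolar_holds ε μ e₀ u hD
  have h0 := abs_zero_le_e₀ hD
  obtain ⟨cu, hcu, hu⟩ := hD.u_pos
  set D := π * (2 : ℝ) ^ (-(n : ℤ)) with hDdef
  have hD0 : 0 ≤ D := by positivity
  have hsub : Finset.univ.filter (fun a : Fin (sectorCount n') => sSector u e₀ n' a ⊆ sSector u e₀ n ωc) ⊆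
      Finset.univ.filter (fun a : Fin (sectorCount n') => torusDist (sectorCenter n' a - sectorCenter n ωc) ≤ D) := by
    intro a ha
    rw [Finset.mem_filter] at ha ⊢
    refine ⟨ha.1, ?_⟩
    have hmem : fermiPoint u (sectorCenter n' a) ∈ sSector u e₀ n ωc := ha.2 (fermiPoint_centre_mem_sSector hD n' a)
    have hupos : 0 < u (sectorCenter n' a) 0 := lt_of_lt_of_le hcu (hu _ 0 h0)
    exact (h72 n ωc hωc _ hmem (u (sectorCenter n' a) 0) (sectorCenter n' a) hupos rfl).2
  have h1 := Finset.card_le_card hsub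
  have h2 := card_centres_torus_le n' (sectorCenter n ωc) D hD0
  have h3 : 2 * D / sectorWidth n' + 1 = 2 * (2 : ℝ) ^ (n' - n) + 1 := by
    rw [hDdef, sectorWidth_eq_zpow, zpow_split hn]
    have : (2 : ℝ) ^ (-(n' : ℤ)) ≠ 0 := (zpow_pos (by norm_num) _).ne'
    field_simp
  rw [h3] at h2
  have h4 : ((Finset.univ.filter (fun a : Fin (sectorCount n') => sSector u e₀ n' a ⊆ sSector u e₀ n ωc)).card : ℝ)
      ≤ 2 * (2 : ℝ) ^ (n' - n) + 1 := (Nat.cast_le.2 h1).trans h2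
  have h5 : (2 : ℝ) * 2 ^ (n' - n) + 1 ≤ 3 * 2 ^ (n' - n) := by
    have : (1 : ℝ) ≤ 2 ^ (n' - n) := one_le_pow₀ (by norm_num)
    linarith
  exact_mod_cast h4.trans h5

end GridMore

section Estimates

variable {ε : (Fin 2 → ℝ) → ℝ} {μ e₀ : ℝ} {u : ℝ → ℝ → ℝ}

/-- Components of a frame displacement `x n⃗(θ) + y τ⃗(θ)` are bounded by `|x| + |y|`. [folklore] -/
private theorem abs_frame_comb_apply_le {θ : ℝ} (hu : 0 < u θ 0) (x y : ℝ) (i : Fin 2) :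
    |(x • unitNormal u θ 0 + y • unitTangent u θ 0) i| ≤ |x| + |y| := by
  rw [unitNormal_angle' hu, unitTangent_angle' hu]
  have hc := Real.abs_cos_le_one (normalAngle u θ 0)
  have hs := Real.abs_sin_le_one (normalAngle u θ 0)
  fin_cases i
  · simp only [Pi.add_apply, Pi.smul_apply, smul_eq_mul, Fin.zero_eta, Matrix.cons_val_zero]
    calc |x * Real.cos (normalAngle u θ 0) + y * -Real.sin (normalAngle u θ 0)|
        ≤ |x * Real.cos (normalAngle u θ 0)| + |y * -Real.sin (normalAngle u θ 0)| := abs_add_le _ _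
      _ ≤ |x| + |y| := by
        rw [abs_mul, abs_mul, abs_neg]
        exact add_le_add (mul_le_of_le_one_right (abs_nonneg _) hc) (mul_le_of_le_one_right (abs_nonneg _) hs)
  · simp only [Pi.add_apply, Pi.smul_apply, smul_eq_mul, Fin.mk_one, Matrix.cons_val_one, Matrix.cons_val_zero]
    calc |x * Real.sin (normalAngle u θ 0) + y * Real.cos (normalAngle u θ 0)|
        ≤ |x * Real.sin (normalAngle u θ 0)| + |y * Real.cos (normalAngle u θ 0)| := abs_add_le _ _
      _ ≤ |x| + |y| := by
        rw [abs_mul, abs_mul]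
        exact add_le_add (mul_le_of_le_one_right (abs_nonneg _) hs) (mul_le_of_le_one_right (abs_nonneg _) hc)

/-- `|p⃗_F(θ) i| ≤ u(θ)`. [folklore] -/
private theorem abs_fermiPoint_apply_le {θ : ℝ} (hu : 0 ≤ u θ 0) (i : Fin 2) : |fermiPoint u θ i| ≤ u θ 0 := by
  rw [fermiPoint_eq, Pi.smul_apply, smul_eq_mul, abs_mul, abs_of_nonneg hu]
  exact mul_le_of_le_one_right hu (abs_dir_le_one θ i)

/-- `p⃗_F(θ_m) ∧ p⃗_F(θ₀) = u(θ_m)u(θ₀) sin(θ₀ - θ_m)`. [folklore] -/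
private theorem det_fermiPoint (u : ℝ → ℝ → ℝ) (a b : ℝ) :
    fermiPoint u a 0 * fermiPoint u b 1 - fermiPoint u a 1 * fermiPoint u b 0 = u a 0 * u b 0 * Real.sin (b - a) := by
  simp [fermiPoint, levelPoint, dir, Real.sin_sub]; ring

/-- **(s1.33)–(s1.34), the wedge argument.** If `L` momenta `k⃗^{(m)} = p⃗_F(θ_m) + O(δ)` sum to zero
and all angles but `θ_{i₁}` are within `φ₀` of `θ_{k₀}` modulo `π` (`δ ≤ φ₀`), then wedging the
conservation law with `p⃗_F(θ_{k₀})` gives `|p⃗_F(θ_{i₁}) ∧ p⃗_F(θ_{k₀})| ≤ cLφ₀`, hence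
`φ(θ_{i₁}, θ_{k₀}) ≤ C_w L φ₀` with `C_w = (π/2)(M² + 4M)/c_u²`. [cite: BenfattoGiulianiMastropietro2003, §7.4 (s1.33)–(s1.34) p.28 (L70–80)] -/
private theorem wedge_bound (hD : DispersionHyp ε μ e₀ u) {cu M : ℝ} (hcu : 0 < cu)
    (huB : ∀ θ : ℝ, cu ≤ u θ 0 ∧ u θ 0 ≤ M)
    {L : ℕ} (i₁ k₀ : Fin L) (θ : Fin L → ℝ) (k : Fin L → (Fin 2 → ℝ)) (x y : Fin L → ℝ)
    (hsum : ∑ m, k m = 0)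
    (hdec : ∀ m, k m = fermiPoint u (θ m) + (x m • unitNormal u (θ m) 0 + y m • unitTangent u (θ m) 0))
    {δ φ₀ : ℝ} (hδ : ∀ m, |x m| + |y m| ≤ 2 * δ) (hδφ : δ ≤ φ₀) (hφ₀ : 0 ≤ φ₀)
    (hclose : ∀ m, m ≠ i₁ → pairAngle (θ m) (θ k₀) ≤ φ₀) :
    pairAngle (θ i₁) (θ k₀) ≤ π / 2 * ((M ^ 2 + 4 * M) / cu ^ 2) * L * φ₀ := by
  have _ := hD.e₀_pos
  have hM : 0 < M := lt_of_lt_of_le hcu ((huB 0).1.trans (huB 0).2)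
  have hupos : ∀ s, 0 < u s 0 := fun s => lt_of_lt_of_le hcu (huB s).1
  set p₀ := fermiPoint u (θ k₀) with hp₀
  set D : Fin L → ℝ := fun m => k m 0 * p₀ 1 - k m 1 * p₀ 0 with hDdef
  -- (1) the wedged conservation law
  have hDsum : ∑ m, D m = 0 := by
    have h0 : ∑ m, k m 0 = 0 := by rw [← Finset.sum_apply, hsum]; rfl
    have h1 : ∑ m, k m 1 = 0 := by rw [← Finset.sum_apply, hsum]; rfl
    simp only [hDdef, Finset.sum_sub_distrib, ← Finset.sum_mul, h0, h1, zero_mul, sub_self]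
  -- (2) per-leg structure: `D m = u_m u₀ sin(θ₀ - θ_m) + (displacement ∧ p₀)`
  have hp₀i : ∀ i, |p₀ i| ≤ M := fun i => (abs_fermiPoint_apply_le (hupos _).le i).trans (huB _).2
  have hDm : ∀ m, |D m - u (θ m) 0 * u (θ k₀) 0 * Real.sin (θ k₀ - θ m)| ≤ 4 * δ * M := by
    intro m
    set d := x m • unitNormal u (θ m) 0 + y m • unitTangent u (θ m) 0 with hd
    have hkm : k m = fermiPoint u (θ m) + d := hdec m
    have hrew : D m - u (θ m) 0 * u (θ k₀) 0 * Real.sin (θ k₀ - θ m) = d 0 * p₀ 1 - d 1 * p₀ 0 := by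
      rw [hDdef, ← det_fermiPoint u (θ m) (θ k₀)]
      simp only [hkm, Pi.add_apply, hp₀]; ring
    rw [hrew]
    have hd0 := abs_frame_comb_apply_le (hupos (θ m)) (x m) (y m) 0
    have hd1 := abs_frame_comb_apply_le (hupos (θ m)) (x m) (y m) 1
    rw [← hd] at hd0 hd1
    calc |d 0 * p₀ 1 - d 1 * p₀ 0| ≤ |d 0 * p₀ 1| + |d 1 * p₀ 0| := abs_sub _ _
      _ = |d 0| * |p₀ 1| + |d 1| * |p₀ 0| := by rw [abs_mul, abs_mul]
      _ ≤ (|x m| + |y m|) * M + (|x m| + |y m|) * M :=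
          add_le_add (mul_le_mul hd0 (hp₀i 1) (abs_nonneg _) (by positivity))
            (mul_le_mul hd1 (hp₀i 0) (abs_nonneg _) (by positivity))
      _ ≤ 2 * δ * M + 2 * δ * M := by nlinarith [hδ m]
      _ = 4 * δ * M := by ring
  -- (3) legs `m ≠ i₁`
  have hother : ∀ m, m ≠ i₁ → |D m| ≤ (M ^ 2 + 4 * M) * φ₀ := by
    intro m hm
    have h1 := hDm m
    have h2 : |u (θ m) 0 * u (θ k₀) 0 * Real.sin (θ k₀ - θ m)| ≤ M ^ 2 * φ₀ := by
      rw [abs_mul, abs_mul, abs_of_pos (hupos _), abs_of_pos (hupos _)]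
      have hs : |Real.sin (θ k₀ - θ m)| ≤ φ₀ := by
        rw [show θ k₀ - θ m = -(θ m - θ k₀) by ring, Real.sin_neg, abs_neg]
        exact (abs_sin_le_pairAngle _ _).trans (hclose m hm)
      calc u (θ m) 0 * u (θ k₀) 0 * |Real.sin (θ k₀ - θ m)| ≤ M * M * φ₀ := by
            apply mul_le_mul (mul_le_mul (huB _).2 (huB _).2 (hupos _).le hM.le) hs (abs_nonneg _) (by positivity)
        _ = M ^ 2 * φ₀ := by ring
    have h3 := abs_sub_abs_le_abs_sub (D m) (u (θ m) 0 * u (θ k₀) 0 * Real.sin (θ k₀ - θ m))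
    nlinarith [h1, h2, h3, hM.le]
  -- (4) the fixed leg
  have hsplit : D i₁ = -∑ m ∈ Finset.univ.erase i₁, D m := by
    have := Finset.add_sum_erase Finset.univ D (Finset.mem_univ i₁)
    linarith
  have hL1 : (1 : ℝ) ≤ L := by
    have : 1 ≤ L := Nat.succ_le_of_lt (Fin.pos i₁)
    exact_mod_cast this
  have hcardE : ((Finset.univ.erase i₁).card : ℝ) = L - 1 := by
    rw [Finset.card_erase_of_mem (Finset.mem_univ i₁), Finset.card_univ, Fintype.card_fin]
    have : 1 ≤ L := Nat.succ_le_of_lt (Fin.pos i₁)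
    rw [Nat.cast_sub this, Nat.cast_one]
  have hi₁ : |D i₁| ≤ (L - 1) * ((M ^ 2 + 4 * M) * φ₀) := by
    rw [hsplit, abs_neg]
    calc |∑ m ∈ Finset.univ.erase i₁, D m| ≤ ∑ m ∈ Finset.univ.erase i₁, |D m| := Finset.abs_sum_le_sum_abs _ _
      _ ≤ ∑ _m ∈ Finset.univ.erase i₁, (M ^ 2 + 4 * M) * φ₀ :=
          Finset.sum_le_sum fun m hm => hother m (Finset.ne_of_mem_erase hm)
      _ = ((Finset.univ.erase i₁).card : ℝ) * ((M ^ 2 + 4 * M) * φ₀) := by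
          rw [Finset.sum_const, nsmul_eq_mul]
      _ = (L - 1) * ((M ^ 2 + 4 * M) * φ₀) := by rw [hcardE]
  have hmain : u (θ i₁) 0 * u (θ k₀) 0 * |Real.sin (θ k₀ - θ i₁)| ≤ (L - 1) * ((M ^ 2 + 4 * M) * φ₀) + 4 * δ * M := by
    have h1 := hDm i₁
    have h3 := abs_sub_abs_le_abs_sub (u (θ i₁) 0 * u (θ k₀) 0 * Real.sin (θ k₀ - θ i₁)) (D i₁)
    rw [abs_sub_comm] at h1
    rw [← abs_of_pos (hupos (θ i₁)), ← abs_of_pos (hupos (θ k₀)), ← abs_mul, ← abs_mul]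
    linarith
  -- (5) Jordan: `(2/π) c_u² φ(θ_{i₁}, θ₀) ≤ u u₀ |sin|`
  have hJ : cu ^ 2 * (2 / π * pairAngle (θ i₁) (θ k₀)) ≤ u (θ i₁) 0 * u (θ k₀) 0 * |Real.sin (θ k₀ - θ i₁)| := by
    have h1 := pairAngle_le_abs_sin (θ i₁) (θ k₀)
    rw [show θ k₀ - θ i₁ = -(θ i₁ - θ k₀) by ring, Real.sin_neg, abs_neg]
    have hφ : 0 ≤ 2 / π * pairAngle (θ i₁) (θ k₀) :=
      mul_nonneg (by positivity) (pairAngle_bounds (θ i₁) (θ k₀)).1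
    calc cu ^ 2 * (2 / π * pairAngle (θ i₁) (θ k₀)) = cu * cu * (2 / π * pairAngle (θ i₁) (θ k₀)) := by ring
      _ ≤ u (θ i₁) 0 * u (θ k₀) 0 * |Real.sin (θ i₁ - θ k₀)| :=
          mul_le_mul (mul_le_mul (huB _).1 (huB _).1 hcu.le (hupos _).le) h1 hφ
            (mul_nonneg (hupos _).le (hupos _).le)
  have hcu2 : 0 < cu ^ 2 := by positivity
  -- combine
  have hfin : cu ^ 2 * (2 / π * pairAngle (θ i₁) (θ k₀)) ≤ L * (M ^ 2 + 4 * M) * φ₀ := by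
    have h4M : 4 * δ * M ≤ 4 * M * φ₀ := by nlinarith
    have h5 : 4 * M * φ₀ ≤ (M ^ 2 + 4 * M) * φ₀ := by nlinarith [sq_nonneg M]
    have h6 : ((L : ℝ) - 1) * ((M ^ 2 + 4 * M) * φ₀) + (M ^ 2 + 4 * M) * φ₀ = L * (M ^ 2 + 4 * M) * φ₀ := by
      ring
    linarith [hJ, hmain]
  have hφpos := (pairAngle_bounds (θ i₁) (θ k₀)).1
  rw [show π / 2 * ((M ^ 2 + 4 * M) / cu ^ 2) * L * φ₀ = (L * (M ^ 2 + 4 * M) * φ₀) / (cu ^ 2 * (2 / π)) by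
    field_simp]
  rw [le_div_iff₀ (by positivity)]
  linarith

/-- **(s1.38)–(s1.40), the displacement box.** For a string as in `wedge_bound`, the chord-sum
`R⃗ = Σ_m p⃗_F(θ_m) = -Σ_m (k⃗^{(m)} - p⃗_F(θ_m))` has, in the frame at `θ_{k₀}`, normal component
`≤ K₁ L δ₂ φ₀` and tangential component `≤ 2 L δ₂`: the normal components of the sector
displacements are `O(γ^{h'}) + O(γ^{h'/2})·sin(α_m - α₀)` and `|sin(α_m - α₀)| ≤ c₂ φ(θ_m, θ₀)`
(Lemma 7.1). [cite: BenfattoGiulianiMastropietro2003, §7.4 (s1.38)–(s1.40) p.28 (L81–101)] -/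
private theorem string_box (hD : DispersionHyp ε μ e₀ u) {c₂ : ℝ}
    (hlip : ∀ θ₁ θ₂ : ℝ, torusDist (normalAngle u θ₂ 0 - normalAngle u θ₁ 0) ≤ c₂ * torusDist (θ₂ - θ₁))
    (hpi : ∀ θ : ℝ, normalAngle u (θ + π) 0 = normalAngle u θ 0 + π) (hc₂ : 0 ≤ c₂)
    {L : ℕ} (i₁ k₀ : Fin L) (θ : Fin L → ℝ) (k : Fin L → (Fin 2 → ℝ)) (x y : Fin L → ℝ)
    (hsum : ∑ m, k m = 0)
    (hdec : ∀ m, k m = fermiPoint u (θ m) + (x m • unitNormal u (θ m) 0 + y m • unitTangent u (θ m) 0))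
    {δ₁ δ₂ φ₀ Cw : ℝ} (hx : ∀ m, |x m| ≤ δ₁) (hy : ∀ m, |y m| ≤ δ₂) (hδ₁₂ : δ₁ ≤ δ₂) (hδ₁ : δ₁ ≤ δ₂ * φ₀)
    (hδ₂ : 0 ≤ δ₂) (hφ₀ : 0 ≤ φ₀)
    (hclose : ∀ m, m ≠ i₁ → pairAngle (θ m) (θ k₀) ≤ φ₀)
    (hwedge : pairAngle (θ i₁) (θ k₀) ≤ Cw * L * φ₀) :
    |(∑ m, fermiPoint u (θ m)) ⬝ᵥ unitNormal u (θ k₀) 0| ≤ (2 + c₂ * (1 + Cw)) * L * δ₂ * φ₀ ∧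
      |(∑ m, fermiPoint u (θ m)) ⬝ᵥ unitTangent u (θ k₀) 0| ≤ 2 * L * δ₂ := by
  have h0 := abs_zero_le_e₀ hD
  obtain ⟨cu, hcu, hu⟩ := hD.u_pos
  have hupos : ∀ s, 0 < u s 0 := fun s => lt_of_lt_of_le hcu (hu s 0 h0)
  set d : Fin L → (Fin 2 → ℝ) := fun m => x m • unitNormal u (θ m) 0 + y m • unitTangent u (θ m) 0 with hd
  have hR : ∑ m, fermiPoint u (θ m) = -∑ m, d m := by
    have : ∑ m, k m = ∑ m, fermiPoint u (θ m) + ∑ m, d m := by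
      rw [← Finset.sum_add_distrib]; exact Finset.sum_congr rfl fun m _ => hdec m
    rw [hsum] at this
    exact eq_neg_of_add_eq_zero_left this.symm
  have hL1 : (1 : ℝ) ≤ L := by
    have : 1 ≤ L := Nat.succ_le_of_lt (Fin.pos i₁)
    exact_mod_cast this
  set n₀ := unitNormal u (θ k₀) 0 with hn₀
  set τ₀ := unitTangent u (θ k₀) 0 with hτ₀
  -- normal components of the displacements
  have hdn : ∀ m, |d m ⬝ᵥ n₀| ≤ δ₁ + δ₂ * (c₂ * pairAngle (θ m) (θ k₀)) := by
    intro m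
    have hexp : d m ⬝ᵥ n₀ = x m * Real.cos (normalAngle u (θ m) 0 - normalAngle u (θ k₀) 0) +
        y m * -Real.sin (normalAngle u (θ m) 0 - normalAngle u (θ k₀) 0) := by
      rw [hd]; simp only [add_dotProduct, smul_dotProduct, smul_eq_mul]
      rw [hn₀, normal_dot_normal' (hupos _) (hupos _), tangent_dot_normal' (hupos _) (hupos _)]
    rw [hexp]
    have h1 : |x m * Real.cos (normalAngle u (θ m) 0 - normalAngle u (θ k₀) 0)| ≤ δ₁ := by
      rw [abs_mul]; exact (mul_le_of_le_one_right (abs_nonneg _) (Real.abs_cos_le_one _)).trans (hx m)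
    have h2 : |y m * -Real.sin (normalAngle u (θ m) 0 - normalAngle u (θ k₀) 0)| ≤
        δ₂ * (c₂ * pairAngle (θ m) (θ k₀)) := by
      rw [abs_mul, abs_neg]
      exact mul_le_mul (hy m) (abs_sin_normalAngle_sub_le hlip hpi _ _) (abs_nonneg _) hδ₂
    exact (abs_add_le _ _).trans (add_le_add h1 h2)
  -- tangential components
  have hdt : ∀ m, |d m ⬝ᵥ τ₀| ≤ δ₁ + δ₂ := by
    intro m
    have hexp : d m ⬝ᵥ τ₀ = x m * Real.sin (normalAngle u (θ m) 0 - normalAngle u (θ k₀) 0) +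
        y m * Real.cos (normalAngle u (θ m) 0 - normalAngle u (θ k₀) 0) := by
      rw [hd]; simp only [add_dotProduct, smul_dotProduct, smul_eq_mul]
      rw [hτ₀, normal_dot_tangent' (hupos _) (hupos _), tangent_dot_tangent' (hupos _) (hupos _)]
    rw [hexp]
    have h1 : |x m * Real.sin (normalAngle u (θ m) 0 - normalAngle u (θ k₀) 0)| ≤ δ₁ := by
      rw [abs_mul]; exact (mul_le_of_le_one_right (abs_nonneg _) (Real.abs_sin_le_one _)).trans (hx m)
    have h2 : |y m * Real.cos (normalAngle u (θ m) 0 - normalAngle u (θ k₀) 0)| ≤ δ₂ := by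
      rw [abs_mul]; exact (mul_le_of_le_one_right (abs_nonneg _) (Real.abs_cos_le_one _)).trans (hy m)
    exact (abs_add_le _ _).trans (add_le_add h1 h2)
  constructor
  · rw [hR, neg_dotProduct, abs_neg, sum_dotProduct]
    have hsplit := Finset.add_sum_erase Finset.univ (fun m => d m ⬝ᵥ n₀) (Finset.mem_univ i₁)
    rw [← hsplit]
    have hA : |d i₁ ⬝ᵥ n₀| ≤ δ₁ + δ₂ * (c₂ * (Cw * L * φ₀)) :=
      (hdn i₁).trans (by gcongr)
    have hB : |∑ m ∈ Finset.univ.erase i₁, d m ⬝ᵥ n₀| ≤ L * (δ₁ + δ₂ * (c₂ * φ₀)) := by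
      calc |∑ m ∈ Finset.univ.erase i₁, d m ⬝ᵥ n₀| ≤ ∑ m ∈ Finset.univ.erase i₁, |d m ⬝ᵥ n₀| :=
            Finset.abs_sum_le_sum_abs _ _
        _ ≤ ∑ _m ∈ Finset.univ.erase i₁, (δ₁ + δ₂ * (c₂ * φ₀)) :=
            Finset.sum_le_sum fun m hm => (hdn m).trans (by
              gcongr; exact hclose m (Finset.ne_of_mem_erase hm))
        _ = ((Finset.univ.erase i₁).card : ℝ) * (δ₁ + δ₂ * (c₂ * φ₀)) := by
            rw [Finset.sum_const, nsmul_eq_mul]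
        _ ≤ L * (δ₁ + δ₂ * (c₂ * φ₀)) := by
            have hc : ((Finset.univ.erase i₁).card : ℝ) ≤ L := by
              have : (Finset.univ.erase i₁).card ≤ L := (Finset.card_erase_le).trans (by simp)
              exact_mod_cast this
            have hnn : 0 ≤ δ₁ + δ₂ * (c₂ * φ₀) := add_nonneg ((abs_nonneg _).trans (hx i₁)) (by positivity)
            exact mul_le_mul_of_nonneg_right hc hnn
    calc |d i₁ ⬝ᵥ n₀ + ∑ m ∈ Finset.univ.erase i₁, d m ⬝ᵥ n₀|
        ≤ |d i₁ ⬝ᵥ n₀| + |∑ m ∈ Finset.univ.erase i₁, d m ⬝ᵥ n₀| := abs_add_le _ _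
      _ ≤ (δ₁ + δ₂ * (c₂ * (Cw * L * φ₀))) + L * (δ₁ + δ₂ * (c₂ * φ₀)) := add_le_add hA hB
      _ ≤ (2 + c₂ * (1 + Cw)) * L * δ₂ * φ₀ := by
          have h1 : δ₁ ≤ L * (δ₂ * φ₀) := hδ₁.trans (le_mul_of_one_le_left (by positivity) hL1)
          nlinarith [hδ₂, hφ₀, hc₂, hL1, h1, hδ₁]
  · rw [hR, neg_dotProduct, abs_neg, sum_dotProduct]
    calc |∑ m, d m ⬝ᵥ τ₀| ≤ ∑ m, |d m ⬝ᵥ τ₀| := Finset.abs_sum_le_sum_abs _ _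
      _ ≤ ∑ _m : Fin L, (δ₁ + δ₂) := Finset.sum_le_sum fun m _ => hdt m
      _ = L * (δ₁ + δ₂) := by rw [Finset.sum_const, nsmul_eq_mul, Finset.card_univ, Fintype.card_fin]
      _ ≤ 2 * L * δ₂ := by nlinarith [hL1, hδ₁₂]

/-- **The solved pair is pinned (Lemma 7.5 + two-to-one).** If two chord sums differ by a vector
`r⃗` which, in the frame at `θ̄₁ = a₀`, has `|r₁| ≤ c₁ηφ₀`, `|r₂| ≤ η ≤ c₂φ₀`, `η ≤ η₀`
(`φ₀ = φ(a₀, b₀) > 0`), then Lemma 7.5 produces a solution `O(η)`-close to `(a₀, b₀)` and the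
two-to-one property of the chord-sum map identifies it with `(a, b)` up to exchange. [cite: BenfattoGiulianiMastropietro2003, §7.4 (s1.42) p.28 (L102–125)] -/
private theorem solved_pair_near (hD : DispersionHyp ε μ e₀ u) {c₁' c₀ c₂' η₀ : ℝ}
    (h75 : ∀ θ₁' θ₂' η r₁ r₂ : ℝ, (θ₁', θ₂') ∈ pairChartDomain →
        |r₁| ≤ c₁' * η * pairAngle θ₁' θ₂' → |r₂| ≤ η → η ≤ c₂' * pairAngle θ₁' θ₂' → η ≤ η₀ →
          fermiPoint u θ₁' + fermiPoint u θ₂' + (r₁ • unitNormal u θ₁' 0 + r₂ • unitTangent u θ₁' 0)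
              ∈ pairRange u ∧
          ∃ θ₁ θ₂ : ℝ,
            fermiPoint u θ₁' + fermiPoint u θ₂' + (r₁ • unitNormal u θ₁' 0 + r₂ • unitTangent u θ₁' 0) =
              fermiPoint u θ₁ + fermiPoint u θ₂ ∧
            |θ₁ - θ₁'| ≤ c₀ * η ∧ |θ₂ - θ₂'| ≤ c₀ * η)
    {a b a₀ b₀ η : ℝ} (r : Fin 2 → ℝ)
    (hF : fermiPoint u a + fermiPoint u b = fermiPoint u a₀ + fermiPoint u b₀ + r)
    (hφ₀ : 0 < pairAngle a₀ b₀) (hab : 0 < pairAngle a b)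
    (hr₁ : |r ⬝ᵥ unitNormal u a₀ 0| ≤ c₁' * η * pairAngle a₀ b₀) (hr₂ : |r ⬝ᵥ unitTangent u a₀ 0| ≤ η)
    (hη : η ≤ c₂' * pairAngle a₀ b₀) (hη₀ : η ≤ η₀) :
    (torusDist (a - a₀) ≤ c₀ * η ∧ torusDist (b - b₀) ≤ c₀ * η) ∨
      (torusDist (a - b₀) ≤ c₀ * η ∧ torusDist (b - a₀) ≤ c₀ * η) := by
  have h0 := abs_zero_le_e₀ hD
  obtain ⟨cu, hcu, hu⟩ := hD.u_pos
  have hupos : ∀ s, 0 < u s 0 := fun s => lt_of_lt_of_le hcu (hu s 0 h0)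
  have hframe := frame_decomp' (hupos a₀) r
  obtain ⟨-, θ₁, θ₂, hsol, h₁, h₂⟩ := h75 a₀ b₀ η (r ⬝ᵥ unitNormal u a₀ 0) (r ⬝ᵥ unitTangent u a₀ 0)
    (mem_pairChartDomain_of_pos hφ₀) hr₁ hr₂ hη hη₀
  rw [← hframe, ← hF] at hsol
  have hmod : ∀ {s t v : ℝ} (k : ℤ), s - t = k * (2 * π) → torusDist (t - v) ≤ |s - v| := by
    intro s t v k hk
    have : t - v = (s - v) + (-k : ℤ) * (2 * π) := by push_cast; linarith
    rw [this, torusDist_add_int_mul']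
    exact torusDist_le_abs' _
  rcases fermiSum_eq_cases hD (mem_pairChartDomain_of_pos hab) hsol.symm with ⟨⟨k₁, hk₁⟩, ⟨k₂, hk₂⟩⟩ | ⟨⟨k₁, hk₁⟩, ⟨k₂, hk₂⟩⟩
  · left
    exact ⟨(hmod k₁ hk₁).trans h₁, (hmod k₂ hk₂).trans h₂⟩
  · right
    exact ⟨(hmod k₂ hk₂).trans h₂, (hmod k₁ hk₁).trans h₁⟩

end Estimates

section Strings

variable {ε : (Fin 2 → ℝ) → ℝ} {μ e₀ : ℝ} {u : ℝ → ℝ → ℝ}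

/-- The data of a sector string: momenta `k⃗^{(m)} ∈ S_{h',ω_m}` summing to zero, each written in
the frame at its sector centre by Lemma 7.3, `k⃗^{(m)} = p⃗_F(θ_m) + x_m n⃗(θ_m) + y_m τ⃗(θ_m)`,
`|x_m| ≤ cγ^{h'}`, `|y_m| ≤ cγ^{h'/2}` ((s1.34a)). [cite: BenfattoGiulianiMastropietro2003, §7.4 (s1.31), (s1.34a) p.28 (L60–69)] -/
private theorem string_data (hD : DispersionHyp ε μ e₀ u) {c₃ : ℝ}
    (h73 : ∀ (n ω : ℕ), ω < sectorCount n → ∀ p ∈ sSector u e₀ n ω,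
      ∃ k₁ k₂ : ℝ,
        p = fermiPoint u (sectorCenter n ω) + k₁ • unitNormal u (sectorCenter n ω) 0 +
              k₂ • unitTangent u (sectorCenter n ω) 0 ∧
        |k₁| ≤ c₃ * (4 : ℝ) ^ (-(n : ℤ)) ∧ |k₂| ≤ c₃ * (2 : ℝ) ^ (-(n : ℤ)) ∧
        |fderiv ℝ ε p (unitTangent u (sectorCenter n ω) 0)| ≤ c₃ * (2 : ℝ) ^ (-(n : ℤ)))
    {n n' L : ℕ} {i₁ : Fin L} {ω₁ : ℕ} {ωt : Fin L → ℕ} {ω : Fin L → Fin (sectorCount n')}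
    (hω : ω ∈ sectorStrings u e₀ n n' L i₁ ω₁ ωt) :
    ∃ (k : Fin L → (Fin 2 → ℝ)) (x y : Fin L → ℝ), ∑ m, k m = 0 ∧
      (∀ m, k m = fermiPoint u (sectorCenter n' (ω m)) +
        (x m • unitNormal u (sectorCenter n' (ω m)) 0 + y m • unitTangent u (sectorCenter n' (ω m)) 0)) ∧
      (∀ m, |x m| ≤ c₃ * (4 : ℝ) ^ (-(n' : ℤ))) ∧ ∀ m, |y m| ≤ c₃ * (2 : ℝ) ^ (-(n' : ℤ)) := by
  have _ := hD.e₀_pos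
  obtain ⟨-, -, k, hk, hsum⟩ := hω
  have h : ∀ m : Fin L, ∃ k₁ k₂ : ℝ,
      k m = fermiPoint u (sectorCenter n' (ω m)) + k₁ • unitNormal u (sectorCenter n' (ω m)) 0 +
              k₂ • unitTangent u (sectorCenter n' (ω m)) 0 ∧
        |k₁| ≤ c₃ * (4 : ℝ) ^ (-(n' : ℤ)) ∧ |k₂| ≤ c₃ * (2 : ℝ) ^ (-(n' : ℤ)) := by
    intro m
    obtain ⟨k₁, k₂, h1, h2, h3, -⟩ := h73 n' (ω m) (ω m).isLt (k m) (hk m)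
    exact ⟨k₁, k₂, h1, h2, h3⟩
  choose x y hxy using h
  exact ⟨k, x, y, hsum, fun m => by rw [(hxy m).1, add_assoc], fun m => (hxy m).2.1, fun m => (hxy m).2.2⟩

/-- The per-string estimates of §7.4 combined: for a string whose maximal pair (among the legs
`≠ i₁`) is `(i, j)` with `φ(θ_i, θ_j) ≤ φ₀`, the chord-sum `R⃗ = Σ_m p⃗_F(θ_m)` has normal component
`≤ K₁ L δ₂ φ₀` and tangential component `≤ 2Lδ₂` in the frame at `θ_{k₀}` ((s1.33)–(s1.40)). [cite: BenfattoGiulianiMastropietro2003, §7.4 (s1.33)–(s1.40) p.28 (L70–101)] -/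
private theorem string_estimates (hD : DispersionHyp ε μ e₀ u) {cu M c₂ Cw : ℝ} (hcu : 0 < cu)
    (huB : ∀ θ : ℝ, cu ≤ u θ 0 ∧ u θ 0 ≤ M)
    (hlip : ∀ θ₁ θ₂ : ℝ, torusDist (normalAngle u θ₂ 0 - normalAngle u θ₁ 0) ≤ c₂ * torusDist (θ₂ - θ₁))
    (hpi : ∀ θ : ℝ, normalAngle u (θ + π) 0 = normalAngle u θ 0 + π) (hc₂ : 0 ≤ c₂)
    (hCw : Cw = π / 2 * ((M ^ 2 + 4 * M) / cu ^ 2))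
    {L : ℕ} {i₁ i j k₀ : Fin L} (hk₀ : k₀ ≠ i₁)
    (θ : Fin L → ℝ) (θ₀ : ℝ) (hθ₀ : θ k₀ = θ₀) (k : Fin L → (Fin 2 → ℝ)) (x y : Fin L → ℝ)
    (hsum : ∑ m, k m = 0)
    (hdec : ∀ m, k m = fermiPoint u (θ m) + (x m • unitNormal u (θ m) 0 + y m • unitTangent u (θ m) 0))
    {δ₁ δ₂ φ₀ : ℝ} (hx : ∀ m, |x m| ≤ δ₁) (hy : ∀ m, |y m| ≤ δ₂) (hδ₁₂ : δ₁ ≤ δ₂) (hδ₁ : δ₁ ≤ δ₂ * φ₀)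
    (hδ₂φ : δ₂ ≤ φ₀) (hδ₂ : 0 ≤ δ₂)
    (hMP : ∀ m l : Fin L, m ≠ i₁ → l ≠ i₁ → pairAngle (θ m) (θ l) ≤ pairAngle (θ i) (θ j))
    (hφ : pairAngle (θ i) (θ j) ≤ φ₀) :
    |(∑ m, fermiPoint u (θ m)) ⬝ᵥ unitNormal u θ₀ 0| ≤ (2 + c₂ * (1 + Cw)) * L * δ₂ * φ₀ ∧
      |(∑ m, fermiPoint u (θ m)) ⬝ᵥ unitTangent u θ₀ 0| ≤ 2 * L * δ₂ := by
  subst hθ₀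
  have hclose : ∀ m, m ≠ i₁ → pairAngle (θ m) (θ k₀) ≤ φ₀ := fun m hm => (hMP m k₀ hm hk₀).trans hφ
  have hφ₀ : 0 ≤ φ₀ := (pairAngle_bounds (θ i) (θ j)).1.trans hφ
  have hwedge := wedge_bound hD hcu huB i₁ k₀ θ k x y hsum hdec (δ := δ₂) (φ₀ := φ₀)
    (fun m => by linarith [hx m, hy m]) hδ₂φ hφ₀ hclose
  rw [← hCw] at hwedge
  exact string_box hD hlip hpi hc₂ i₁ k₀ θ k x y hsum hdec hx hy hδ₁₂ hδ₁ hδ₂ hφ₀ hclose hwedge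

end Strings

section Fibre

variable {ε : (Fin 2 → ℝ) → ℝ} {μ e₀ : ℝ} {u : ℝ → ℝ → ℝ}

/-- `(4)^{-n} = 2^{-n} 2^{-n}`. [folklore] -/
private theorem four_zpow_neg (n : ℕ) : (4 : ℝ) ^ (-(n : ℤ)) = (2 : ℝ) ^ (-(n : ℤ)) * (2 : ℝ) ^ (-(n : ℤ)) := by
  rw [← mul_zpow]; norm_num

/-- Frame change `θ_{k₀} → θ_{a₀}` plus Lemma 7.5 plus two-to-one: if the difference `r⃗` of two
chord sums has `|r⃗·n⃗(θ_c)| ≤ 2K₁Lδ₂φ₀`, `|r⃗·τ⃗(θ_c)| ≤ 4Lδ₂` with `φ(θ_c, a₀) ≤ φ₀ = φ(a₀,b₀)`,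
then in the frame at `a₀` it satisfies the hypotheses of Lemma 7.5 with `η = K₂Lδ₂`,
`K₂ = K₁π + 4`, `c₁ = (2K₁ + 4c₂)/K₂`, and the solved pair is pinned up to exchange. [cite: BenfattoGiulianiMastropietro2003, §7.4 (s1.40)–(s1.42) p.28 (L95–125)] -/
private theorem pair_pinned (hD : DispersionHyp ε μ e₀ u) {c₂ K₁ K₂ c₀ c₂' η₀ : ℝ}
    (hlip : ∀ θ₁ θ₂ : ℝ, torusDist (normalAngle u θ₂ 0 - normalAngle u θ₁ 0) ≤ c₂ * torusDist (θ₂ - θ₁))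
    (hpi : ∀ θ : ℝ, normalAngle u (θ + π) 0 = normalAngle u θ 0 + π) (hc₂ : 0 ≤ c₂) (hK₁0 : 0 ≤ K₁)
    (hK₂ : K₂ = K₁ * π + 4)
    (h75 : ∀ θ₁' θ₂' η r₁ r₂ : ℝ, (θ₁', θ₂') ∈ pairChartDomain →
        |r₁| ≤ (2 * K₁ + 4 * c₂) / K₂ * η * pairAngle θ₁' θ₂' → |r₂| ≤ η → η ≤ c₂' * pairAngle θ₁' θ₂' →
          η ≤ η₀ →
          fermiPoint u θ₁' + fermiPoint u θ₂' + (r₁ • unitNormal u θ₁' 0 + r₂ • unitTangent u θ₁' 0)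
              ∈ pairRange u ∧
          ∃ θ₁ θ₂ : ℝ,
            fermiPoint u θ₁' + fermiPoint u θ₂' + (r₁ • unitNormal u θ₁' 0 + r₂ • unitTangent u θ₁' 0) =
              fermiPoint u θ₁ + fermiPoint u θ₂ ∧
            |θ₁ - θ₁'| ≤ c₀ * η ∧ |θ₂ - θ₂'| ≤ c₀ * η)
    {a b a₀ b₀ θc Lr δ₂ : ℝ} (hLr : 0 ≤ Lr) (hδ₂ : 0 ≤ δ₂) (r : Fin 2 → ℝ)
    (hF : fermiPoint u a + fermiPoint u b = fermiPoint u a₀ + fermiPoint u b₀ + r)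
    (hφ₀pos : 0 < pairAngle a₀ b₀) (habpos : 0 < pairAngle a b)
    (hrn₀ : |r ⬝ᵥ unitNormal u θc 0| ≤ 2 * K₁ * Lr * δ₂ * pairAngle a₀ b₀)
    (hrτ₀ : |r ⬝ᵥ unitTangent u θc 0| ≤ 4 * Lr * δ₂)
    (hθc : pairAngle θc a₀ ≤ pairAngle a₀ b₀)
    (hη : K₂ * Lr * δ₂ ≤ c₂' * pairAngle a₀ b₀) (hη₀ : K₂ * Lr * δ₂ ≤ η₀) :
    (torusDist (a - a₀) ≤ c₀ * (K₂ * Lr * δ₂) ∧ torusDist (b - b₀) ≤ c₀ * (K₂ * Lr * δ₂)) ∨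
      (torusDist (a - b₀) ≤ c₀ * (K₂ * Lr * δ₂) ∧ torusDist (b - a₀) ≤ c₀ * (K₂ * Lr * δ₂)) := by
  have h0 := abs_zero_le_e₀ hD
  obtain ⟨cu, hcu, hu⟩ := hD.u_pos
  have hupos : ∀ s, 0 < u s 0 := fun s => lt_of_lt_of_le hcu (hu s 0 h0)
  have hK₂pos : 0 < K₂ := by rw [hK₂]; positivity
  set φ₀ := pairAngle a₀ b₀ with hφ₀
  have hφ₀le : φ₀ ≤ π / 2 := (pairAngle_bounds _ _).2.1
  have hφ₀nn : 0 ≤ φ₀ := (pairAngle_bounds _ _).1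
  have hA0 : 0 ≤ 2 * K₁ * Lr * δ₂ := mul_nonneg (mul_nonneg (by positivity) hLr) hδ₂
  have hA1 : 0 ≤ 2 * K₁ * Lr * δ₂ * φ₀ := mul_nonneg hA0 hφ₀nn
  have hB0 : 0 ≤ 4 * Lr * δ₂ := mul_nonneg (mul_nonneg (by norm_num) hLr) hδ₂
  set n₀ := unitNormal u θc 0 with hn₀
  set τ₀ := unitTangent u θc 0 with hτ₀
  set nA := unitNormal u a₀ 0 with hnA
  set τA := unitTangent u a₀ 0 with hτA
  have hframe := frame_decomp' (hupos θc) r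
  rw [← hn₀, ← hτ₀] at hframe
  have hcos1 : |n₀ ⬝ᵥ nA| ≤ 1 := by
    rw [hn₀, hnA, normal_dot_normal' (hupos _) (hupos _)]; exact Real.abs_cos_le_one _
  have hcos2 : |n₀ ⬝ᵥ τA| ≤ 1 := by
    rw [hn₀, hτA, normal_dot_tangent' (hupos _) (hupos _)]; exact Real.abs_sin_le_one _
  have hcos3 : |τ₀ ⬝ᵥ τA| ≤ 1 := by
    rw [hτ₀, hτA, tangent_dot_tangent' (hupos _) (hupos _)]; exact Real.abs_cos_le_one _
  have hsin : |τ₀ ⬝ᵥ nA| ≤ c₂ * φ₀ := by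
    rw [hτ₀, hnA, tangent_dot_normal' (hupos _) (hupos _), abs_neg]
    exact (abs_sin_normalAngle_sub_le hlip hpi _ _).trans (mul_le_mul_of_nonneg_left hθc hc₂)
  have hr₁ : |r ⬝ᵥ nA| ≤ (2 * K₁ + 4 * c₂) / K₂ * (K₂ * Lr * δ₂) * φ₀ := by
    have hexp : r ⬝ᵥ nA = (r ⬝ᵥ n₀) * (n₀ ⬝ᵥ nA) + (r ⬝ᵥ τ₀) * (τ₀ ⬝ᵥ nA) := by
      conv_lhs => rw [hframe]
      rw [add_dotProduct, smul_dotProduct, smul_dotProduct, smul_eq_mul, smul_eq_mul]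
    rw [hexp]
    have h1 : |(r ⬝ᵥ n₀) * (n₀ ⬝ᵥ nA)| ≤ 2 * K₁ * Lr * δ₂ * φ₀ := by
      rw [abs_mul]
      calc |r ⬝ᵥ n₀| * |n₀ ⬝ᵥ nA| ≤ (2 * K₁ * Lr * δ₂ * φ₀) * 1 :=
            mul_le_mul hrn₀ hcos1 (abs_nonneg _) hA1
        _ = 2 * K₁ * Lr * δ₂ * φ₀ := mul_one _
    have h2 : |(r ⬝ᵥ τ₀) * (τ₀ ⬝ᵥ nA)| ≤ 4 * Lr * δ₂ * (c₂ * φ₀) := by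
      rw [abs_mul]; exact mul_le_mul hrτ₀ hsin (abs_nonneg _) hB0
    have h3 : (2 * K₁ + 4 * c₂) / K₂ * (K₂ * Lr * δ₂) * φ₀ = 2 * K₁ * Lr * δ₂ * φ₀ + 4 * Lr * δ₂ * (c₂ * φ₀) := by
      rw [div_mul_eq_mul_div, show (2 * K₁ + 4 * c₂) * (K₂ * Lr * δ₂) / K₂ =
        (2 * K₁ + 4 * c₂) * (Lr * δ₂) * (K₂ / K₂) by ring, div_self hK₂pos.ne']
      ring
    rw [h3]
    exact (abs_add_le _ _).trans (add_le_add h1 h2)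
  have hr₂ : |r ⬝ᵥ τA| ≤ K₂ * Lr * δ₂ := by
    have hexp : r ⬝ᵥ τA = (r ⬝ᵥ n₀) * (n₀ ⬝ᵥ τA) + (r ⬝ᵥ τ₀) * (τ₀ ⬝ᵥ τA) := by
      conv_lhs => rw [hframe]
      rw [add_dotProduct, smul_dotProduct, smul_dotProduct, smul_eq_mul, smul_eq_mul]
    rw [hexp]
    have h1 : |(r ⬝ᵥ n₀) * (n₀ ⬝ᵥ τA)| ≤ 2 * K₁ * Lr * δ₂ * φ₀ := by
      rw [abs_mul]
      calc |r ⬝ᵥ n₀| * |n₀ ⬝ᵥ τA| ≤ (2 * K₁ * Lr * δ₂ * φ₀) * 1 :=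
            mul_le_mul hrn₀ hcos2 (abs_nonneg _) hA1
        _ = 2 * K₁ * Lr * δ₂ * φ₀ := mul_one _
    have h2 : |(r ⬝ᵥ τ₀) * (τ₀ ⬝ᵥ τA)| ≤ 4 * Lr * δ₂ := by
      rw [abs_mul]
      calc |r ⬝ᵥ τ₀| * |τ₀ ⬝ᵥ τA| ≤ (4 * Lr * δ₂) * 1 := mul_le_mul hrτ₀ hcos3 (abs_nonneg _) hB0
        _ = 4 * Lr * δ₂ := mul_one _
    have h3 : 2 * K₁ * Lr * δ₂ * φ₀ + 4 * Lr * δ₂ ≤ K₂ * Lr * δ₂ := by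
      rw [hK₂]
      have h4 : 2 * K₁ * Lr * δ₂ * φ₀ ≤ 2 * K₁ * Lr * δ₂ * (π / 2) :=
        mul_le_mul_of_nonneg_left hφ₀le hA0
      have h5 : 2 * K₁ * Lr * δ₂ * (π / 2) + 4 * Lr * δ₂ = (K₁ * π + 4) * Lr * δ₂ := by ring
      linarith
    exact ((abs_add_le _ _).trans (add_le_add h1 h2)).trans h3
  exact solved_pair_near hD h75 r hF hφ₀pos habpos hr₁ hr₂ hη hη₀

/-- Arithmetic of the small-`h'` regime: `η₀ < K₂ L c₃ t` gives `(2/t)² ≤ (4c₃²K₂²/η₀²) L²`. [folklore] -/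
private theorem trivial_regime_bound {t η₀ K₂ c₃ Lr : ℝ} (ht : 0 < t) (hη₀ : 0 < η₀)
    (hlt : η₀ < K₂ * Lr * (c₃ * t)) : (2 / t) ^ 2 ≤ 4 * c₃ ^ 2 * K₂ ^ 2 / η₀ ^ 2 * Lr ^ 2 := by
  have h1 : 2 / t < 2 * c₃ * K₂ * Lr / η₀ := by
    rw [div_lt_div_iff₀ ht hη₀]
    have : K₂ * Lr * (c₃ * t) * 2 = 2 * c₃ * K₂ * Lr * t := by ring
    linarith
  have h2 : 0 < 2 / t := by positivity
  calc (2 / t) ^ 2 ≤ (2 * c₃ * K₂ * Lr / η₀) ^ 2 := pow_le_pow_left₀ h2.le h1.le 2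
    _ = 4 * c₃ ^ 2 * K₂ ^ 2 / η₀ ^ 2 * Lr ^ 2 := by field_simp; ring

/-- **The fibre over the free legs, far part `𝒜_>` (s1.26).** Fix the sectors of all legs except the
solved pair `(i, j)` (the function `ρ`). Among the pairs `(ω_i, ω_j)` completing `ρ` to a string
in which `(i, j)` is the maximal pair and `φ(θ_i, θ_j) > Φ = K_Φ L γ^{h'/2}`, at most `cL²` occur:
with `(a₀, b₀)` the completing pair of maximal `φ = φ₀`, every other completing pair gives a chord
sum differing from `p⃗_F(θ_{a₀}) + p⃗_F(θ_{b₀})` by `r⃗` with `|r₁| ≤ cLφ₀γ^{h'/2}`,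
`|r₂| ≤ cLγ^{h'/2}` ((s1.40)); Lemma 7.5 and the two-to-one property of the chord-sum map pin
`(θ_a, θ_b)` to within `c₀η = O(Lγ^{h'/2})` of `(θ_{a₀}, θ_{b₀})` up to exchange, i.e. to `O(L)`
grid points each. If `η = K₂Lc γ^{h'/2} > η₀` the trivial bound `|O_{h'}|² ≤ cL²` applies. [cite: BenfattoGiulianiMastropietro2003, §7.4 (s1.26)–(s1.42) p.28 (L44–125)] -/
private theorem fibre_large (hD : DispersionHyp ε μ e₀ u) {cu M c₂ c₃ Cw K₁ K₂ c₀ c₂' η₀ : ℝ}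
    (hcu : 0 < cu) (huB : ∀ θ : ℝ, cu ≤ u θ 0 ∧ u θ 0 ≤ M)
    (hlip : ∀ θ₁ θ₂ : ℝ, torusDist (normalAngle u θ₂ 0 - normalAngle u θ₁ 0) ≤ c₂ * torusDist (θ₂ - θ₁))
    (hpi : ∀ θ : ℝ, normalAngle u (θ + π) 0 = normalAngle u θ 0 + π) (hc₂ : 0 ≤ c₂) (hc₃ : 0 < c₃)
    (h73 : ∀ (n ω : ℕ), ω < sectorCount n → ∀ p ∈ sSector u e₀ n ω,
      ∃ k₁ k₂ : ℝ,
        p = fermiPoint u (sectorCenter n ω) + k₁ • unitNormal u (sectorCenter n ω) 0 +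
              k₂ • unitTangent u (sectorCenter n ω) 0 ∧
        |k₁| ≤ c₃ * (4 : ℝ) ^ (-(n : ℤ)) ∧ |k₂| ≤ c₃ * (2 : ℝ) ^ (-(n : ℤ)) ∧
        |fderiv ℝ ε p (unitTangent u (sectorCenter n ω) 0)| ≤ c₃ * (2 : ℝ) ^ (-(n : ℤ)))
    (hCw : Cw = π / 2 * ((M ^ 2 + 4 * M) / cu ^ 2)) (hK₁ : K₁ = 2 + c₂ * (1 + Cw)) (hK₁0 : 0 ≤ K₁)
    (hK₂ : K₂ = K₁ * π + 4) (hc₀ : 0 < c₀) (hc₂' : 0 < c₂') (hη₀ : 0 < η₀)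
    (h75 : ∀ θ₁' θ₂' η r₁ r₂ : ℝ, (θ₁', θ₂') ∈ pairChartDomain →
        |r₁| ≤ (2 * K₁ + 4 * c₂) / K₂ * η * pairAngle θ₁' θ₂' → |r₂| ≤ η → η ≤ c₂' * pairAngle θ₁' θ₂' →
          η ≤ η₀ →
          fermiPoint u θ₁' + fermiPoint u θ₂' + (r₁ • unitNormal u θ₁' 0 + r₂ • unitTangent u θ₁' 0)
              ∈ pairRange u ∧
          ∃ θ₁ θ₂ : ℝ,
            fermiPoint u θ₁' + fermiPoint u θ₂' + (r₁ • unitNormal u θ₁' 0 + r₂ • unitTangent u θ₁' 0) =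
              fermiPoint u θ₁ + fermiPoint u θ₂ ∧
            |θ₁ - θ₁'| ≤ c₀ * η ∧ |θ₂ - θ₂'| ≤ c₀ * η)
    {n n' L : ℕ} {i₁ i j k₀ : Fin L} (hij : i ≠ j) (hi : i ≠ i₁)
    (hk₀i : k₀ ≠ i) (hk₀j : k₀ ≠ j) (hk₀ : k₀ ≠ i₁)
    {ω₁ : ℕ} {ωt : Fin L → ℕ} (ρ : Fin L → Fin (sectorCount n')) {Φ : ℝ}
    (hΦ : Φ = max (c₃ * K₂ / c₂') (max c₃ 1) * L * (2 : ℝ) ^ (-(n' : ℤ)))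
    (E : Finset (Fin (sectorCount n') × Fin (sectorCount n')))
    (hE : ∀ ab ∈ E,
        Φ < pairAngle (sectorCenter n' ab.1) (sectorCenter n' ab.2) ∧
        ∃ ω : Fin L → Fin (sectorCount n'), ω ∈ sectorStrings u e₀ n n' L i₁ ω₁ ωt ∧
          (∀ m l : Fin L, m ≠ i₁ → l ≠ i₁ →
            pairAngle (sectorCenter n' (ω m)) (sectorCenter n' (ω l)) ≤
              pairAngle (sectorCenter n' (ω i)) (sectorCenter n' (ω j))) ∧
          (∀ m, m ≠ i → m ≠ j → ω m = ρ m) ∧ ω i = ab.1 ∧ ω j = ab.2) :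
    (E.card : ℝ) ≤
      max ((2 * ((2 * c₀ * K₂ * c₃ / π + 1) * L)) ^ 2) (4 * c₃ ^ 2 * K₂ ^ 2 / η₀ ^ 2 * L ^ 2) := by
  classical
  have h0 := abs_zero_le_e₀ hD
  have hupos : ∀ s, 0 < u s 0 := fun s => lt_of_lt_of_le hcu (huB s).1
  -- scales
  set t := (2 : ℝ) ^ (-(n' : ℤ)) with ht
  have htpos : 0 < t := zpow_pos (by norm_num) _
  have htle : t ≤ 1 := zpow_le_one_of_nonpos₀ (by norm_num) (by simp)
  set δ₂ := c₃ * t with hδ₂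
  set δ₁ := c₃ * (4 : ℝ) ^ (-(n' : ℤ)) with hδ₁
  have hδ₁t : δ₁ = δ₂ * t := by rw [hδ₁, four_zpow_neg, hδ₂, ht]; ring
  have hδ₂pos : 0 < δ₂ := by positivity
  have hδ₁₂ : δ₁ ≤ δ₂ := by rw [hδ₁t]; exact mul_le_of_le_one_right hδ₂pos.le htle
  have hL1 : (1 : ℝ) ≤ L := by
    have : 1 ≤ L := Nat.succ_le_of_lt (Fin.pos i₁)
    exact_mod_cast this
  have hK₂pos : 0 < K₂ := by rw [hK₂]; positivity
  -- consequences of `Φ < φ`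
  have hKΦ1 : 1 ≤ max (c₃ * K₂ / c₂') (max c₃ 1) := le_max_of_le_right (le_max_right _ _)
  have hΦt : t ≤ Φ := by
    rw [hΦ]
    calc t = 1 * 1 * t := by ring
      _ ≤ max (c₃ * K₂ / c₂') (max c₃ 1) * L * t := by gcongr
  have hΦδ : δ₂ ≤ Φ := by
    rw [hΦ, hδ₂]
    calc c₃ * t = c₃ * 1 * t := by ring
      _ ≤ max (c₃ * K₂ / c₂') (max c₃ 1) * L * t := by
          gcongr
          exact le_max_of_le_right (le_max_left _ _)
  have hΦη : K₂ * L * δ₂ ≤ c₂' * Φ := by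
    rw [hΦ, hδ₂]
    have h1 : K₂ * L * (c₃ * t) = c₂' * (c₃ * K₂ / c₂' * L * t) := by field_simp
    rw [h1]
    exact mul_le_mul_of_nonneg_left (mul_le_mul_of_nonneg_right
      (mul_le_mul_of_nonneg_right (le_max_left _ _) (by positivity)) htpos.le) hc₂'.le
  -- trivial cases
  rcases Finset.eq_empty_or_nonempty E with hE0 | hEne
  · rw [hE0, Finset.card_empty, Nat.cast_zero]
    exact le_max_of_le_left (by positivity)
  rcases lt_or_ge η₀ (K₂ * L * δ₂) with hlt | hη
  · -- small `h'`: the trivial bound `|O_{h'}|²`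
    have hcard : (E.card : ℝ) ≤ ((sectorCount n' : ℕ) : ℝ) ^ 2 := by
      have h1 : E.card ≤ (Finset.univ : Finset (Fin (sectorCount n') × Fin (sectorCount n'))).card :=
        Finset.card_le_card (Finset.subset_univ _)
      rw [Finset.card_univ, Fintype.card_prod, Fintype.card_fin] at h1
      have h2 : ((sectorCount n' * sectorCount n' : ℕ) : ℝ) = ((sectorCount n' : ℕ) : ℝ) ^ 2 := by push_cast; ring
      exact (Nat.cast_le.2 h1).trans_eq h2
    have hNt : ((sectorCount n' : ℕ) : ℝ) * t = 2 := by
      rw [sectorCount, ht, Nat.cast_pow, Nat.cast_ofNat, pow_succ, zpow_neg, zpow_natCast]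
      field_simp
    have hN2 : ((sectorCount n' : ℕ) : ℝ) = 2 / t := by rw [← hNt]; field_simp
    refine hcard.trans (le_max_of_le_right ?_)
    rw [hN2]
    exact trivial_regime_bound htpos hη₀ (by rw [hδ₂] at hlt; exact hlt)
  -- the reference pair of maximal angle
  obtain ⟨⟨a₀, b₀⟩, hmem₀, hmax⟩ :=
    E.exists_max_image (fun ab => pairAngle (sectorCenter n' ab.1) (sectorCenter n' ab.2)) hEne
  obtain ⟨hΦ₀, ω₀, hω₀S, hMP₀, hρ₀, hω₀i, hω₀j⟩ := hE _ hmem₀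
  set φ₀ := pairAngle (sectorCenter n' a₀) (sectorCenter n' b₀) with hφ₀
  have hφ₀pos : 0 < φ₀ := lt_of_le_of_lt (htpos.le.trans hΦt) hΦ₀
  have hφ₀le : φ₀ ≤ π / 2 := (pairAngle_bounds _ _).2.1
  have htφ : t ≤ φ₀ := hΦt.trans hΦ₀.le
  have hδφ : δ₂ ≤ φ₀ := hΦδ.trans hΦ₀.le
  have hδ₁φ : δ₁ ≤ δ₂ * φ₀ := by rw [hδ₁t]; exact mul_le_mul_of_nonneg_left htφ hδ₂pos.le
  -- reference string data and estimates (frame at `θ₀ = θ_{ρ k₀}`)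
  set θc := sectorCenter n' (ρ k₀) with hθc
  obtain ⟨kk₀, x₀, y₀, hsum₀, hdec₀, hx₀, hy₀⟩ := string_data hD h73 hω₀S
  have hθ₀k₀ : (fun m => sectorCenter n' (ω₀ m)) k₀ = θc := by
    simp only [hθc]; rw [hρ₀ k₀ hk₀i hk₀j]
  have est₀ := string_estimates hD hcu huB hlip hpi hc₂ hCw hk₀ (fun m => sectorCenter n' (ω₀ m)) θc hθ₀k₀
    kk₀ x₀ y₀ hsum₀ hdec₀ hx₀ hy₀ hδ₁₂ hδ₁φ hδφ hδ₂pos.le hMP₀ (by simp only [hω₀i, hω₀j]; exact le_rfl)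
  rw [← hK₁] at est₀
  -- the target boxes on the grid
  set D := c₀ * (K₂ * L * δ₂) with hDdef
  have hD0 : 0 ≤ D := by positivity
  obtain ⟨W, hWdef⟩ : ∃ W : ℝ → Finset (Fin (sectorCount n')), ∀ θs, W θs =
      Finset.univ.filter (fun c : Fin (sectorCount n') => torusDist (sectorCenter n' c - θs) ≤ D) :=
    ⟨fun θs => Finset.univ.filter (fun c : Fin (sectorCount n') => torusDist (sectorCenter n' c - θs) ≤ D),
      fun θs => rfl⟩
  have hWmem : ∀ (θs : ℝ) (c : Fin (sectorCount n')), torusDist (sectorCenter n' c - θs) ≤ D → c ∈ W θs :=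
      fun θs c h => by
    rw [hWdef]; exact Finset.mem_filter.2 ⟨Finset.mem_univ _, h⟩
  have hWcard : ∀ θs, ((W θs).card : ℝ) ≤ (2 * c₀ * K₂ * c₃ / π + 1) * L := by
    intro θs
    have h1 := card_centres_torus_le n' θs D hD0
    rw [← hWdef] at h1
    have h2 : 2 * D / sectorWidth n' + 1 = 2 * c₀ * K₂ * c₃ / π * L + 1 := by
      rw [hDdef, hδ₂, sectorWidth_eq_zpow, ← ht]; field_simp
    rw [h2] at h1
    have h3 : (2 * c₀ * K₂ * c₃ / π + 1) * L = 2 * c₀ * K₂ * c₃ / π * L + L := by ring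
    calc ((W θs).card : ℝ) ≤ 2 * c₀ * K₂ * c₃ / π * L + 1 := h1
      _ ≤ (2 * c₀ * K₂ * c₃ / π + 1) * L := by rw [h3]; linarith
  -- every completing pair lands in the boxes
  have hsub : E ⊆ (W (sectorCenter n' a₀) ∪ W (sectorCenter n' b₀)) ×ˢ
      (W (sectorCenter n' a₀) ∪ W (sectorCenter n' b₀)) := by
    rintro ⟨a, b⟩ hab
    have hφle : pairAngle (sectorCenter n' a) (sectorCenter n' b) ≤ φ₀ := hmax ⟨a, b⟩ hab
    obtain ⟨hΦab, ω, hωS, hMP, hρω, hωi, hωj⟩ := hE _ hab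
    have habpos : 0 < pairAngle (sectorCenter n' a) (sectorCenter n' b) :=
      lt_of_le_of_lt (htpos.le.trans hΦt) hΦab
    obtain ⟨kk, x, y, hsum, hdec, hx, hy⟩ := string_data hD h73 hωS
    have hθk₀ : (fun m => sectorCenter n' (ω m)) k₀ = θc := by
      simp only [hθc]; rw [hρω k₀ hk₀i hk₀j]
    have est := string_estimates hD hcu huB hlip hpi hc₂ hCw hk₀ (fun m => sectorCenter n' (ω m)) θc hθk₀
      kk x y hsum hdec hx hy hδ₁₂ hδ₁φ hδφ hδ₂pos.le hMP (by simp only [hωi, hωj]; exact hφle)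
    rw [← hK₁] at est
    -- the difference of the two chord sums
    set r := ∑ m, fermiPoint u (sectorCenter n' (ω m)) - ∑ m, fermiPoint u (sectorCenter n' (ω₀ m)) with hr
    have hF : fermiPoint u (sectorCenter n' a) + fermiPoint u (sectorCenter n' b) =
        fermiPoint u (sectorCenter n' a₀) + fermiPoint u (sectorCenter n' b₀) + r := by
      have hdiff : r = (fermiPoint u (sectorCenter n' a) - fermiPoint u (sectorCenter n' a₀)) +
          (fermiPoint u (sectorCenter n' b) - fermiPoint u (sectorCenter n' b₀)) := by
        rw [hr, ← Finset.sum_sub_distrib]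
        rw [Fintype.sum_eq_add i j hij (fun m hm => by
          show fermiPoint u (sectorCenter n' (ω m)) - fermiPoint u (sectorCenter n' (ω₀ m)) = 0
          rw [hρω m hm.1 hm.2, hρ₀ m hm.1 hm.2, sub_self])]
        rw [hωi, hωj, hω₀i, hω₀j]
      rw [hdiff]; abel
    -- components of `r` in the common frame at `θc`
    set n₀ := unitNormal u θc 0 with hn₀
    set τ₀ := unitTangent u θc 0 with hτ₀
    have hrn₀ : |r ⬝ᵥ n₀| ≤ 2 * K₁ * L * δ₂ * φ₀ := by
      rw [hr, sub_dotProduct]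
      have := abs_sub ((∑ m, fermiPoint u (sectorCenter n' (ω m))) ⬝ᵥ n₀)
        ((∑ m, fermiPoint u (sectorCenter n' (ω₀ m))) ⬝ᵥ n₀)
      linarith [est.1, est₀.1]
    have hrτ₀ : |r ⬝ᵥ τ₀| ≤ 4 * L * δ₂ := by
      rw [hr, sub_dotProduct]
      have := abs_sub ((∑ m, fermiPoint u (sectorCenter n' (ω m))) ⬝ᵥ τ₀)
        ((∑ m, fermiPoint u (sectorCenter n' (ω₀ m))) ⬝ᵥ τ₀)
      linarith [est.2, est₀.2]
    -- frame change, Lemma 7.5 and two-to-one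
    have hθc' : pairAngle θc (sectorCenter n' a₀) ≤ φ₀ := by
      have h1 := hMP₀ k₀ i hk₀ hi
      rw [hρ₀ k₀ hk₀i hk₀j, hω₀i, hω₀j] at h1
      exact h1
    have hnear := pair_pinned hD hlip hpi hc₂ hK₁0 hK₂ h75 (Nat.cast_nonneg L) hδ₂pos.le r hF hφ₀pos habpos
      hrn₀ hrτ₀ hθc'
      (hΦη.trans (mul_le_mul_of_nonneg_left hΦ₀.le hc₂'.le)) hη
    rw [Finset.mem_product, Finset.mem_union, Finset.mem_union]
    rcases hnear with ⟨h1, h2⟩ | ⟨h1, h2⟩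
    · exact ⟨Or.inl (hWmem _ _ h1), Or.inr (hWmem _ _ h2)⟩
    · exact ⟨Or.inr (hWmem _ _ h1), Or.inl (hWmem _ _ h2)⟩
  -- count
  have hU : (((W (sectorCenter n' a₀) ∪ W (sectorCenter n' b₀)).card : ℕ) : ℝ) ≤
      2 * ((2 * c₀ * K₂ * c₃ / π + 1) * L) := by
    calc (((W (sectorCenter n' a₀) ∪ W (sectorCenter n' b₀)).card : ℕ) : ℝ)
        ≤ ((W (sectorCenter n' a₀)).card : ℝ) + ((W (sectorCenter n' b₀)).card : ℝ) := by
          exact_mod_cast Finset.card_union_le _ _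
      _ ≤ 2 * ((2 * c₀ * K₂ * c₃ / π + 1) * L) := by linarith [hWcard (sectorCenter n' a₀), hWcard (sectorCenter n' b₀)]
  refine le_max_of_le_left ?_
  calc (E.card : ℝ) ≤ (((W (sectorCenter n' a₀) ∪ W (sectorCenter n' b₀)) ×ˢ
        (W (sectorCenter n' a₀) ∪ W (sectorCenter n' b₀))).card : ℝ) := by
        exact_mod_cast Finset.card_le_card hsub
    _ = (((W (sectorCenter n' a₀) ∪ W (sectorCenter n' b₀)).card : ℝ)) ^ 2 := by
        rw [Finset.card_product]; push_cast; ring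
    _ ≤ (2 * ((2 * c₀ * K₂ * c₃ / π + 1) * L)) ^ 2 := pow_le_pow_left₀ (by positivity) hU 2


/-- **The fibre over the free legs, near part `𝒜_<` (s1.24)–(s1.25).** If the maximal pair `(i, j)`
has `φ(θ_i, θ_j) ≤ Φ`, both `θ_i` and `θ_j` are within `Φ` (modulo `π`) of the FIXED angle `θ_{k₀}`
of a third free leg, so at most `(2(2Φ/w_{h'} + 1))²` completing pairs occur. [cite: BenfattoGiulianiMastropietro2003, §7.4 (s1.24)–(s1.25) p.28 (L37–43)] -/
private theorem fibre_small {n n' L : ℕ} {i₁ i j k₀ : Fin L} (hi : i ≠ i₁) (hj : j ≠ i₁) (hk₀ : k₀ ≠ i₁)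
    (hk₀i : k₀ ≠ i) (hk₀j : k₀ ≠ j)
    {u : ℝ → ℝ → ℝ} {e₀ : ℝ} {ω₁ : ℕ} {ωt : Fin L → ℕ} (ρ : Fin L → Fin (sectorCount n'))
    {Φ : ℝ} (hΦ0 : 0 ≤ Φ)
    (E : Finset (Fin (sectorCount n') × Fin (sectorCount n')))
    (hE : ∀ ab ∈ E,
        pairAngle (sectorCenter n' ab.1) (sectorCenter n' ab.2) ≤ Φ ∧
        ∃ ω : Fin L → Fin (sectorCount n'), ω ∈ sectorStrings u e₀ n n' L i₁ ω₁ ωt ∧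
          (∀ m l : Fin L, m ≠ i₁ → l ≠ i₁ →
            pairAngle (sectorCenter n' (ω m)) (sectorCenter n' (ω l)) ≤
              pairAngle (sectorCenter n' (ω i)) (sectorCenter n' (ω j))) ∧
          (∀ m, m ≠ i → m ≠ j → ω m = ρ m) ∧ ω i = ab.1 ∧ ω j = ab.2) :
    (E.card : ℝ) ≤ (2 * (2 * Φ / sectorWidth n' + 1)) ^ 2 := by
  classical
  set Wp := Finset.univ.filter (fun c : Fin (sectorCount n') =>
    pairAngle (sectorCenter n' c) (sectorCenter n' (ρ k₀)) ≤ Φ) with hWp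
  have hsub : E ⊆ Wp ×ˢ Wp := by
    rintro ⟨a, b⟩ hab
    obtain ⟨hφ, ω, -, hMP, hρω, hωi, hωj⟩ := hE _ hab
    have hk : sectorCenter n' (ω k₀) = sectorCenter n' (ρ k₀) := by rw [hρω k₀ hk₀i hk₀j]
    rw [Finset.mem_product]
    simp only [hWp, Finset.mem_filter, Finset.mem_univ, true_and]
    constructor
    · have h1 := hMP i k₀ hi hk₀
      rw [hk, hωi, hωj] at h1
      exact h1.trans hφ
    · have h1 := hMP j k₀ hj hk₀
      rw [hk, hωi, hωj] at h1
      exact h1.trans hφ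
  have hW := card_centres_modpi_le n' (sectorCenter n' (ρ k₀)) Φ hΦ0
  rw [← hWp] at hW
  calc (E.card : ℝ) ≤ ((Wp ×ˢ Wp).card : ℝ) := by exact_mod_cast Finset.card_le_card hsub
    _ = (Wp.card : ℝ) ^ 2 := by rw [Finset.card_product]; push_cast; ring
    _ ≤ (2 * (2 * Φ / sectorWidth n' + 1)) ^ 2 := pow_le_pow_left₀ (by positivity) hW 2

end Fibre

section Assembly

variable {ε : (Fin 2 → ℝ) → ℝ} {μ e₀ : ℝ} {u : ℝ → ℝ → ℝ}

/-- `L⁴ ≤ 16^L`. [folklore] -/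
private theorem pow_four_le_sixteen_pow (L : ℕ) : (L : ℝ) ^ 4 ≤ (16 : ℝ) ^ L := by
  have h1 : (L : ℝ) ≤ 2 ^ L := by exact_mod_cast (Nat.lt_two_pow_self).le
  calc (L : ℝ) ^ 4 ≤ (2 ^ L) ^ 4 := pow_le_pow_left₀ (by positivity) h1 4
    _ = (16 : ℝ) ^ L := by rw [← pow_mul, mul_comm, pow_mul]; norm_num

/-- **The fibre of the solved pair.** Strings in one class that agree off `{i, j}` number at most
`K L²` (`fibre_small` + `fibre_large`, the two regimes (s1.24)/(s1.26)). [cite: BenfattoGiulianiMastropietro2003, §7.4 (s1.24)–(s1.26) p.28 (L37–52)] -/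
private theorem fibre_bound (hD : DispersionHyp ε μ e₀ u) {cu M c₂ c₃ Cw K₁ K₂ c₀ c₂' η₀ KΦ Kfib : ℝ}
    (hcu : 0 < cu) (huB : ∀ θ : ℝ, cu ≤ u θ 0 ∧ u θ 0 ≤ M)
    (hlip : ∀ θ₁ θ₂ : ℝ, torusDist (normalAngle u θ₂ 0 - normalAngle u θ₁ 0) ≤ c₂ * torusDist (θ₂ - θ₁))
    (hpi : ∀ θ : ℝ, normalAngle u (θ + π) 0 = normalAngle u θ 0 + π) (hc₂ : 0 ≤ c₂) (hc₃ : 0 < c₃)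
    (h73 : ∀ (n ω : ℕ), ω < sectorCount n → ∀ p ∈ sSector u e₀ n ω,
      ∃ k₁ k₂ : ℝ,
        p = fermiPoint u (sectorCenter n ω) + k₁ • unitNormal u (sectorCenter n ω) 0 +
              k₂ • unitTangent u (sectorCenter n ω) 0 ∧
        |k₁| ≤ c₃ * (4 : ℝ) ^ (-(n : ℤ)) ∧ |k₂| ≤ c₃ * (2 : ℝ) ^ (-(n : ℤ)) ∧
        |fderiv ℝ ε p (unitTangent u (sectorCenter n ω) 0)| ≤ c₃ * (2 : ℝ) ^ (-(n : ℤ)))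
    (hCw : Cw = π / 2 * ((M ^ 2 + 4 * M) / cu ^ 2)) (hK₁ : K₁ = 2 + c₂ * (1 + Cw)) (hK₁0 : 0 ≤ K₁)
    (hK₂ : K₂ = K₁ * π + 4) (hc₀ : 0 < c₀) (hc₂' : 0 < c₂') (hη₀ : 0 < η₀)
    (h75 : ∀ θ₁' θ₂' η r₁ r₂ : ℝ, (θ₁', θ₂') ∈ pairChartDomain →
        |r₁| ≤ (2 * K₁ + 4 * c₂) / K₂ * η * pairAngle θ₁' θ₂' → |r₂| ≤ η → η ≤ c₂' * pairAngle θ₁' θ₂' →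
          η ≤ η₀ →
          fermiPoint u θ₁' + fermiPoint u θ₂' + (r₁ • unitNormal u θ₁' 0 + r₂ • unitTangent u θ₁' 0)
              ∈ pairRange u ∧
          ∃ θ₁ θ₂ : ℝ,
            fermiPoint u θ₁' + fermiPoint u θ₂' + (r₁ • unitNormal u θ₁' 0 + r₂ • unitTangent u θ₁' 0) =
              fermiPoint u θ₁ + fermiPoint u θ₂ ∧
            |θ₁ - θ₁'| ≤ c₀ * η ∧ |θ₂ - θ₂'| ≤ c₀ * η)
    (hKΦ : KΦ = max (c₃ * K₂ / c₂') (max c₃ 1))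
    (hKfib : Kfib = 4 * (2 * KΦ / π + 1) ^ 2 +
      (4 * (2 * c₀ * K₂ * c₃ / π + 1) ^ 2 + 4 * c₃ ^ 2 * K₂ ^ 2 / η₀ ^ 2))
    {n n' : ℕ} (hn : n ≤ n') {L : ℕ} (hL : 4 ≤ L) (i₁ : Fin L) {ω₁ : ℕ} (hω₁ : ω₁ < sectorCount n')
    {ωt : Fin L → ℕ} (hωt : ∀ i, ωt i < sectorCount n)
    {i j k₀ : Fin L} (hij : i ≠ j) (hi : i ≠ i₁) (hj : j ≠ i₁) (hk₀i : k₀ ≠ i) (hk₀j : k₀ ≠ j) (hk₀ : k₀ ≠ i₁)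
    (ρ : Fin L → Fin (sectorCount n')) (F : Finset (Fin L → Fin (sectorCount n')))
    (hF : ∀ ω ∈ F, ω ∈ sectorStrings u e₀ n n' L i₁ ω₁ ωt ∧
      (∀ m l : Fin L, m ≠ i₁ → l ≠ i₁ →
        pairAngle (sectorCenter n' (ω m)) (sectorCenter n' (ω l)) ≤
          pairAngle (sectorCenter n' (ω i)) (sectorCenter n' (ω j))) ∧
      ∀ m, m ≠ i → m ≠ j → ω m = ρ m) :
    (F.card : ℝ) ≤ Kfib * L ^ 2 := by
  classical
  have _ := hn; have _ := hωt; have _ := hω₁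
  have hL1 : (1 : ℝ) ≤ L := by exact_mod_cast (show 1 ≤ L by omega)
  have hKΦ0 : 0 ≤ KΦ := by rw [hKΦ]; exact le_trans zero_le_one (le_max_of_le_right (le_max_right _ _))
  set t := (2 : ℝ) ^ (-(n' : ℤ)) with ht
  have htpos : 0 < t := zpow_pos (by norm_num) _
  set Φ := KΦ * L * t with hΦdef
  have hΦ0 : 0 ≤ Φ := by positivity
  have hΦ' : Φ = max (c₃ * K₂ / c₂') (max c₃ 1) * L * (2 : ℝ) ^ (-(n' : ℤ)) := by rw [hΦdef, hKΦ]
  set g : (Fin L → Fin (sectorCount n')) → Fin (sectorCount n') × Fin (sectorCount n') :=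
    fun ω => (ω i, ω j) with hg
  have hinj : Set.InjOn g F := by
    intro ω hω ω' hω' hgg
    have h1 : ω i = ω' i := congrArg Prod.fst hgg
    have h2 : ω j = ω' j := congrArg Prod.snd hgg
    have hρ := (hF ω (Finset.mem_coe.1 hω)).2.2
    have hρ' := (hF ω' (Finset.mem_coe.1 hω')).2.2
    funext m
    by_cases hmi : m = i
    · rw [hmi]; exact h1
    by_cases hmj : m = j
    · rw [hmj]; exact h2
    rw [hρ m hmi hmj, hρ' m hmi hmj]
  set Eρ := F.image g with hEρ
  have hcardF : F.card = Eρ.card := (Finset.card_image_of_injOn hinj).symm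
  have hEρ_spec : ∀ ab ∈ Eρ, ∃ ω : Fin L → Fin (sectorCount n'), ω ∈ sectorStrings u e₀ n n' L i₁ ω₁ ωt ∧
      (∀ m l : Fin L, m ≠ i₁ → l ≠ i₁ →
        pairAngle (sectorCenter n' (ω m)) (sectorCenter n' (ω l)) ≤
          pairAngle (sectorCenter n' (ω i)) (sectorCenter n' (ω j))) ∧
      (∀ m, m ≠ i → m ≠ j → ω m = ρ m) ∧ ω i = ab.1 ∧ ω j = ab.2 := by
    intro ab hab
    obtain ⟨ω, hωF, hωab⟩ := Finset.mem_image.1 hab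
    obtain ⟨hωS, hωMP, hωρ⟩ := hF ω hωF
    exact ⟨ω, hωS, hωMP, hωρ, congrArg Prod.fst hωab, congrArg Prod.snd hωab⟩
  set Es := Eρ.filter (fun ab => pairAngle (sectorCenter n' ab.1) (sectorCenter n' ab.2) ≤ Φ) with hEs
  set El := Eρ.filter (fun ab => ¬ pairAngle (sectorCenter n' ab.1) (sectorCenter n' ab.2) ≤ Φ) with hEl
  have hsplit : Eρ.card = Es.card + El.card :=
    (Finset.card_filter_add_card_filter_not _).symm
  have hEs_le := fibre_small hi hj hk₀ hk₀i hk₀j ρ hΦ0 Es (fun ab hab => by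
    obtain ⟨h1, h2⟩ := Finset.mem_filter.1 hab
    exact ⟨h2, hEρ_spec ab h1⟩)
  have hEl_le := fibre_large hD hcu huB hlip hpi hc₂ hc₃ h73 hCw hK₁ hK₁0 hK₂ hc₀ hc₂' hη₀ h75 hij hi
    hk₀i hk₀j hk₀ ρ hΦ' El (fun ab hab => by
    obtain ⟨h1, h2⟩ := Finset.mem_filter.1 hab
    exact ⟨not_le.1 h2, hEρ_spec ab h1⟩)
  -- numerical bound `≤ Kfib L²`
  have hw : 2 * Φ / sectorWidth n' + 1 = 2 * KΦ / π * L + 1 := by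
    rw [hΦdef, sectorWidth_eq_zpow, ← ht]; field_simp
  rw [hw] at hEs_le
  rw [hcardF, hsplit, Nat.cast_add, hKfib]
  have h1 : (2 * (2 * KΦ / π * L + 1)) ^ 2 ≤ 4 * (2 * KΦ / π + 1) ^ 2 * L ^ 2 := by
    have h11 : 2 * (2 * KΦ / π * L + 1) ≤ 2 * ((2 * KΦ / π + 1) * L) := by
      have e : (2 * KΦ / π + 1) * L = 2 * KΦ / π * L + L := by ring
      rw [e]; linarith
    have h12 : 0 ≤ 2 * (2 * KΦ / π * L + 1) := by positivity
    calc (2 * (2 * KΦ / π * L + 1)) ^ 2 ≤ (2 * ((2 * KΦ / π + 1) * L)) ^ 2 :=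
          pow_le_pow_left₀ h12 h11 2
      _ = 4 * (2 * KΦ / π + 1) ^ 2 * L ^ 2 := by ring
  set a := 2 * c₀ * K₂ * c₃ / π + 1 with ha
  set b := 4 * c₃ ^ 2 * K₂ ^ 2 / η₀ ^ 2 with hb
  have hbL : 0 ≤ b * L ^ 2 := by positivity
  have haL : 0 ≤ 4 * a ^ 2 * L ^ 2 := by positivity
  have h2 : max ((2 * (a * L)) ^ 2) (b * L ^ 2) ≤ (4 * a ^ 2 + b) * L ^ 2 := by
    have e1 : (2 * (a * L)) ^ 2 = 4 * a ^ 2 * L ^ 2 := by ring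
    have e2 : (4 * a ^ 2 + b) * L ^ 2 = 4 * a ^ 2 * L ^ 2 + b * L ^ 2 := by ring
    rw [e1, e2]
    exact max_le (by linarith) (by linarith)
  have e3 : (4 * (2 * KΦ / π + 1) ^ 2 + (4 * a ^ 2 + b)) * (L : ℝ) ^ 2 =
      4 * (2 * KΦ / π + 1) ^ 2 * L ^ 2 + (4 * a ^ 2 + b) * L ^ 2 := by ring
  rw [e3]
  linarith [hEs_le, hEl_le, h1, h2]

/-- **One class of the cover** (the pair `(i, j)` maximal): projecting a string onto its legs
`∉ {i, j}` lands in a product of refinement sets of size `≤ (3γ^{(h-h')/2})^{L-3}` ((s1.23)), and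
each fibre (the solved pair) has `≤ K L²` elements (`fibre_small` + `fibre_large`). [cite: BenfattoGiulianiMastropietro2003, §7.4 (s1.23)–(s1.25a) p.28 (L33–52)] -/
private theorem class_bound (hD : DispersionHyp ε μ e₀ u) {cu M c₂ c₃ Cw K₁ K₂ c₀ c₂' η₀ KΦ Kfib : ℝ}
    (hcu : 0 < cu) (huB : ∀ θ : ℝ, cu ≤ u θ 0 ∧ u θ 0 ≤ M)
    (hlip : ∀ θ₁ θ₂ : ℝ, torusDist (normalAngle u θ₂ 0 - normalAngle u θ₁ 0) ≤ c₂ * torusDist (θ₂ - θ₁))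
    (hpi : ∀ θ : ℝ, normalAngle u (θ + π) 0 = normalAngle u θ 0 + π) (hc₂ : 0 ≤ c₂) (hc₃ : 0 < c₃)
    (h73 : ∀ (n ω : ℕ), ω < sectorCount n → ∀ p ∈ sSector u e₀ n ω,
      ∃ k₁ k₂ : ℝ,
        p = fermiPoint u (sectorCenter n ω) + k₁ • unitNormal u (sectorCenter n ω) 0 +
              k₂ • unitTangent u (sectorCenter n ω) 0 ∧
        |k₁| ≤ c₃ * (4 : ℝ) ^ (-(n : ℤ)) ∧ |k₂| ≤ c₃ * (2 : ℝ) ^ (-(n : ℤ)) ∧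
        |fderiv ℝ ε p (unitTangent u (sectorCenter n ω) 0)| ≤ c₃ * (2 : ℝ) ^ (-(n : ℤ)))
    (hCw : Cw = π / 2 * ((M ^ 2 + 4 * M) / cu ^ 2)) (hK₁ : K₁ = 2 + c₂ * (1 + Cw)) (hK₁0 : 0 ≤ K₁)
    (hK₂ : K₂ = K₁ * π + 4) (hc₀ : 0 < c₀) (hc₂' : 0 < c₂') (hη₀ : 0 < η₀)
    (h75 : ∀ θ₁' θ₂' η r₁ r₂ : ℝ, (θ₁', θ₂') ∈ pairChartDomain →
        |r₁| ≤ (2 * K₁ + 4 * c₂) / K₂ * η * pairAngle θ₁' θ₂' → |r₂| ≤ η → η ≤ c₂' * pairAngle θ₁' θ₂' →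
          η ≤ η₀ →
          fermiPoint u θ₁' + fermiPoint u θ₂' + (r₁ • unitNormal u θ₁' 0 + r₂ • unitTangent u θ₁' 0)
              ∈ pairRange u ∧
          ∃ θ₁ θ₂ : ℝ,
            fermiPoint u θ₁' + fermiPoint u θ₂' + (r₁ • unitNormal u θ₁' 0 + r₂ • unitTangent u θ₁' 0) =
              fermiPoint u θ₁ + fermiPoint u θ₂ ∧
            |θ₁ - θ₁'| ≤ c₀ * η ∧ |θ₂ - θ₂'| ≤ c₀ * η)
    (hKΦ : KΦ = max (c₃ * K₂ / c₂') (max c₃ 1))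
    (hKfib : Kfib = 4 * (2 * KΦ / π + 1) ^ 2 +
      (4 * (2 * c₀ * K₂ * c₃ / π + 1) ^ 2 + 4 * c₃ ^ 2 * K₂ ^ 2 / η₀ ^ 2))
    {n n' : ℕ} (hn : n ≤ n') {L : ℕ} (hL : 4 ≤ L) (i₁ : Fin L) {ω₁ : ℕ} (hω₁ : ω₁ < sectorCount n')
    {ωt : Fin L → ℕ} (hωt : ∀ i, ωt i < sectorCount n)
    {i j : Fin L} (hij : i ≠ j) (hi : i ≠ i₁) (hj : j ≠ i₁)
    (T : Finset (Fin L → Fin (sectorCount n')))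
    (hT : ∀ ω ∈ T, ω ∈ sectorStrings u e₀ n n' L i₁ ω₁ ωt ∧
      ∀ m l : Fin L, m ≠ i₁ → l ≠ i₁ →
        pairAngle (sectorCenter n' (ω m)) (sectorCenter n' (ω l)) ≤
          pairAngle (sectorCenter n' (ω i)) (sectorCenter n' (ω j))) :
    (T.card : ℝ) ≤ Kfib * L ^ 2 * (3 * (2 : ℝ) ^ (n' - n)) ^ (L - 3) := by
  classical
  have hL1 : (1 : ℝ) ≤ L := by exact_mod_cast (show 1 ≤ L by omega)
  have hKΦ0 : 0 ≤ KΦ := by rw [hKΦ]; exact le_trans zero_le_one (le_max_of_le_right (le_max_right _ _))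
  have hKfib0 : 0 ≤ Kfib := by rw [hKfib]; positivity
  set t := (2 : ℝ) ^ (-(n' : ℤ)) with ht
  have htpos : 0 < t := zpow_pos (by norm_num) _
  set Φ := KΦ * L * t with hΦdef
  have hΦ0 : 0 ≤ Φ := by positivity
  have hΦ' : Φ = max (c₃ * K₂ / c₂') (max c₃ 1) * L * (2 : ℝ) ^ (-(n' : ℤ)) := by rw [hΦdef, hKΦ]
  -- a third free leg `k₀`
  obtain ⟨k₀, hk₀mem⟩ : (((Finset.univ.erase i₁).erase i).erase j).Nonempty := by
    rw [← Finset.card_pos]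
    have h1 : i ∈ Finset.univ.erase i₁ := Finset.mem_erase.2 ⟨hi, Finset.mem_univ _⟩
    have h2 : j ∈ (Finset.univ.erase i₁).erase i := Finset.mem_erase.2 ⟨hij.symm, Finset.mem_erase.2 ⟨hj, Finset.mem_univ _⟩⟩
    rw [Finset.card_erase_of_mem h2, Finset.card_erase_of_mem h1, Finset.card_erase_of_mem (Finset.mem_univ _),
      Finset.card_univ, Fintype.card_fin]
    omega
  have hk₀j : k₀ ≠ j := Finset.ne_of_mem_erase hk₀mem
  have hk₀i : k₀ ≠ i := Finset.ne_of_mem_erase (Finset.mem_of_mem_erase hk₀mem)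
  have hk₀ : k₀ ≠ i₁ := Finset.ne_of_mem_erase (Finset.mem_of_mem_erase (Finset.mem_of_mem_erase hk₀mem))
  -- the projection onto the other legs and its target
  set z : Fin (sectorCount n') := ⟨0, sectorCount_pos n'⟩ with hz
  set proj : (Fin L → Fin (sectorCount n')) → (Fin L → Fin (sectorCount n')) :=
    fun ω => Function.update (Function.update ω i z) j z with hproj
  have hproj_i : ∀ ω, proj ω i = z := fun ω => by
    simp only [hproj]; rw [Function.update_of_ne hij, Function.update_self]
  have hproj_j : ∀ ω, proj ω j = z := fun ω => by simp only [hproj]; rw [Function.update_self]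
  have hproj_o : ∀ ω m, m ≠ i → m ≠ j → proj ω m = ω m := fun ω m hmi hmj => by
    simp only [hproj]; rw [Function.update_of_ne hmj, Function.update_of_ne hmi]
  obtain ⟨Ref, hRef⟩ : ∃ Ref : Fin L → Finset (Fin (sectorCount n')),
      ∀ m, Ref m = Finset.univ.filter (fun a : Fin (sectorCount n') => sSector u e₀ n' a ⊆ sSector u e₀ n (ωt m)) :=
    ⟨_, fun m => rfl⟩
  have hRefcard : ∀ m, (Ref m).card ≤ 3 * 2 ^ (n' - n) := fun m => by
    rw [hRef]; exact card_refinements_le hD hn (hωt m)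
  set tf : Fin L → Finset (Fin (sectorCount n')) :=
    fun m => if m = i ∨ m = j then {z} else if m = i₁ then {⟨ω₁, hω₁⟩} else Ref m with htf
  set A := Fintype.piFinset tf with hA
  -- strings of the class project into `A`
  have hmaps : ∀ ω ∈ T, proj ω ∈ A := by
    intro ω hω
    obtain ⟨hωS, -⟩ := hT ω hω
    obtain ⟨hω₁eq, hsub, -⟩ := hωS
    rw [hA, Fintype.mem_piFinset]
    intro m
    simp only [htf]
    by_cases hm : m = i ∨ m = j
    · rw [if_pos hm, Finset.mem_singleton]
      rcases hm with rfl | rfl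
      · exact hproj_i ω
      · exact hproj_j ω
    · rw [if_neg hm]
      rw [not_or] at hm
      rw [hproj_o ω m hm.1 hm.2]
      by_cases hm₁ : m = i₁
      · rw [if_pos hm₁, Finset.mem_singleton, hm₁]
        exact Fin.ext hω₁eq
      · rw [if_neg hm₁, hRef, Finset.mem_filter]
        exact ⟨Finset.mem_univ _, hsub m hm₁⟩
  -- the fibres: the solved pair
  have hfib : ∀ ρ ∈ A, ((T).filter (fun ω => proj ω = ρ)).card ≤ ⌊Kfib * L ^ 2⌋₊ := by
    intro ρ _
    apply Nat.le_floor
    refine fibre_bound hD hcu huB hlip hpi hc₂ hc₃ h73 hCw hK₁ hK₁0 hK₂ hc₀ hc₂' hη₀ h75 hKΦ hKfib hn hL i₁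
      hω₁ hωt hij hi hj hk₀i hk₀j hk₀ ρ _ (fun ω hω => ?_)
    obtain ⟨hωT, hωρ⟩ := Finset.mem_filter.1 hω
    obtain ⟨hωS, hωMP⟩ := hT ω hωT
    exact ⟨hωS, hωMP, fun m hmi hmj => by rw [← hproj_o ω m hmi hmj, hωρ]⟩
  -- the size of the target `A`: (s1.23) for each of the `L - 3` free legs
  have hAcard : A.card ≤ (3 * 2 ^ (n' - n)) ^ (L - 3) := by
    rw [hA, Fintype.card_piFinset]
    have hle : ∀ m, (tf m).card ≤ if m = i ∨ m = j ∨ m = i₁ then 1 else 3 * 2 ^ (n' - n) := by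
      intro m
      simp only [htf]
      by_cases hm : m = i ∨ m = j
      · rw [if_pos hm, if_pos (by tauto), Finset.card_singleton]
      · rw [if_neg hm]
        by_cases hm₁ : m = i₁
        · rw [if_pos hm₁, if_pos (by tauto), Finset.card_singleton]
        · rw [if_neg hm₁, if_neg (by tauto)]; exact hRefcard m
    calc ∏ m, (tf m).card ≤ ∏ m : Fin L, (if m = i ∨ m = j ∨ m = i₁ then 1 else 3 * 2 ^ (n' - n)) :=
          Finset.prod_le_prod' fun m _ => hle m
      _ = (3 * 2 ^ (n' - n)) ^ (Finset.univ.filter (fun m : Fin L => ¬(m = i ∨ m = j ∨ m = i₁))).card := by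
          rw [Finset.prod_ite, Finset.prod_const_one, one_mul, Finset.prod_const]
      _ = (3 * 2 ^ (n' - n)) ^ (L - 3) := by
          congr 1
          have h3 : (Finset.univ.filter (fun m : Fin L => m = i ∨ m = j ∨ m = i₁)).card = 3 := by
            rw [Finset.card_eq_three]
            refine ⟨i, j, i₁, hij, hi, hj, ?_⟩
            ext m; simp
          have := Finset.card_filter_add_card_filter_not (s := (Finset.univ : Finset (Fin L)))
            (fun m : Fin L => m = i ∨ m = j ∨ m = i₁)
          rw [h3, Finset.card_univ, Fintype.card_fin] at this
          omega
  -- assemble the class bound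
  have hTle := Finset.card_le_mul_card_image_of_maps_to hmaps (⌊Kfib * L ^ 2⌋₊) hfib
  have h1 : ((T).card : ℝ) ≤ (⌊Kfib * ↑L ^ 2⌋₊ : ℝ) * (A.card : ℝ) := by exact_mod_cast hTle
  have h2 : (⌊Kfib * ↑L ^ 2⌋₊ : ℝ) ≤ Kfib * L ^ 2 := Nat.floor_le (by positivity)
  have h3 : (A.card : ℝ) ≤ (3 * (2 : ℝ) ^ (n' - n)) ^ (L - 3) := by exact_mod_cast hAcard
  calc ((T).card : ℝ) ≤ (⌊Kfib * ↑L ^ 2⌋₊ : ℝ) * (A.card : ℝ) := h1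
    _ ≤ Kfib * L ^ 2 * (3 * (2 : ℝ) ^ (n' - n)) ^ (L - 3) :=
        mul_le_mul h2 h3 (by positivity) (by positivity)

/-- **The sector counting lemma for `L ≥ 4` legs, (4.3app).** The strings are covered by the
`≤ L²` classes «`(i, j)` is the maximal pair among the legs `≠ i₁`» (the paper's reordering
(s1.22)); each class is bounded by `class_bound`. [cite: BenfattoGiulianiMastropietro2003, §7.4 (4.3app), (s1.22)–(s1.25a) p.28 (L6–52)] -/
private theorem count_ge_four (hD : DispersionHyp ε μ e₀ u) {cu M c₂ c₃ Cw K₁ K₂ c₀ c₂' η₀ KΦ Kfib : ℝ}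
    (hcu : 0 < cu) (huB : ∀ θ : ℝ, cu ≤ u θ 0 ∧ u θ 0 ≤ M)
    (hlip : ∀ θ₁ θ₂ : ℝ, torusDist (normalAngle u θ₂ 0 - normalAngle u θ₁ 0) ≤ c₂ * torusDist (θ₂ - θ₁))
    (hpi : ∀ θ : ℝ, normalAngle u (θ + π) 0 = normalAngle u θ 0 + π) (hc₂ : 0 ≤ c₂) (hc₃ : 0 < c₃)
    (h73 : ∀ (n ω : ℕ), ω < sectorCount n → ∀ p ∈ sSector u e₀ n ω,
      ∃ k₁ k₂ : ℝ,
        p = fermiPoint u (sectorCenter n ω) + k₁ • unitNormal u (sectorCenter n ω) 0 +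
              k₂ • unitTangent u (sectorCenter n ω) 0 ∧
        |k₁| ≤ c₃ * (4 : ℝ) ^ (-(n : ℤ)) ∧ |k₂| ≤ c₃ * (2 : ℝ) ^ (-(n : ℤ)) ∧
        |fderiv ℝ ε p (unitTangent u (sectorCenter n ω) 0)| ≤ c₃ * (2 : ℝ) ^ (-(n : ℤ)))
    (hCw : Cw = π / 2 * ((M ^ 2 + 4 * M) / cu ^ 2)) (hK₁ : K₁ = 2 + c₂ * (1 + Cw)) (hK₁0 : 0 ≤ K₁)
    (hK₂ : K₂ = K₁ * π + 4) (hc₀ : 0 < c₀) (hc₂' : 0 < c₂') (hη₀ : 0 < η₀)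
    (h75 : ∀ θ₁' θ₂' η r₁ r₂ : ℝ, (θ₁', θ₂') ∈ pairChartDomain →
        |r₁| ≤ (2 * K₁ + 4 * c₂) / K₂ * η * pairAngle θ₁' θ₂' → |r₂| ≤ η → η ≤ c₂' * pairAngle θ₁' θ₂' →
          η ≤ η₀ →
          fermiPoint u θ₁' + fermiPoint u θ₂' + (r₁ • unitNormal u θ₁' 0 + r₂ • unitTangent u θ₁' 0)
              ∈ pairRange u ∧
          ∃ θ₁ θ₂ : ℝ,
            fermiPoint u θ₁' + fermiPoint u θ₂' + (r₁ • unitNormal u θ₁' 0 + r₂ • unitTangent u θ₁' 0) =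
              fermiPoint u θ₁ + fermiPoint u θ₂ ∧
            |θ₁ - θ₁'| ≤ c₀ * η ∧ |θ₂ - θ₂'| ≤ c₀ * η)
    (hKΦ : KΦ = max (c₃ * K₂ / c₂') (max c₃ 1))
    (hKfib : Kfib = 4 * (2 * KΦ / π + 1) ^ 2 +
      (4 * (2 * c₀ * K₂ * c₃ / π + 1) ^ 2 + 4 * c₃ ^ 2 * K₂ ^ 2 / η₀ ^ 2))
    {n n' : ℕ} (hn : n ≤ n') {L : ℕ} (hL : 4 ≤ L) (i₁ : Fin L) {ω₁ : ℕ} (hω₁ : ω₁ < sectorCount n')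
    {ωt : Fin L → ℕ} (hωt : ∀ i, ωt i < sectorCount n) :
    (Nat.card (sectorStrings u e₀ n n' L i₁ ω₁ ωt) : ℝ) ≤
      (48 * (Kfib + 1)) ^ L * (2 : ℝ) ^ ((n' - n) * (L - 3)) := by
  classical
  have hKΦ0 : 0 ≤ KΦ := by rw [hKΦ]; exact le_trans zero_le_one (le_max_of_le_right (le_max_right _ _))
  have hKfib0 : 0 ≤ Kfib := by rw [hKfib]; positivity
  -- the strings as a Finset
  set S := (sectorStrings u e₀ n n' L i₁ ω₁ ωt).toFinset with hS
  have hmemS : ∀ ω, ω ∈ S ↔ ω ∈ sectorStrings u e₀ n n' L i₁ ω₁ ωt := fun ω => Set.mem_toFinset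
  have hcardS : Nat.card (sectorStrings u e₀ n n' L i₁ ω₁ ωt) = S.card := by
    rw [hS, Nat.card_eq_card_toFinset]
  rw [hcardS]
  -- the classes
  obtain ⟨T, hT⟩ : ∃ T : Fin L × Fin L → Finset (Fin L → Fin (sectorCount n')),
      ∀ p ω, ω ∈ T p ↔ ω ∈ S ∧ ∀ m l : Fin L, m ≠ i₁ → l ≠ i₁ →
        pairAngle (sectorCenter n' (ω m)) (sectorCenter n' (ω l)) ≤
          pairAngle (sectorCenter n' (ω p.1)) (sectorCenter n' (ω p.2)) :=
    ⟨fun p => S.filter (fun ω => ∀ m l : Fin L, m ≠ i₁ → l ≠ i₁ →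
        pairAngle (sectorCenter n' (ω m)) (sectorCenter n' (ω l)) ≤
          pairAngle (sectorCenter n' (ω p.1)) (sectorCenter n' (ω p.2))), fun p ω => Finset.mem_filter⟩
  obtain ⟨Pairs, hPairs⟩ : ∃ Pairs : Finset (Fin L × Fin L),
      ∀ p, p ∈ Pairs ↔ p.1 ≠ p.2 ∧ p.1 ≠ i₁ ∧ p.2 ≠ i₁ :=
    ⟨Finset.univ.filter (fun p : Fin L × Fin L => p.1 ≠ p.2 ∧ p.1 ≠ i₁ ∧ p.2 ≠ i₁), fun p => by simp⟩
  -- (s1.22): every string has a maximal pair among the legs `≠ i₁`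
  have hcover : S ⊆ Pairs.biUnion T := by
    intro ω hω
    have hPne : Pairs.Nonempty := by
      have hcard : 1 < (Finset.univ.erase i₁).card := by
        rw [Finset.card_erase_of_mem (Finset.mem_univ _), Finset.card_univ, Fintype.card_fin]; omega
      obtain ⟨a, ha, b, hb, hab⟩ := Finset.one_lt_card.1 hcard
      exact ⟨(a, b), (hPairs _).2 ⟨hab, Finset.ne_of_mem_erase ha, Finset.ne_of_mem_erase hb⟩⟩
    obtain ⟨p, hp, hmax⟩ := Pairs.exists_max_image
      (fun q : Fin L × Fin L => pairAngle (sectorCenter n' (ω q.1)) (sectorCenter n' (ω q.2))) hPne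
    rw [Finset.mem_biUnion]
    refine ⟨p, hp, (hT p ω).2 ⟨hω, fun m l hm hl => ?_⟩⟩
    by_cases hml : m = l
    · rw [hml, pairAngle_self']; exact (pairAngle_bounds _ _).1
    · exact hmax (m, l) ((hPairs _).2 ⟨hml, hm, hl⟩)
  -- the bound for one class
  have hclass : ∀ p ∈ Pairs, ((T p).card : ℝ) ≤ Kfib * L ^ 2 * (3 * (2 : ℝ) ^ (n' - n)) ^ (L - 3) := by
    rintro ⟨i, j⟩ hp
    obtain ⟨hij, hi, hj⟩ := (hPairs _).1 hp
    exact class_bound hD hcu huB hlip hpi hc₂ hc₃ h73 hCw hK₁ hK₁0 hK₂ hc₀ hc₂' hη₀ h75 hKΦ hKfib hn hL i₁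
      hω₁ hωt hij hi hj (T (i, j)) (fun ω hω => by
        obtain ⟨h1, h2⟩ := (hT _ ω).1 hω
        exact ⟨(hmemS ω).1 h1, h2⟩)
  -- sum over the classes
  have hPcard : (Pairs.card : ℝ) ≤ L ^ 2 := by
    have : Pairs.card ≤ (Finset.univ : Finset (Fin L × Fin L)).card := Finset.card_le_card (Finset.subset_univ _)
    rw [Finset.card_univ, Fintype.card_prod, Fintype.card_fin] at this
    exact_mod_cast this.trans_eq (by ring)
  have hsum : (S.card : ℝ) ≤ L ^ 2 * (Kfib * L ^ 2 * (3 * (2 : ℝ) ^ (n' - n)) ^ (L - 3)) := by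
    calc (S.card : ℝ) ≤ ((Pairs.biUnion T).card : ℝ) := by exact_mod_cast Finset.card_le_card hcover
      _ ≤ ∑ p ∈ Pairs, ((T p).card : ℝ) := by exact_mod_cast Finset.card_biUnion_le
      _ ≤ ∑ _p ∈ Pairs, Kfib * L ^ 2 * (3 * (2 : ℝ) ^ (n' - n)) ^ (L - 3) := Finset.sum_le_sum hclass
      _ = Pairs.card * (Kfib * L ^ 2 * (3 * (2 : ℝ) ^ (n' - n)) ^ (L - 3)) := by
          rw [Finset.sum_const, nsmul_eq_mul]
      _ ≤ L ^ 2 * (Kfib * L ^ 2 * (3 * (2 : ℝ) ^ (n' - n)) ^ (L - 3)) := by gcongr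
  -- constants: `L⁴ Kfib 3^{L-3} ≤ (48(Kfib+1))^L`
  refine hsum.trans ?_
  have hsplit3 : (3 * (2 : ℝ) ^ (n' - n)) ^ (L - 3) = 3 ^ (L - 3) * (2 : ℝ) ^ ((n' - n) * (L - 3)) := by
    rw [mul_pow, ← pow_mul]
  rw [hsplit3]
  have h3L : (3 : ℝ) ^ (L - 3) ≤ 3 ^ L := pow_le_pow_right₀ (by norm_num) (by omega)
  have h16 := pow_four_le_sixteen_pow L
  have hK : Kfib ≤ (Kfib + 1) ^ L := by
    have h1 : Kfib + 1 ≤ (Kfib + 1) ^ L := by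
      calc Kfib + 1 = (Kfib + 1) ^ 1 := (pow_one _).symm
        _ ≤ (Kfib + 1) ^ L := pow_le_pow_right₀ (by linarith) (by omega)
    linarith
  have h48 : (48 * (Kfib + 1)) ^ L = 16 ^ L * 3 ^ L * (Kfib + 1) ^ L := by
    rw [mul_pow, show (48 : ℝ) = 16 * 3 by norm_num, mul_pow]
  rw [h48]
  have hpos2 : 0 ≤ (2 : ℝ) ^ ((n' - n) * (L - 3)) := by positivity
  calc (L : ℝ) ^ 2 * (Kfib * L ^ 2 * (3 ^ (L - 3) * (2 : ℝ) ^ ((n' - n) * (L - 3))))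
      = (L ^ 4 * 3 ^ (L - 3) * Kfib) * (2 : ℝ) ^ ((n' - n) * (L - 3)) := by ring
    _ ≤ (16 ^ L * 3 ^ L * (Kfib + 1) ^ L) * (2 : ℝ) ^ ((n' - n) * (L - 3)) := by
        apply mul_le_mul_of_nonneg_right _ hpos2
        exact mul_le_mul (mul_le_mul h16 h3L (by positivity) (by positivity)) hK hKfib0 (by positivity)

end Assembly

section TwoLegs

variable {ε : (Fin 2 → ℝ) → ℝ} {μ e₀ : ℝ} {u : ℝ → ℝ → ℝ}

/-- **The case `L = 2`** (p.28 L6–8): momentum conservation and the symmetry (2.8c) force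
`k⃗^{(2)} = -k⃗^{(1)} = |k⃗^{(1)}| e⃗_r(θ + π)`, so by Lemma 7.2 the free sector's centre lies within
`2πγ^{h'/2}` of the antipode of the fixed one: at most `5` strings. [cite: BenfattoGiulianiMastropietro2003, §7.4 p.28 (L6–8)] -/
private theorem count_two (hD : DispersionHyp ε μ e₀ u) {n n' : ℕ} (i₁ : Fin 2) {ω₁ : ℕ}
    (hω₁ : ω₁ < sectorCount n') (ωt : Fin 2 → ℕ) :
    (Nat.card (sectorStrings u e₀ n n' 2 i₁ ω₁ ωt) : ℝ) ≤ 5 := by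
  classical
  obtain ⟨c, -, h72⟩ := lemma72_sectorPolar_holds ε μ e₀ u hD
  obtain ⟨cu, hcu, hu⟩ := hD.u_pos
  -- the other leg
  set io : Fin 2 := ⟨1 - i₁.val, by omega⟩ with hio_def
  have hio : io ≠ i₁ := by
    intro h; have := congrArg Fin.val h; simp [hio_def] at this; omega
  have hcover : ∀ m : Fin 2, m ≠ i₁ → m = io := by
    intro m hm
    apply Fin.ext
    have h1 : m.val ≠ i₁.val := fun h => hm (Fin.ext h)
    have h2 := m.isLt; have h3 := i₁.isLt
    simp [hio_def]; omega
  set S := (sectorStrings u e₀ n n' 2 i₁ ω₁ ωt).toFinset with hS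
  have hmemS : ∀ ω, ω ∈ S ↔ ω ∈ sectorStrings u e₀ n n' 2 i₁ ω₁ ωt := fun ω => Set.mem_toFinset
  have hcardS : Nat.card (sectorStrings u e₀ n n' 2 i₁ ω₁ ωt) = S.card := by
    rw [hS, Nat.card_eq_card_toFinset]
  rw [hcardS]
  set t := (2 : ℝ) ^ (-(n' : ℤ)) with ht
  have htpos : 0 < t := zpow_pos (by norm_num) _
  set D := 2 * (π * t) with hDdef
  set W := Finset.univ.filter (fun a : Fin (sectorCount n') =>
    torusDist (sectorCenter n' a - (sectorCenter n' ω₁ + π)) ≤ D) with hW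
  have hmaps : Set.MapsTo (fun ω : Fin 2 → Fin (sectorCount n') => ω io) S W := by
    intro ω hω
    obtain ⟨hω₁eq, -, k, hk, hsum⟩ := (hmemS ω).1 (Finset.mem_coe.1 hω)
    -- the fixed leg
    have hk₁ : k i₁ ∈ sSector u e₀ n' ω₁ := by have := hk i₁; rwa [hω₁eq] at this
    obtain ⟨θ, e, he, hζ, hkeq⟩ := hk₁
    have he₀ : |e| ≤ e₀ := he.trans (by
      have : (4 : ℝ) ^ (-(n' : ℤ)) ≤ 1 := zpow_le_one_of_nonpos₀ (by norm_num) (by simp)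
      nlinarith [hD.e₀_pos])
    have hρ : 0 < u θ e := lt_of_lt_of_le hcu (hu θ e he₀)
    have hang₁ := (h72 n' ω₁ hω₁ (k i₁) ⟨θ, e, he, hζ, hkeq⟩ (u θ e) θ hρ (by rw [hkeq]; rfl)).2
    -- the free leg is the antipode
    have hk₂ : k io = u θ e • dir (θ + π) := by
      have hs : k i₁ + k io = 0 := by
        rw [← hsum, Fintype.sum_eq_add i₁ io hio.symm]
        intro m hm
        exact absurd (hcover m hm.1) hm.2
      rw [dir_add_pi, smul_neg, show u θ e • dir θ = levelPoint u θ e from rfl, ← hkeq]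
      exact eq_neg_of_add_eq_zero_right hs
    have hang₂ := (h72 n' (ω io) (ω io).isLt (k io) (hk io) (u θ e) (θ + π) hρ hk₂).2
    rw [Finset.mem_coe, hW, Finset.mem_filter]
    refine ⟨Finset.mem_univ _, ?_⟩
    have h1 : torusDist (sectorCenter n' (ω io) - (sectorCenter n' ω₁ + π)) ≤
        torusDist (-(θ + π - sectorCenter n' (ω io))) + torusDist (θ - sectorCenter n' ω₁) := by
      have := torusDist_add_le' (-(θ + π - sectorCenter n' (ω io))) (θ - sectorCenter n' ω₁)
      rwa [show -(θ + π - sectorCenter n' (ω io)) + (θ - sectorCenter n' ω₁) =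
        sectorCenter n' (ω io) - (sectorCenter n' ω₁ + π) by ring] at this
    rw [torusDist_neg'] at h1
    rw [hDdef]
    linarith
  have hinj : Set.InjOn (fun ω : Fin 2 → Fin (sectorCount n') => ω io) S := by
    intro ω hω ω' hω' h
    obtain ⟨hω₁eq, -⟩ := (hmemS ω).1 (Finset.mem_coe.1 hω)
    obtain ⟨hω₁eq', -⟩ := (hmemS ω').1 (Finset.mem_coe.1 hω')
    funext m
    by_cases hm : m = i₁
    · rw [hm]; exact Fin.ext (hω₁eq.trans hω₁eq'.symm)
    · rw [hcover m hm]; exact h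
  have h1 := Finset.card_le_card_of_injOn _ hmaps hinj
  have h2 := card_centres_torus_le n' (sectorCenter n' ω₁ + π) D (by positivity)
  rw [← hW] at h2
  have h3 : 2 * D / sectorWidth n' + 1 = 5 := by
    rw [hDdef, sectorWidth_eq_zpow, ← ht]; field_simp; norm_num
  rw [h3] at h2
  exact (Nat.cast_le.2 h1).trans h2

end TwoLegs

/-- **BGM 2003 Lemma 3.1 [lm4.1] — the sector counting lemma (4.3), PROVED** (discharges the named
fact `lemma31_sectorCounting` of `BGM2003Sectors`), following §7.4 on top of the tree's proved
Lemmas 7.1 (`lemma71_normalAngle_holds`), 7.2 (`lemma72_sectorPolar_holds`), 7.3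
(`lemma73_sectorBox_holds`) and 7.5 (`lemma75_parallelogram_holds`):
* `L = 2`: conservation and (2.8c) put the free sector at the antipode of the fixed one
  (`count_two`, `≤ 5` strings);
* `L ≥ 4`: the strings are covered by the `≤ L²` classes «`(i,j)` is the pair of maximal angular
  separation `φ` among the legs `≠ i₁`» (the reordering (s1.22)); the other `L - 3` legs refine their
  coarse sectors (`≤ 3γ^{(h-h')/2}` choices each, (s1.23), `card_refinements_le`); given those, the
  solved pair has `≤ cL²` completions: `𝒜_<` (s1.24)–(s1.25) (`fibre_small`) and `𝒜_>`
  (s1.26)–(s1.42) (`fibre_large`: the wedge estimate (s1.33)–(s1.34), the displacement box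
  (s1.38)–(s1.40), the particular solution of maximal `φ₀` and Lemma 7.5, plus the two-to-one
  property of `(θ₁,θ₂) ↦ p⃗_F(θ₁) + p⃗_F(θ₂)` on `𝒯` (`fermiSum_eq_cases`, the §7.3 statement
  «each [half of `𝒯`] is in a one to one correspondence through `F` with `𝒟`», proved here from
  the strict support inequality `fermiPoint_support`).
Deviations from the printed argument (bookkeeping only): the solved pair is located through the
sector CENTRES rather than the projections `k⃗_⊥` of Lemma 7.4 (all `L` displacements are put into
`r⃗`), and the regime `η = cLγ^{h'/2} > η₀` of Lemma 7.5 (finitely many scales `h'`) is covered by the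
trivial bound `|O_{h'}|² ≤ cL²`. The constant is `c = max(48(K+1), 5)` with `K` explicit in the
constants of Lemmas 7.1, 7.3, 7.5 and the bounds `c_u ≤ u ≤ M`. [cite: BenfattoGiulianiMastropietro2003, §3.1 Lemma 3.1 (4.3) p.17 (L46–58) and §7.4 (4.3app)–(s1.42) p.27 (L150) – p.28 (L125)] -/
theorem lemma31_sectorCounting_holds : lemma31_sectorCounting := by
  intro ε μ e₀ u hD
  obtain ⟨cu, M, hcu, hcuM, huB⟩ := fermiRadius_bounds hD
  obtain ⟨c₁, c₂, hc₁, hc₁₂, -, hlip2, hpi⟩ := normalAngle_facts hD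
  have hlip : ∀ θ₁ θ₂ : ℝ, torusDist (normalAngle u θ₂ 0 - normalAngle u θ₁ 0) ≤ c₂ * torusDist (θ₂ - θ₁) :=
    fun θ₁ θ₂ => (hlip2 θ₁ θ₂).2
  have hc₂ : 0 ≤ c₂ := hc₁.le.trans hc₁₂
  obtain ⟨c₃, hc₃, h73⟩ := lemma73_sectorBox_holds ε μ e₀ u hD
  obtain ⟨Cw, hCw⟩ : ∃ Cw : ℝ, Cw = π / 2 * ((M ^ 2 + 4 * M) / cu ^ 2) := ⟨_, rfl⟩
  have hM : 0 < M := hcu.trans_le hcuM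
  have hCw0 : 0 ≤ Cw := by rw [hCw]; positivity
  obtain ⟨K₁, hK₁⟩ : ∃ K₁ : ℝ, K₁ = 2 + c₂ * (1 + Cw) := ⟨_, rfl⟩
  have hK₁2 : 2 ≤ K₁ := by rw [hK₁]; nlinarith
  have hK₁0 : 0 ≤ K₁ := by linarith
  obtain ⟨K₂, hK₂⟩ : ∃ K₂ : ℝ, K₂ = K₁ * π + 4 := ⟨_, rfl⟩
  have hK₂0 : 0 < K₂ := by rw [hK₂]; positivity
  have hc₁' : 0 < (2 * K₁ + 4 * c₂) / K₂ := by
    apply div_pos _ hK₂0; linarith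
  obtain ⟨c₀, c₂', η₀, hc₀, hc₂', hη₀, h75⟩ :=
    lemma75_parallelogram_holds ε μ e₀ u hD ((2 * K₁ + 4 * c₂) / K₂) hc₁'
  obtain ⟨KΦ, hKΦ⟩ : ∃ KΦ : ℝ, KΦ = max (c₃ * K₂ / c₂') (max c₃ 1) := ⟨_, rfl⟩
  obtain ⟨Kfib, hKfib⟩ : ∃ Kfib : ℝ, Kfib = 4 * (2 * KΦ / π + 1) ^ 2 +
      (4 * (2 * c₀ * K₂ * c₃ / π + 1) ^ 2 + 4 * c₃ ^ 2 * K₂ ^ 2 / η₀ ^ 2) := ⟨_, rfl⟩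
  have hKfib0 : 0 ≤ Kfib := by rw [hKfib]; positivity
  refine ⟨max (48 * (Kfib + 1)) 5, lt_max_of_lt_right (by norm_num), fun n n' hn => ⟨?_, ?_⟩⟩
  · intro L i₁ ω₁ ωt hL hω₁ hωt
    have h := count_ge_four hD hcu huB hlip hpi hc₂ hc₃ h73 hCw hK₁ hK₁0 hK₂ hc₀ hc₂' hη₀ h75 hKΦ hKfib
      hn hL i₁ hω₁ hωt
    refine h.trans (mul_le_mul_of_nonneg_right ?_ (by positivity))
    exact pow_le_pow_left₀ (by positivity) (le_max_left _ _) L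
  · intro i₁ ω₁ ωt hω₁ _
    exact (count_two hD i₁ hω₁ ωt).trans (le_max_right _ _)


/-- **BGM 2003 Lemma 3.1 (4.3) with the constant EXPLICIT IN THE GEOMETRIC DATA** (uniform form of `lemma31_sectorCounting_holds`,
for families of dispersions — e.g. the flow's admissible frames of cell gate-hubbard-kl — along which the data below are uniform):
if the `DispersionHyp` datum comes with radius bounds `c_u ≤ u(·,0) ≤ M`, the Lipschitz constant `c₂` and the half-turn law of the normal
angle (Lemma 7.1), the sector-box constant `c₃` (Lemma 7.3) and the parallelogram constants `(c₀, c₂′, η₀)` of Lemma 7.5 at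
`c₁′ = (2K₁ + 4c₂)/K₂` (`C_w = (π/2)(M² + 4M)/c_u²`, `K₁ = 2 + c₂(1 + C_w)`, `K₂ = K₁π + 4`), then for all `n ≤ n′` the sector strings obey
`|A| ≤ (48(K_fib + 1))^L · 2^{(n′−n)(L−3)}` (`L ≥ 4`) with
`K_fib = 4(2K_Φ/π + 1)² + 4(2c₀K₂c₃/π + 1)² + 4c₃²K₂²/η₀²`, `K_Φ = max(c₃K₂/c₂′, c₃, 1)`, and `|A| ≤ 5` (`L = 2`) — the printed
`c = max(48(K+1), 5)` of §7.4, read off the proof above. [cite: BenfattoGiulianiMastropietro2003, §3.1 Lemma 3.1 (4.3) p.17 (L46–58) and §7.4 (4.3app)–(s1.42) p.27 (L150) – p.28 (L125)] -/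
theorem lemma31_sectorCounting_of_constants {ε : (Fin 2 → ℝ) → ℝ} {μ e₀ : ℝ} {u : ℝ → ℝ → ℝ}
    (hD : DispersionHyp ε μ e₀ u) {cu M c₂ c₃ Cw K₁ K₂ c₀ c₂' η₀ KΦ Kfib : ℝ}
    (hcu : 0 < cu) (huB : ∀ θ : ℝ, cu ≤ u θ 0 ∧ u θ 0 ≤ M)
    (hlip : ∀ θ₁ θ₂ : ℝ, torusDist (normalAngle u θ₂ 0 - normalAngle u θ₁ 0) ≤ c₂ * torusDist (θ₂ - θ₁))
    (hpi : ∀ θ : ℝ, normalAngle u (θ + π) 0 = normalAngle u θ 0 + π) (hc₂ : 0 ≤ c₂) (hc₃ : 0 < c₃)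
    (h73 : ∀ (n ω : ℕ), ω < sectorCount n → ∀ p ∈ sSector u e₀ n ω,
      ∃ k₁ k₂ : ℝ,
        p = fermiPoint u (sectorCenter n ω) + k₁ • unitNormal u (sectorCenter n ω) 0 +
              k₂ • unitTangent u (sectorCenter n ω) 0 ∧
        |k₁| ≤ c₃ * (4 : ℝ) ^ (-(n : ℤ)) ∧ |k₂| ≤ c₃ * (2 : ℝ) ^ (-(n : ℤ)) ∧
        |fderiv ℝ ε p (unitTangent u (sectorCenter n ω) 0)| ≤ c₃ * (2 : ℝ) ^ (-(n : ℤ)))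
    (hCw : Cw = π / 2 * ((M ^ 2 + 4 * M) / cu ^ 2)) (hK₁ : K₁ = 2 + c₂ * (1 + Cw)) (hK₂ : K₂ = K₁ * π + 4)
    (hc₀ : 0 < c₀) (hc₂' : 0 < c₂') (hη₀ : 0 < η₀)
    (h75 : ∀ θ₁' θ₂' η r₁ r₂ : ℝ, (θ₁', θ₂') ∈ pairChartDomain →
        |r₁| ≤ (2 * K₁ + 4 * c₂) / K₂ * η * pairAngle θ₁' θ₂' → |r₂| ≤ η → η ≤ c₂' * pairAngle θ₁' θ₂' →
          η ≤ η₀ →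
          fermiPoint u θ₁' + fermiPoint u θ₂' + (r₁ • unitNormal u θ₁' 0 + r₂ • unitTangent u θ₁' 0)
              ∈ pairRange u ∧
          ∃ θ₁ θ₂ : ℝ,
            fermiPoint u θ₁' + fermiPoint u θ₂' + (r₁ • unitNormal u θ₁' 0 + r₂ • unitTangent u θ₁' 0) =
              fermiPoint u θ₁ + fermiPoint u θ₂ ∧
            |θ₁ - θ₁'| ≤ c₀ * η ∧ |θ₂ - θ₂'| ≤ c₀ * η)
    (hKΦ : KΦ = max (c₃ * K₂ / c₂') (max c₃ 1))
    (hKfib : Kfib = 4 * (2 * KΦ / π + 1) ^ 2 +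
      (4 * (2 * c₀ * K₂ * c₃ / π + 1) ^ 2 + 4 * c₃ ^ 2 * K₂ ^ 2 / η₀ ^ 2)) :
    ∀ (n n' : ℕ), n ≤ n' →
      (∀ (L : ℕ) (i₁ : Fin L) (ω₁ : ℕ) (ωt : Fin L → ℕ), 4 ≤ L → ω₁ < sectorCount n' →
          (∀ i, ωt i < sectorCount n) →
          (Nat.card (sectorStrings u e₀ n n' L i₁ ω₁ ωt) : ℝ) ≤ (48 * (Kfib + 1)) ^ L * (2 : ℝ) ^ ((n' - n) * (L - 3))) ∧
      (∀ (i₁ : Fin 2) (ω₁ : ℕ) (ωt : Fin 2 → ℕ), ω₁ < sectorCount n' → (∀ i, ωt i < sectorCount n) →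
          (Nat.card (sectorStrings u e₀ n n' 2 i₁ ω₁ ωt) : ℝ) ≤ 5) := by
  intro n n' hn
  have hM : 0 < M := hcu.trans_le ((huB 0).1.trans (huB 0).2)
  have hCw0 : 0 ≤ Cw := by rw [hCw]; positivity
  have hK₁0 : 0 ≤ K₁ := by rw [hK₁]; nlinarith
  refine ⟨fun L i₁ ω₁ ωt hL hω₁ hωt => ?_, fun i₁ ω₁ ωt hω₁ _ => count_two hD i₁ hω₁ ωt⟩
  exact count_ge_four hD hcu huB hlip hpi hc₂ hc₃ h73 hCw hK₁ hK₁0 hK₂ hc₀ hc₂' hη₀ h75 hKΦ hKfib hn hL i₁ hω₁ hωt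

/-- **BGM 2003 §7.4, one max-pair class, with PRESCRIBED fine legs** (brick (T1) of the cell's «KEYED-R1-TWO-ANCHOR» blueprint,
HOME/prover-p4/KEYED-R1-NOTE.md §6): as `class_bound` — the strings of the class «`(i, j)` is the maximal pair among the legs `≠ i₁`» —
but for strings that moreover agree with a prescribed string `τ` on a set `E ∋ i₁` of legs AVOIDING the pair (`i, j ∉ E`); the free sum then runs
over the `L − |E| − 2` legs outside `E ∪ {i, j}`: `≤ K_fib·L²·(3·2^{n′−n})^{L − |E| − 2}`.  (The classes whose max pair MEETS `E` are not covered — they are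
the located gap of that note.) [cite: BenfattoGiulianiMastropietro2003, §7.4 (4.3app), (s1.22)–(s1.25a) p.28 (L6–52)] -/
theorem class_bound_prescribed {ε : (Fin 2 → ℝ) → ℝ} {μ e₀ : ℝ} {u : ℝ → ℝ → ℝ}
    (hD : DispersionHyp ε μ e₀ u) {cu M c₂ c₃ Cw K₁ K₂ c₀ c₂' η₀ KΦ Kfib : ℝ}
    (hcu : 0 < cu) (huB : ∀ θ : ℝ, cu ≤ u θ 0 ∧ u θ 0 ≤ M)
    (hlip : ∀ θ₁ θ₂ : ℝ, torusDist (normalAngle u θ₂ 0 - normalAngle u θ₁ 0) ≤ c₂ * torusDist (θ₂ - θ₁))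
    (hpi : ∀ θ : ℝ, normalAngle u (θ + π) 0 = normalAngle u θ 0 + π) (hc₂ : 0 ≤ c₂) (hc₃ : 0 < c₃)
    (h73 : ∀ (n ω : ℕ), ω < sectorCount n → ∀ p ∈ sSector u e₀ n ω,
      ∃ k₁ k₂ : ℝ,
        p = fermiPoint u (sectorCenter n ω) + k₁ • unitNormal u (sectorCenter n ω) 0 +
              k₂ • unitTangent u (sectorCenter n ω) 0 ∧
        |k₁| ≤ c₃ * (4 : ℝ) ^ (-(n : ℤ)) ∧ |k₂| ≤ c₃ * (2 : ℝ) ^ (-(n : ℤ)) ∧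
        |fderiv ℝ ε p (unitTangent u (sectorCenter n ω) 0)| ≤ c₃ * (2 : ℝ) ^ (-(n : ℤ)))
    (hCw : Cw = π / 2 * ((M ^ 2 + 4 * M) / cu ^ 2)) (hK₁ : K₁ = 2 + c₂ * (1 + Cw)) (hK₁0 : 0 ≤ K₁)
    (hK₂ : K₂ = K₁ * π + 4) (hc₀ : 0 < c₀) (hc₂' : 0 < c₂') (hη₀ : 0 < η₀)
    (h75 : ∀ θ₁' θ₂' η r₁ r₂ : ℝ, (θ₁', θ₂') ∈ pairChartDomain →
        |r₁| ≤ (2 * K₁ + 4 * c₂) / K₂ * η * pairAngle θ₁' θ₂' → |r₂| ≤ η → η ≤ c₂' * pairAngle θ₁' θ₂' →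
          η ≤ η₀ →
          fermiPoint u θ₁' + fermiPoint u θ₂' + (r₁ • unitNormal u θ₁' 0 + r₂ • unitTangent u θ₁' 0)
              ∈ pairRange u ∧
          ∃ θ₁ θ₂ : ℝ,
            fermiPoint u θ₁' + fermiPoint u θ₂' + (r₁ • unitNormal u θ₁' 0 + r₂ • unitTangent u θ₁' 0) =
              fermiPoint u θ₁ + fermiPoint u θ₂ ∧
            |θ₁ - θ₁'| ≤ c₀ * η ∧ |θ₂ - θ₂'| ≤ c₀ * η)
    (hKΦ : KΦ = max (c₃ * K₂ / c₂') (max c₃ 1))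
    (hKfib : Kfib = 4 * (2 * KΦ / π + 1) ^ 2 +
      (4 * (2 * c₀ * K₂ * c₃ / π + 1) ^ 2 + 4 * c₃ ^ 2 * K₂ ^ 2 / η₀ ^ 2))
    {n n' : ℕ} (hn : n ≤ n') {L : ℕ} (hL : 4 ≤ L) (i₁ : Fin L) {ω₁ : ℕ} (hω₁ : ω₁ < sectorCount n')
    {ωt : Fin L → ℕ} (hωt : ∀ i, ωt i < sectorCount n)
    {i j : Fin L} (hij : i ≠ j) (hi : i ≠ i₁) (hj : j ≠ i₁)
    (T : Finset (Fin L → Fin (sectorCount n')))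
    (hT : ∀ ω ∈ T, ω ∈ sectorStrings u e₀ n n' L i₁ ω₁ ωt ∧
      ∀ m l : Fin L, m ≠ i₁ → l ≠ i₁ →
        pairAngle (sectorCenter n' (ω m)) (sectorCenter n' (ω l)) ≤
          pairAngle (sectorCenter n' (ω i)) (sectorCenter n' (ω j)))
    (E : Finset (Fin L)) (τ : Fin L → Fin (sectorCount n')) (hi₁E : i₁ ∈ E) (hiE : i ∉ E) (hjE : j ∉ E)
    (hTE : ∀ ω ∈ T, ∀ e ∈ E, ω e = τ e) :
    (T.card : ℝ) ≤ Kfib * L ^ 2 * (3 * (2 : ℝ) ^ (n' - n)) ^ (L - E.card - 2) := by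
  classical
  have hL1 : (1 : ℝ) ≤ L := by exact_mod_cast (show 1 ≤ L by omega)
  have hKΦ0 : 0 ≤ KΦ := by rw [hKΦ]; exact le_trans zero_le_one (le_max_of_le_right (le_max_right _ _))
  have hKfib0 : 0 ≤ Kfib := by rw [hKfib]; positivity
  set t := (2 : ℝ) ^ (-(n' : ℤ)) with ht
  have htpos : 0 < t := zpow_pos (by norm_num) _
  set Φ := KΦ * L * t with hΦdef
  have hΦ0 : 0 ≤ Φ := by positivity
  have hΦ' : Φ = max (c₃ * K₂ / c₂') (max c₃ 1) * L * (2 : ℝ) ^ (-(n' : ℤ)) := by rw [hΦdef, hKΦ]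
  -- a third free leg `k₀`
  obtain ⟨k₀, hk₀mem⟩ : (((Finset.univ.erase i₁).erase i).erase j).Nonempty := by
    rw [← Finset.card_pos]
    have h1 : i ∈ Finset.univ.erase i₁ := Finset.mem_erase.2 ⟨hi, Finset.mem_univ _⟩
    have h2 : j ∈ (Finset.univ.erase i₁).erase i := Finset.mem_erase.2 ⟨hij.symm, Finset.mem_erase.2 ⟨hj, Finset.mem_univ _⟩⟩
    rw [Finset.card_erase_of_mem h2, Finset.card_erase_of_mem h1, Finset.card_erase_of_mem (Finset.mem_univ _),
      Finset.card_univ, Fintype.card_fin]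
    omega
  have hk₀j : k₀ ≠ j := Finset.ne_of_mem_erase hk₀mem
  have hk₀i : k₀ ≠ i := Finset.ne_of_mem_erase (Finset.mem_of_mem_erase hk₀mem)
  have hk₀ : k₀ ≠ i₁ := Finset.ne_of_mem_erase (Finset.mem_of_mem_erase (Finset.mem_of_mem_erase hk₀mem))
  -- the projection onto the other legs and its target
  set z : Fin (sectorCount n') := ⟨0, sectorCount_pos n'⟩ with hz
  set proj : (Fin L → Fin (sectorCount n')) → (Fin L → Fin (sectorCount n')) :=
    fun ω => Function.update (Function.update ω i z) j z with hproj
  have hproj_i : ∀ ω, proj ω i = z := fun ω => by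
    simp only [hproj]; rw [Function.update_of_ne hij, Function.update_self]
  have hproj_j : ∀ ω, proj ω j = z := fun ω => by simp only [hproj]; rw [Function.update_self]
  have hproj_o : ∀ ω m, m ≠ i → m ≠ j → proj ω m = ω m := fun ω m hmi hmj => by
    simp only [hproj]; rw [Function.update_of_ne hmj, Function.update_of_ne hmi]
  obtain ⟨Ref, hRef⟩ : ∃ Ref : Fin L → Finset (Fin (sectorCount n')),
      ∀ m, Ref m = Finset.univ.filter (fun a : Fin (sectorCount n') => sSector u e₀ n' a ⊆ sSector u e₀ n (ωt m)) :=
    ⟨_, fun m => rfl⟩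
  have hRefcard : ∀ m, (Ref m).card ≤ 3 * 2 ^ (n' - n) := fun m => by
    rw [hRef]; exact card_refinements_le hD hn (hωt m)
  set tf : Fin L → Finset (Fin (sectorCount n')) :=
    fun m => if m = i ∨ m = j then {z} else if m ∈ E then {τ m} else Ref m with htf
  set A := Fintype.piFinset tf with hA
  -- strings of the class project into `A`
  have hmaps : ∀ ω ∈ T, proj ω ∈ A := by
    intro ω hω
    obtain ⟨hωS, -⟩ := hT ω hω
    obtain ⟨-, hsub, -⟩ := hωS
    rw [hA, Fintype.mem_piFinset]
    intro m
    simp only [htf]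
    by_cases hm : m = i ∨ m = j
    · rw [if_pos hm, Finset.mem_singleton]
      rcases hm with rfl | rfl
      · exact hproj_i ω
      · exact hproj_j ω
    · rw [if_neg hm]
      rw [not_or] at hm
      rw [hproj_o ω m hm.1 hm.2]
      by_cases hm₁ : m ∈ E
      · rw [if_pos hm₁, Finset.mem_singleton]
        exact hTE ω hω m hm₁
      · rw [if_neg hm₁, hRef, Finset.mem_filter]
        have hmi₁ : m ≠ i₁ := fun h => hm₁ (h ▸ hi₁E)
        exact ⟨Finset.mem_univ _, hsub m hmi₁⟩
  -- the fibres: the solved pair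
  have hfib : ∀ ρ ∈ A, ((T).filter (fun ω => proj ω = ρ)).card ≤ ⌊Kfib * L ^ 2⌋₊ := by
    intro ρ _
    apply Nat.le_floor
    refine fibre_bound hD hcu huB hlip hpi hc₂ hc₃ h73 hCw hK₁ hK₁0 hK₂ hc₀ hc₂' hη₀ h75 hKΦ hKfib hn hL i₁
      hω₁ hωt hij hi hj hk₀i hk₀j hk₀ ρ _ (fun ω hω => ?_)
    obtain ⟨hωT, hωρ⟩ := Finset.mem_filter.1 hω
    obtain ⟨hωS, hωMP⟩ := hT ω hωT
    exact ⟨hωS, hωMP, fun m hmi hmj => by rw [← hproj_o ω m hmi hmj, hωρ]⟩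
  -- the size of the target `A`: (s1.23) for each of the `L - |E| - 2` free legs
  have hAcard : A.card ≤ (3 * 2 ^ (n' - n)) ^ (L - E.card - 2) := by
    rw [hA, Fintype.card_piFinset]
    have hle : ∀ m, (tf m).card ≤ if m = i ∨ m = j ∨ m ∈ E then 1 else 3 * 2 ^ (n' - n) := by
      intro m
      simp only [htf]
      by_cases hm : m = i ∨ m = j
      · rw [if_pos hm, if_pos (by tauto), Finset.card_singleton]
      · rw [if_neg hm]
        by_cases hm₁ : m ∈ E
        · rw [if_pos hm₁, if_pos (by tauto), Finset.card_singleton]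
        · rw [if_neg hm₁, if_neg (by tauto)]; exact hRefcard m
    calc ∏ m, (tf m).card ≤ ∏ m : Fin L, (if m = i ∨ m = j ∨ m ∈ E then 1 else 3 * 2 ^ (n' - n)) :=
          Finset.prod_le_prod' fun m _ => hle m
      _ = (3 * 2 ^ (n' - n)) ^ (Finset.univ.filter (fun m : Fin L => ¬(m = i ∨ m = j ∨ m ∈ E))).card := by
          rw [Finset.prod_ite, Finset.prod_const_one, one_mul, Finset.prod_const]
      _ = (3 * 2 ^ (n' - n)) ^ (L - E.card - 2) := by
          congr 1
          have h3 : (Finset.univ.filter (fun m : Fin L => m = i ∨ m = j ∨ m ∈ E)).card = E.card + 2 := by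
            have hset : Finset.univ.filter (fun m : Fin L => m = i ∨ m = j ∨ m ∈ E) = insert i (insert j E) := by
              ext m; simp [Finset.mem_insert]
            rw [hset, Finset.card_insert_of_notMem (by simp [hij, hiE]), Finset.card_insert_of_notMem hjE]
          have := Finset.card_filter_add_card_filter_not (s := (Finset.univ : Finset (Fin L)))
            (fun m : Fin L => m = i ∨ m = j ∨ m ∈ E)
          rw [h3, Finset.card_univ, Fintype.card_fin] at this
          omega
  -- assemble the class bound
  have hTle := Finset.card_le_mul_card_image_of_maps_to hmaps (⌊Kfib * L ^ 2⌋₊) hfib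
  have h1 : ((T).card : ℝ) ≤ (⌊Kfib * ↑L ^ 2⌋₊ : ℝ) * (A.card : ℝ) := by exact_mod_cast hTle
  have h2 : (⌊Kfib * ↑L ^ 2⌋₊ : ℝ) ≤ Kfib * L ^ 2 := Nat.floor_le (by positivity)
  have h3 : (A.card : ℝ) ≤ (3 * (2 : ℝ) ^ (n' - n)) ^ (L - E.card - 2) := by exact_mod_cast hAcard
  calc ((T).card : ℝ) ≤ (⌊Kfib * ↑L ^ 2⌋₊ : ℝ) * (A.card : ℝ) := h1
    _ ≤ Kfib * L ^ 2 * (3 * (2 : ℝ) ^ (n' - n)) ^ (L - E.card - 2) :=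
        mul_le_mul h2 h3 (by positivity) (by positivity)

/-- **BGM 2003 §7.4 with PRESCRIBED fine legs, generic-position classes** (brick (T2) of «KEYED-R1-TWO-ANCHOR», HOME/prover-p4/KEYED-R1-NOTE.md §6):
the scale-`n′` sector strings refining given scale-`n` sectors (first entry `i₁` fixed), agreeing with a prescribed string `τ` on a leg set `E ∋ i₁`,
compatible with `Σ k⃗ᵢ = 0` in `ℝ²`, AND admitting a maximal-separation pair `(i, j)` among the legs `≠ i₁` that AVOIDS `E`, number at most
`(48(K_fib + 1))^L · 2^{(n′−n)(L − |E| − 2)}` — the honest two-more-legs-determined exponent.  The complementary classes (every maximal pair meets `E`)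
are NOT counted here (located gap (T3) of that note). [cite: BenfattoGiulianiMastropietro2003, §7.4 (4.3app), (s1.22)–(s1.25a) p.28 (L6–52)] -/
theorem count_prescribed_generic {ε : (Fin 2 → ℝ) → ℝ} {μ e₀ : ℝ} {u : ℝ → ℝ → ℝ}
    (hD : DispersionHyp ε μ e₀ u) {cu M c₂ c₃ Cw K₁ K₂ c₀ c₂' η₀ KΦ Kfib : ℝ}
    (hcu : 0 < cu) (huB : ∀ θ : ℝ, cu ≤ u θ 0 ∧ u θ 0 ≤ M)
    (hlip : ∀ θ₁ θ₂ : ℝ, torusDist (normalAngle u θ₂ 0 - normalAngle u θ₁ 0) ≤ c₂ * torusDist (θ₂ - θ₁))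
    (hpi : ∀ θ : ℝ, normalAngle u (θ + π) 0 = normalAngle u θ 0 + π) (hc₂ : 0 ≤ c₂) (hc₃ : 0 < c₃)
    (h73 : ∀ (n ω : ℕ), ω < sectorCount n → ∀ p ∈ sSector u e₀ n ω,
      ∃ k₁ k₂ : ℝ,
        p = fermiPoint u (sectorCenter n ω) + k₁ • unitNormal u (sectorCenter n ω) 0 +
              k₂ • unitTangent u (sectorCenter n ω) 0 ∧
        |k₁| ≤ c₃ * (4 : ℝ) ^ (-(n : ℤ)) ∧ |k₂| ≤ c₃ * (2 : ℝ) ^ (-(n : ℤ)) ∧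
        |fderiv ℝ ε p (unitTangent u (sectorCenter n ω) 0)| ≤ c₃ * (2 : ℝ) ^ (-(n : ℤ)))
    (hCw : Cw = π / 2 * ((M ^ 2 + 4 * M) / cu ^ 2)) (hK₁ : K₁ = 2 + c₂ * (1 + Cw)) (hK₁0 : 0 ≤ K₁)
    (hK₂ : K₂ = K₁ * π + 4) (hc₀ : 0 < c₀) (hc₂' : 0 < c₂') (hη₀ : 0 < η₀)
    (h75 : ∀ θ₁' θ₂' η r₁ r₂ : ℝ, (θ₁', θ₂') ∈ pairChartDomain →
        |r₁| ≤ (2 * K₁ + 4 * c₂) / K₂ * η * pairAngle θ₁' θ₂' → |r₂| ≤ η → η ≤ c₂' * pairAngle θ₁' θ₂' →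
          η ≤ η₀ →
          fermiPoint u θ₁' + fermiPoint u θ₂' + (r₁ • unitNormal u θ₁' 0 + r₂ • unitTangent u θ₁' 0)
              ∈ pairRange u ∧
          ∃ θ₁ θ₂ : ℝ,
            fermiPoint u θ₁' + fermiPoint u θ₂' + (r₁ • unitNormal u θ₁' 0 + r₂ • unitTangent u θ₁' 0) =
              fermiPoint u θ₁ + fermiPoint u θ₂ ∧
            |θ₁ - θ₁'| ≤ c₀ * η ∧ |θ₂ - θ₂'| ≤ c₀ * η)
    (hKΦ : KΦ = max (c₃ * K₂ / c₂') (max c₃ 1))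
    (hKfib : Kfib = 4 * (2 * KΦ / π + 1) ^ 2 +
      (4 * (2 * c₀ * K₂ * c₃ / π + 1) ^ 2 + 4 * c₃ ^ 2 * K₂ ^ 2 / η₀ ^ 2))
    {n n' : ℕ} (hn : n ≤ n') {L : ℕ} (hL : 4 ≤ L) (i₁ : Fin L) {ω₁ : ℕ} (hω₁ : ω₁ < sectorCount n')
    {ωt : Fin L → ℕ} (hωt : ∀ i, ωt i < sectorCount n)
    (E : Finset (Fin L)) (τ : Fin L → Fin (sectorCount n')) (hi₁E : i₁ ∈ E) :
    (Nat.card {ω : Fin L → Fin (sectorCount n') | ω ∈ sectorStrings u e₀ n n' L i₁ ω₁ ωt ∧ (∀ e ∈ E, ω e = τ e) ∧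
        ∃ i j : Fin L, i ≠ j ∧ i ≠ i₁ ∧ j ≠ i₁ ∧ i ∉ E ∧ j ∉ E ∧
          ∀ m l : Fin L, m ≠ i₁ → l ≠ i₁ →
            pairAngle (sectorCenter n' (ω m)) (sectorCenter n' (ω l)) ≤
              pairAngle (sectorCenter n' (ω i)) (sectorCenter n' (ω j))} : ℝ) ≤
      (48 * (Kfib + 1)) ^ L * (2 : ℝ) ^ ((n' - n) * (L - E.card - 2)) := by
  classical
  have hKΦ0 : 0 ≤ KΦ := by rw [hKΦ]; exact le_trans zero_le_one (le_max_of_le_right (le_max_right _ _))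
  have hKfib0 : 0 ≤ Kfib := by rw [hKfib]; positivity
  -- the strings as a Finset
  set G := {ω : Fin L → Fin (sectorCount n') | ω ∈ sectorStrings u e₀ n n' L i₁ ω₁ ωt ∧ (∀ e ∈ E, ω e = τ e) ∧
        ∃ i j : Fin L, i ≠ j ∧ i ≠ i₁ ∧ j ≠ i₁ ∧ i ∉ E ∧ j ∉ E ∧
          ∀ m l : Fin L, m ≠ i₁ → l ≠ i₁ →
            pairAngle (sectorCenter n' (ω m)) (sectorCenter n' (ω l)) ≤
              pairAngle (sectorCenter n' (ω i)) (sectorCenter n' (ω j))} with hG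
  set S := G.toFinset with hS
  have hmemS : ∀ ω, ω ∈ S ↔ ω ∈ G := fun ω => Set.mem_toFinset
  have hcardS : Nat.card G = S.card := by rw [hS, Nat.card_eq_card_toFinset]
  rw [hcardS]
  -- the classes
  obtain ⟨T, hT⟩ : ∃ T : Fin L × Fin L → Finset (Fin L → Fin (sectorCount n')),
      ∀ p ω, ω ∈ T p ↔ ω ∈ S ∧ ∀ m l : Fin L, m ≠ i₁ → l ≠ i₁ →
        pairAngle (sectorCenter n' (ω m)) (sectorCenter n' (ω l)) ≤
          pairAngle (sectorCenter n' (ω p.1)) (sectorCenter n' (ω p.2)) :=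
    ⟨fun p => S.filter (fun ω => ∀ m l : Fin L, m ≠ i₁ → l ≠ i₁ →
        pairAngle (sectorCenter n' (ω m)) (sectorCenter n' (ω l)) ≤
          pairAngle (sectorCenter n' (ω p.1)) (sectorCenter n' (ω p.2))), fun p ω => Finset.mem_filter⟩
  obtain ⟨Pairs, hPairs⟩ : ∃ Pairs : Finset (Fin L × Fin L),
      ∀ p, p ∈ Pairs ↔ p.1 ≠ p.2 ∧ p.1 ≠ i₁ ∧ p.2 ≠ i₁ ∧ p.1 ∉ E ∧ p.2 ∉ E :=
    ⟨Finset.univ.filter (fun p : Fin L × Fin L => p.1 ≠ p.2 ∧ p.1 ≠ i₁ ∧ p.2 ≠ i₁ ∧ p.1 ∉ E ∧ p.2 ∉ E), fun p => by simp⟩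
  -- every generic string lies in the class of its E-avoiding maximal pair
  have hcover : S ⊆ Pairs.biUnion T := by
    intro ω hω
    obtain ⟨-, -, i, j, hij, hi, hj, hiE, hjE, hmax⟩ := (hmemS ω).1 hω
    rw [Finset.mem_biUnion]
    exact ⟨(i, j), (hPairs _).2 ⟨hij, hi, hj, hiE, hjE⟩, (hT (i, j) ω).2 ⟨hω, hmax⟩⟩
  -- the bound for one class
  have hclass : ∀ p ∈ Pairs, ((T p).card : ℝ) ≤ Kfib * L ^ 2 * (3 * (2 : ℝ) ^ (n' - n)) ^ (L - E.card - 2) := by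
    rintro ⟨i, j⟩ hp
    obtain ⟨hij, hi, hj, hiE, hjE⟩ := (hPairs _).1 hp
    exact class_bound_prescribed hD hcu huB hlip hpi hc₂ hc₃ h73 hCw hK₁ hK₁0 hK₂ hc₀ hc₂' hη₀ h75 hKΦ hKfib hn hL i₁
      hω₁ hωt hij hi hj (T (i, j)) (fun ω hω => by
        obtain ⟨h1, h2⟩ := (hT _ ω).1 hω
        exact ⟨((hmemS ω).1 h1).1, h2⟩) E τ hi₁E hiE hjE (fun ω hω => by
        obtain ⟨h1, -⟩ := (hT _ ω).1 hω
        exact ((hmemS ω).1 h1).2.1)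
  -- sum over the classes
  have hPcard : (Pairs.card : ℝ) ≤ L ^ 2 := by
    have : Pairs.card ≤ (Finset.univ : Finset (Fin L × Fin L)).card := Finset.card_le_card (Finset.subset_univ _)
    rw [Finset.card_univ, Fintype.card_prod, Fintype.card_fin] at this
    exact_mod_cast this.trans_eq (by ring)
  have hsum : (S.card : ℝ) ≤ L ^ 2 * (Kfib * L ^ 2 * (3 * (2 : ℝ) ^ (n' - n)) ^ (L - E.card - 2)) := by
    calc (S.card : ℝ) ≤ ((Pairs.biUnion T).card : ℝ) := by exact_mod_cast Finset.card_le_card hcover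
      _ ≤ ∑ p ∈ Pairs, ((T p).card : ℝ) := by exact_mod_cast Finset.card_biUnion_le
      _ ≤ ∑ _p ∈ Pairs, Kfib * L ^ 2 * (3 * (2 : ℝ) ^ (n' - n)) ^ (L - E.card - 2) := Finset.sum_le_sum hclass
      _ = Pairs.card * (Kfib * L ^ 2 * (3 * (2 : ℝ) ^ (n' - n)) ^ (L - E.card - 2)) := by
          rw [Finset.sum_const, nsmul_eq_mul]
      _ ≤ L ^ 2 * (Kfib * L ^ 2 * (3 * (2 : ℝ) ^ (n' - n)) ^ (L - E.card - 2)) := by gcongr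
  -- constants: `L⁴ Kfib 3^{L-|E|-2} ≤ (48(Kfib+1))^L`
  refine hsum.trans ?_
  have hsplit3 : (3 * (2 : ℝ) ^ (n' - n)) ^ (L - E.card - 2) = 3 ^ (L - E.card - 2) * (2 : ℝ) ^ ((n' - n) * (L - E.card - 2)) := by
    rw [mul_pow, ← pow_mul]
  rw [hsplit3]
  have h3L : (3 : ℝ) ^ (L - E.card - 2) ≤ 3 ^ L := pow_le_pow_right₀ (by norm_num) (by omega)
  have h16 := pow_four_le_sixteen_pow L
  have hK : Kfib ≤ (Kfib + 1) ^ L := by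
    have h1 : Kfib + 1 ≤ (Kfib + 1) ^ L := by
      calc Kfib + 1 = (Kfib + 1) ^ 1 := (pow_one _).symm
        _ ≤ (Kfib + 1) ^ L := pow_le_pow_right₀ (by linarith) (by omega)
    linarith
  have h48 : (48 * (Kfib + 1)) ^ L = 16 ^ L * 3 ^ L * (Kfib + 1) ^ L := by
    rw [mul_pow, show (48 : ℝ) = 16 * 3 by norm_num, mul_pow]
  rw [h48]
  have hpos2 : 0 ≤ (2 : ℝ) ^ ((n' - n) * (L - E.card - 2)) := by positivity
  calc (L : ℝ) ^ 2 * (Kfib * L ^ 2 * (3 ^ (L - E.card - 2) * (2 : ℝ) ^ ((n' - n) * (L - E.card - 2))))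
      = (L ^ 4 * 3 ^ (L - E.card - 2) * Kfib) * (2 : ℝ) ^ ((n' - n) * (L - E.card - 2)) := by ring
    _ ≤ (16 ^ L * 3 ^ L * (Kfib + 1) ^ L) * (2 : ℝ) ^ ((n' - n) * (L - E.card - 2)) := by
        apply mul_le_mul_of_nonneg_right _ hpos2
        exact mul_le_mul (mul_le_mul h16 h3L (by positivity) (by positivity)) hK hKfib0 (by positivity)

end BGM2003

end Literature.MathematicalPhysics.QuantumLattice.FermiRG

/-! ### BGM 2006 App. A4 (A4.1)/(A4.3): ONE-LEG DETERMINATION — all legs of a vertex but one in fixed fine sectors fix the last one up to `O(L)` sectors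
(«simply by momentum conservation»; the primitive (P1) of the routed sector count, located-risk #10 of the Hubbard KL cell) -/

namespace Literature.MathematicalPhysics.QuantumLattice.FermiRG

namespace BGM2003

open Real Set

section OneLeg

variable {ε : (Fin 2 → ℝ) → ℝ} {μ e₀ : ℝ} {u : ℝ → ℝ → ℝ}

/-- The sum of the squared components of `ρ e⃗_r(θ) − ρ′ e⃗_r(θ′)` is `ρ² + ρ′² − 2ρρ′cos(θ − θ′)`. [folklore] -/
private theorem polar_sub_sq (ρ ρ' θ θ' : ℝ) :
    (ρ • dir θ - ρ' • dir θ') 0 ^ 2 + (ρ • dir θ - ρ' • dir θ') 1 ^ 2 = ρ ^ 2 + ρ' ^ 2 - 2 * ρ * ρ' * Real.cos (θ - θ') := by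
  simp only [Pi.sub_apply, smul_dir_apply_zero', smul_dir_apply_one']
  rw [Real.cos_sub]
  have h1 := Real.sin_sq_add_cos_sq θ
  have h2 := Real.sin_sq_add_cos_sq θ'
  linear_combination ρ ^ 2 * h1 + ρ' ^ 2 * h2

/-- The component of `ρ e⃗_r(θ) − ρ′ e⃗_r(θ′)` along `e⃗_t(θ) = (−sin θ, cos θ)` is `−ρ′ sin(θ′ − θ)`. [folklore] -/
private theorem polar_sub_cross (ρ ρ' θ θ' : ℝ) :
    (ρ • dir θ - ρ' • dir θ') 0 * (-Real.sin θ) + (ρ • dir θ - ρ' • dir θ') 1 * Real.cos θ = -(ρ' * Real.sin (θ' - θ)) := by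
  simp only [Pi.sub_apply, smul_dir_apply_zero', smul_dir_apply_one']
  rw [Real.sin_sub]
  ring

/-- `|sin d| = sin |d|` for `|d| ≤ π`. [folklore] -/
private theorem abs_sin_eq_sin_abs {d : ℝ} (hd : |d| ≤ π) : |Real.sin d| = Real.sin |d| := by
  rcases le_or_gt 0 d with h0 | h0
  · rw [abs_of_nonneg h0] at hd ⊢
    exact abs_of_nonneg (Real.sin_nonneg_of_nonneg_of_le_pi h0 hd)
  · rw [abs_of_neg h0] at hd ⊢
    rw [Real.sin_neg]
    exact abs_of_nonpos (by have := Real.sin_nonneg_of_nonneg_of_le_pi (by linarith : 0 ≤ -d) hd; rw [Real.sin_neg] at this; linarith)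

/-- **Angular separation on a star-shaped curve**: for radii `ρ, ρ′ ≥ cu > 0`,
`(cu/π)·‖θ − θ′‖_{𝕋¹} ≤ |v 0| + |v 1|` with `v = ρ e⃗_r(θ) − ρ′ e⃗_r(θ′)`. [folklore] -/
private theorem torusDist_le_of_polar {ρ ρ' θ θ' cu : ℝ} (hcu : 0 < cu) (hρ : cu ≤ ρ) (hρ' : cu ≤ ρ') :
    cu / π * torusDist (θ - θ') ≤ |(ρ • dir θ - ρ' • dir θ') 0| + |(ρ • dir θ - ρ' • dir θ') 1| := by
  set v := ρ • dir θ - ρ' • dir θ' with hv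
  obtain ⟨k, d, hx, hdπ, hdist⟩ := torusDist_rep (θ - θ')
  rw [hdist]
  have hρ0 : 0 < ρ := hcu.trans_le hρ
  have hρ'0 : 0 < ρ' := hcu.trans_le hρ'
  have hS0 : 0 ≤ |v 0| + |v 1| := by positivity
  by_cases hd : |d| ≤ π / 2
  · -- `ρ′|sin(θ′−θ)| ≤ |v 0| + |v 1|` and Jordan's inequality on `|d| ≤ π/2`
    have hcross := polar_sub_cross ρ ρ' θ θ'
    have hsin : |Real.sin (θ' - θ)| = Real.sin |d| := by
      rw [show θ' - θ = -(d + k * (2 * π)) by linarith, Real.sin_neg, abs_neg, Real.sin_add_int_mul_two_pi]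
      exact abs_sin_eq_sin_abs hdπ
    have hj : 2 / π * |d| ≤ Real.sin |d| := Real.mul_le_sin (abs_nonneg d) hd
    have hcomp : |ρ' * Real.sin (θ' - θ)| ≤ |v 0| + |v 1| := by
      rw [← abs_neg, ← hcross]
      calc |v 0 * -Real.sin θ + v 1 * Real.cos θ| ≤ |v 0 * -Real.sin θ| + |v 1 * Real.cos θ| := abs_add_le _ _
        _ ≤ |v 0| + |v 1| := by
          rw [abs_mul, abs_mul, abs_neg]
          exact add_le_add (mul_le_of_le_one_right (abs_nonneg _) (Real.abs_sin_le_one _))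
            (mul_le_of_le_one_right (abs_nonneg _) (Real.abs_cos_le_one _))
    rw [abs_mul, abs_of_pos hρ'0, hsin] at hcomp
    calc cu / π * |d| ≤ cu * (2 / π * |d|) := by
          rw [show cu * (2 / π * |d|) = 2 * (cu / π * |d|) by ring]
          have : 0 ≤ cu / π * |d| := by positivity
          linarith
      _ ≤ ρ' * Real.sin |d| := mul_le_mul hρ' hj (by positivity) hρ'0.le
      _ ≤ |v 0| + |v 1| := hcomp
  · -- `|d| > π/2`: `cos(θ−θ′) ≤ 0`, so `|v|² ≥ ρ² + ρ′² ≥ cu²` and `|d| ≤ π`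
    rw [not_le] at hd
    have hcos : Real.cos (θ - θ') ≤ 0 := by
      rw [hx, Real.cos_add_int_mul_two_pi, ← Real.cos_abs]
      exact Real.cos_nonpos_of_pi_div_two_le_of_le hd.le (by linarith)
    have hsq := polar_sub_sq ρ ρ' θ θ'
    have hsq' : cu ^ 2 ≤ (|v 0| + |v 1|) ^ 2 := by
      have h2 : 0 ≤ -(2 * ρ * ρ' * Real.cos (θ - θ')) := by
        have : 0 ≤ 2 * ρ * ρ' := by positivity
        nlinarith
      have hv2 : v 0 ^ 2 + v 1 ^ 2 ≤ (|v 0| + |v 1|) ^ 2 := by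
        rw [← sq_abs (v 0), ← sq_abs (v 1)]; nlinarith [abs_nonneg (v 0), abs_nonneg (v 1)]
      have hcu2 : cu ^ 2 ≤ ρ ^ 2 := pow_le_pow_left₀ hcu.le hρ 2
      nlinarith [sq_nonneg ρ']
    have hle : cu ≤ |v 0| + |v 1| := (pow_le_pow_iff_left₀ hcu.le hS0 (by norm_num : (2 : ℕ) ≠ 0)).1 hsq'
    calc cu / π * |d| ≤ cu / π * π := mul_le_mul_of_nonneg_left hdπ (by positivity)
      _ = cu := by field_simp
      _ ≤ |v 0| + |v 1| := hle

open Classical in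
/-- **ONE-LEG DETERMINATION** (BGM 2006 App. A4, the bound behind (A4.1)/(A4.3) «simply by momentum conservation»; primitive (P1) of the routed sector
count): if all legs of an `L`-leg vertex except `f₀` carry FIXED fine sectors `σ i` at scale `n`, the number of sectors of the leg `f₀` for which the string
admits momenta `k⃗ᵢ ∈ S_{n,ωᵢ}` with `Σ k⃗ᵢ = 0` is at most `16(c₃/cu)·L + 5` — uniformly in `n` — where `c₃` is the sector-box constant of Lemma 7.3 and
`cu` the lower radius of the shell.  Proof: two admissible strings have `k⃗_{f₀}` within `4c₃L·2^{−n}` componentwise (the other boxes have diameter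
`≤ 4c₃2^{−n}`), hence polar angles within `8πc₃L2^{−n}/cu` (`torusDist_le_of_polar`), hence centres within `π2^{−n}(2 + 8c₃L/cu)` (Lemma 7.2), and
`card_centres_torus_le` counts them. [cite: BenfattoGiulianiMastropietro2006, App. A4 (A4.1)–(A4.3)] -/
theorem card_oneLeg_le (hD : DispersionHyp ε μ e₀ u) {c₃ : ℝ}
    (h73 : ∀ (n ω : ℕ), ω < sectorCount n → ∀ p ∈ sSector u e₀ n ω,
      ∃ k₁ k₂ : ℝ,
        p = fermiPoint u (sectorCenter n ω) + k₁ • unitNormal u (sectorCenter n ω) 0 +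
              k₂ • unitTangent u (sectorCenter n ω) 0 ∧
        |k₁| ≤ c₃ * (4 : ℝ) ^ (-(n : ℤ)) ∧ |k₂| ≤ c₃ * (2 : ℝ) ^ (-(n : ℤ)) ∧
        |fderiv ℝ ε p (unitTangent u (sectorCenter n ω) 0)| ≤ c₃ * (2 : ℝ) ^ (-(n : ℤ)))
    {cu : ℝ} (hcu : 0 < cu) (hu : ∀ θ e : ℝ, |e| ≤ e₀ → cu ≤ u θ e)
    (n : ℕ) {L : ℕ} (f₀ : Fin L) (σ : Fin L → Fin (sectorCount n)) :
    (Nat.card {ω : Fin L → Fin (sectorCount n) | (∀ i, i ≠ f₀ → ω i = σ i) ∧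
        ∃ k : Fin L → (Fin 2 → ℝ), (∀ i, k i ∈ sSector u e₀ n (ω i : ℕ)) ∧ ∑ i, k i = 0} : ℝ) ≤
      16 * (c₃ / cu) * L + 5 := by
  classical
  have he₀ := hD.e₀_pos
  obtain ⟨c72, -, h72⟩ := lemma72_sectorPolar_holds ε μ e₀ u hD
  set S := {ω : Fin L → Fin (sectorCount n) | (∀ i, i ≠ f₀ → ω i = σ i) ∧
        ∃ k : Fin L → (Fin 2 → ℝ), (∀ i, k i ∈ sSector u e₀ n (ω i : ℕ)) ∧ ∑ i, k i = 0} with hSdef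
  have hc₃0 : 0 ≤ c₃ := by
    -- any sector is nonempty (its centre's Fermi point), so `0 ≤ |k₂| ≤ c₃·2^{-0}` at `n = 0`
    obtain ⟨k₁, k₂, -, -, hk₂, -⟩ := h73 0 0 (sectorCount_pos 0) _ (fermiPoint_centre_mem_sSector hD 0 0)
    have : (0 : ℝ) ≤ c₃ * (2 : ℝ) ^ (-((0 : ℕ) : ℤ)) := (abs_nonneg _).trans hk₂
    simpa using this
  have hRHS0 : 0 ≤ 16 * (c₃ / cu) * L + 5 := by positivity
  rcases S.eq_empty_or_nonempty with hSe | ⟨ω0, hω0⟩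
  · rw [hSe]; simp; linarith
  obtain ⟨hω0σ, k0, hk0, hsum0⟩ := hω0
  -- abbreviations
  set tn : ℝ := (2 : ℝ) ^ (-(n : ℤ)) with htn
  have htn0 : 0 < tn := by rw [htn]; positivity
  have h4le : (4 : ℝ) ^ (-(n : ℤ)) ≤ tn := by
    rw [htn, zpow_neg, zpow_neg, zpow_natCast, zpow_natCast]
    exact inv_anti₀ (by positivity) (pow_le_pow_left₀ (by norm_num) (by norm_num) n)
  have h4le1 : (4 : ℝ) ^ (-(n : ℤ)) ≤ 1 := by
    rw [zpow_neg, zpow_natCast]; exact inv_le_one_of_one_le₀ (one_le_pow₀ (by norm_num))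
  set θc : Fin (sectorCount n) → ℝ := fun a => sectorCenter n a with hθc
  set D : ℝ := π * tn * (2 + 8 * c₃ * L / cu) with hDdef
  have hD0 : 0 ≤ D := by rw [hDdef]; positivity
  -- the polar data of an admissible `k f₀ ∈ S_{n, a}`: radius `≥ cu`, angle within `π·tn` of the centre (Lemma 7.2)
  have hpolar : ∀ (a : Fin (sectorCount n)) (p : Fin 2 → ℝ), p ∈ sSector u e₀ n (a : ℕ) →
      ∃ ρ θ : ℝ, cu ≤ ρ ∧ p = ρ • dir θ ∧ torusDist (θ - θc a) ≤ π * tn := by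
    intro a p hp
    obtain ⟨θ, e, he, -, hpe⟩ := id hp
    have he' : |e| ≤ e₀ := he.trans (mul_le_of_le_one_left he₀.le h4le1)
    have hρ : cu ≤ u θ e := hu θ e he'
    have hpe' : p = u θ e • dir θ := hpe
    exact ⟨u θ e, θ, hρ, hpe', by simpa [htn] using (h72 n a a.isLt p hp (u θ e) θ (hcu.trans_le hρ) hpe').2⟩
  -- two points of one sector box are componentwise `≤ 4c₃·tn` apart (Lemma 7.3)
  have hbox : ∀ (a : ℕ), a < sectorCount n → ∀ p q : Fin 2 → ℝ, p ∈ sSector u e₀ n a → q ∈ sSector u e₀ n a →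
      ∀ j : Fin 2, |(p - q) j| ≤ 4 * c₃ * tn := by
    intro a ha p q hp hq j
    obtain ⟨x, y, hpx, hx, hy, -⟩ := h73 n a ha p hp
    obtain ⟨x', y', hqx, hx', hy', -⟩ := h73 n a ha q hq
    have hu0 : 0 < u (sectorCenter n a) 0 := hcu.trans_le (hu _ 0 (by simp [he₀.le]))
    have hdiff : p - q = (x - x') • unitNormal u (sectorCenter n a) 0 + (y - y') • unitTangent u (sectorCenter n a) 0 := by
      rw [hpx, hqx, sub_smul, sub_smul]; abel
    rw [hdiff]
    refine (abs_frame_comb_apply_le hu0 _ _ j).trans ?_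
    have hx4 : |x| ≤ c₃ * tn := hx.trans (mul_le_mul_of_nonneg_left h4le hc₃0)
    have hx4' : |x'| ≤ c₃ * tn := hx'.trans (mul_le_mul_of_nonneg_left h4le hc₃0)
    have h1 : |x - x'| ≤ 2 * c₃ * tn := (abs_sub x x').trans (by linarith)
    have h2 : |y - y'| ≤ 2 * c₃ * tn := (abs_sub y y').trans (by linarith)
    linarith
  -- the `f₀`-momenta of two admissible strings are componentwise `≤ 4c₃·tn·L` apart (conservation)
  have hk0f : k0 f₀ = -∑ i ∈ Finset.univ.erase f₀, k0 i :=
    eq_neg_of_add_eq_zero_left (by rw [Finset.add_sum_erase _ _ (Finset.mem_univ f₀)]; exact hsum0)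
  have hclose : ∀ (ω : Fin L → Fin (sectorCount n)), (∀ i, i ≠ f₀ → ω i = σ i) →
      ∀ (k : Fin L → (Fin 2 → ℝ)), (∀ i, k i ∈ sSector u e₀ n (ω i : ℕ)) → ∑ i, k i = 0 →
      ∀ j : Fin 2, |(k f₀ - k0 f₀) j| ≤ 4 * c₃ * tn * L := by
    intro ω hωσ k hk hsum j
    have hkf : k f₀ = -∑ i ∈ Finset.univ.erase f₀, k i :=
      eq_neg_of_add_eq_zero_left (by rw [Finset.add_sum_erase _ _ (Finset.mem_univ f₀)]; exact hsum)
    have hcomp : (k f₀ - k0 f₀) j = -∑ i ∈ Finset.univ.erase f₀, (k i - k0 i) j := by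
      rw [hkf, hk0f]
      simp only [Pi.sub_apply, Pi.neg_apply, Finset.sum_apply, Finset.sum_sub_distrib]
      ring
    rw [hcomp, abs_neg]
    have hL : ((Finset.univ.erase f₀).card : ℝ) ≤ L := by
      rw [Finset.card_erase_of_mem (Finset.mem_univ f₀), Finset.card_univ, Fintype.card_fin]
      exact_mod_cast Nat.sub_le L 1
    calc |∑ i ∈ Finset.univ.erase f₀, (k i - k0 i) j| ≤ ∑ i ∈ Finset.univ.erase f₀, |(k i - k0 i) j| := Finset.abs_sum_le_sum_abs _ _
      _ ≤ ∑ _i ∈ Finset.univ.erase f₀, 4 * c₃ * tn := Finset.sum_le_sum fun i hi => by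
          have hi' : i ≠ f₀ := Finset.ne_of_mem_erase hi
          have h1 : k i ∈ sSector u e₀ n (σ i : ℕ) := by rw [← hωσ i hi']; exact hk i
          have h2 : k0 i ∈ sSector u e₀ n (σ i : ℕ) := by rw [← hω0σ i hi']; exact hk0 i
          exact hbox (σ i) (σ i).isLt _ _ h1 h2 j
      _ ≤ 4 * c₃ * tn * L := by
          rw [Finset.sum_const, nsmul_eq_mul]
          have : 0 ≤ 4 * c₃ * tn := by positivity
          nlinarith
  -- hence the centres of the `f₀` sectors of admissible strings are within `D` of the reference centre
  have hcentre : ∀ ω ∈ S, torusDist (θc (ω f₀) - θc (ω0 f₀)) ≤ D := by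
    intro ω hω
    obtain ⟨hωσ, k, hk, hsum⟩ := hω
    obtain ⟨ρ, θ, hρ, hkρ, hθ⟩ := hpolar (ω f₀) (k f₀) (hk f₀)
    obtain ⟨ρ0, θ0, hρ0, hk0ρ, hθ0⟩ := hpolar (ω0 f₀) (k0 f₀) (hk0 f₀)
    have hv := torusDist_le_of_polar (θ := θ) (θ' := θ0) hcu hρ hρ0
    rw [← hkρ, ← hk0ρ] at hv
    have hc := hclose ω hωσ k hk hsum
    have hθθ : torusDist (θ - θ0) ≤ 8 * π * c₃ * tn * L / cu := by
      have h8 : cu / π * torusDist (θ - θ0) ≤ 8 * c₃ * tn * L := hv.trans (by linarith [hc 0, hc 1])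
      rw [le_div_iff₀ hcu]
      have hπ := Real.pi_pos
      have : cu * torusDist (θ - θ0) ≤ π * (8 * c₃ * tn * L) := by
        have := mul_le_mul_of_nonneg_left h8 hπ.le
        rwa [← mul_assoc, mul_div_cancel₀ _ hπ.ne'] at this
      linarith
    have hsplit : θc (ω f₀) - θc (ω0 f₀) = (-(θ - θc (ω f₀)) + (θ - θ0)) + (θ0 - θc (ω0 f₀)) := by ring
    rw [hsplit]
    calc torusDist ((-(θ - θc (ω f₀)) + (θ - θ0)) + (θ0 - θc (ω0 f₀)))
        ≤ torusDist (-(θ - θc (ω f₀)) + (θ - θ0)) + torusDist (θ0 - θc (ω0 f₀)) := torusDist_add_le' _ _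
      _ ≤ torusDist (-(θ - θc (ω f₀))) + torusDist (θ - θ0) + torusDist (θ0 - θc (ω0 f₀)) := by
          linarith [torusDist_add_le' (-(θ - θc (ω f₀))) (θ - θ0)]
      _ ≤ π * tn + 8 * π * c₃ * tn * L / cu + π * tn := by rw [torusDist_neg']; linarith
      _ = D := by rw [hDdef]; field_simp; ring
  -- count: `ω ↦ ω f₀` is injective on `S` into the centres within `D` of the reference centre
  set T := Finset.univ.filter (fun a : Fin (sectorCount n) => torusDist (sectorCenter n a - θc (ω0 f₀)) ≤ D) with hTdef
  have hinj : S.toFinset.card ≤ T.card := by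
    refine Finset.card_le_card_of_injOn (fun ω => ω f₀) (fun ω hω => ?_) (fun ω hω ω' hω' h => ?_)
    · have hω' : ω ∈ S := by simpa using hω
      simp only [hTdef, Finset.coe_filter, Set.mem_setOf_eq]
      exact ⟨Finset.mem_univ _, hcentre ω hω'⟩
    · have hω1 : ω ∈ S := by simpa using hω
      have hω2 : ω' ∈ S := by simpa using hω'
      funext i
      by_cases hi : i = f₀
      · subst hi; exact h
      · rw [hω1.1 i hi, hω2.1 i hi]
  have hcardS : Nat.card S = S.toFinset.card := Nat.card_eq_card_toFinset S
  have hTcard := card_centres_torus_le n (θc (ω0 f₀)) D hD0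
  have hw : 2 * D / sectorWidth n + 1 = 16 * (c₃ / cu) * L + 5 := by
    rw [sectorWidth_eq_zpow, hDdef]
    have hπ := Real.pi_pos.ne'
    field_simp
    ring
  calc (Nat.card S : ℝ) = S.toFinset.card := by rw [hcardS]
    _ ≤ T.card := by exact_mod_cast hinj
    _ ≤ 2 * D / sectorWidth n + 1 := hTcard
    _ = 16 * (c₃ / cu) * L + 5 := hw

end OneLeg

section RelativeCount

variable {ε : (Fin 2 → ℝ) → ℝ} {μ e₀ : ℝ} {u : ℝ → ℝ → ℝ}

open Classical in
/-- **BGM 2006 Lemma A4.1 (A4.2) — THE SINGLE-VERTEX RELATIVE COUNT WITH `F` FIXED LEGS**: the scale-`n′` strings of an `L`-leg vertex that agree with a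
prescribed string `τ` on a leg set `E` (`|E| = F`, any `F ≤ L`), whose other legs refine given scale-`n` sectors `ωt`, and that admit momenta
`k⃗ᵢ ∈ S_{n′,ωᵢ}` with `Σ k⃗ᵢ = 0`, number at most `(3·2^{n′−n})^{L−F−1}·(16(c₃/cu)L + 5)`: every free leg but one costs its refinement count
(`card_refinements_le`), the last one is determined (`card_oneLeg_le`).  As BGM note, this is the conservation saving the basic power counting already spends;
it is recorded for the routed level count («(I1)-LEV-FLOOR», primitive (A4.2)). [cite: BenfattoGiulianiMastropietro2006, App. A4 Lemma A4.1 (A4.2)–(A4.3)] -/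
theorem count_prescribed_relative (hD : DispersionHyp ε μ e₀ u) {c₃ : ℝ}
    (h73 : ∀ (n ω : ℕ), ω < sectorCount n → ∀ p ∈ sSector u e₀ n ω,
      ∃ k₁ k₂ : ℝ,
        p = fermiPoint u (sectorCenter n ω) + k₁ • unitNormal u (sectorCenter n ω) 0 +
              k₂ • unitTangent u (sectorCenter n ω) 0 ∧
        |k₁| ≤ c₃ * (4 : ℝ) ^ (-(n : ℤ)) ∧ |k₂| ≤ c₃ * (2 : ℝ) ^ (-(n : ℤ)) ∧
        |fderiv ℝ ε p (unitTangent u (sectorCenter n ω) 0)| ≤ c₃ * (2 : ℝ) ^ (-(n : ℤ)))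
    {cu : ℝ} (hcu : 0 < cu) (hu : ∀ θ e : ℝ, |e| ≤ e₀ → cu ≤ u θ e)
    {n n' : ℕ} (hn : n ≤ n') {L : ℕ} {ωt : Fin L → ℕ} (hωt : ∀ i, ωt i < sectorCount n)
    (E : Finset (Fin L)) (τ : Fin L → Fin (sectorCount n')) :
    (Nat.card {ω : Fin L → Fin (sectorCount n') | (∀ e ∈ E, ω e = τ e) ∧ (∀ i, i ∉ E → sSector u e₀ n' (ω i : ℕ) ⊆ sSector u e₀ n (ωt i)) ∧
        ∃ k : Fin L → (Fin 2 → ℝ), (∀ i, k i ∈ sSector u e₀ n' (ω i : ℕ)) ∧ ∑ i, k i = 0} : ℝ) ≤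
      (3 * (2 : ℝ) ^ (n' - n)) ^ (L - E.card - 1) * (16 * (c₃ / cu) * L + 5) := by
  classical
  have he₀ := hD.e₀_pos
  set S := {ω : Fin L → Fin (sectorCount n') | (∀ e ∈ E, ω e = τ e) ∧ (∀ i, i ∉ E → sSector u e₀ n' (ω i : ℕ) ⊆ sSector u e₀ n (ωt i)) ∧
        ∃ k : Fin L → (Fin 2 → ℝ), (∀ i, k i ∈ sSector u e₀ n' (ω i : ℕ)) ∧ ∑ i, k i = 0} with hSdef
  have hcardS : Nat.card S = S.toFinset.card := Nat.card_eq_card_toFinset S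
  set B₁ : ℝ := 16 * (c₃ / cu) * L + 5 with hB₁
  -- nonnegativity of the one-leg bound (a sector box contains its centre's Fermi point)
  have hc₃0 : 0 ≤ c₃ := by
    obtain ⟨k₁, k₂, -, -, hk₂, -⟩ := h73 0 0 (sectorCount_pos 0) _ (fermiPoint_centre_mem_sSector hD 0 0)
    have : (0 : ℝ) ≤ c₃ * (2 : ℝ) ^ (-((0 : ℕ) : ℤ)) := (abs_nonneg _).trans hk₂
    simpa using this
  have hB₁0 : 0 ≤ B₁ := by rw [hB₁]; positivity
  have hR0 : 0 ≤ (3 * (2 : ℝ) ^ (n' - n)) ^ (L - E.card - 1) := by positivity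
  -- the case `E = univ`: at most the one string `τ`
  by_cases hE : E = Finset.univ
  · have hsub : S.toFinset ⊆ {τ} := by
      intro ω hω
      rw [Set.mem_toFinset] at hω
      rw [Finset.mem_singleton]
      funext i
      exact hω.1 i (hE ▸ Finset.mem_univ i)
    have h1 : (S.toFinset.card : ℝ) ≤ 1 := by exact_mod_cast (Finset.card_le_card hsub).trans (Finset.card_singleton τ).le
    have h5 : (1 : ℝ) ≤ (3 * (2 : ℝ) ^ (n' - n)) ^ (L - E.card - 1) * B₁ := by
      have ha : (1 : ℝ) ≤ (3 * (2 : ℝ) ^ (n' - n)) ^ (L - E.card - 1) := one_le_pow₀ (by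
        have : (1 : ℝ) ≤ (2 : ℝ) ^ (n' - n) := one_le_pow₀ (by norm_num)
        linarith)
      have h16 : (0 : ℝ) ≤ 16 * (c₃ / cu) * L := by positivity
      have hb : (1 : ℝ) ≤ B₁ := by rw [hB₁]; linarith
      nlinarith
    rw [hcardS]; exact h1.trans h5
  -- a free leg `f₀ ∉ E`
  obtain ⟨f₀, hf₀⟩ : ∃ f₀, f₀ ∉ E := not_forall.mp fun h => hE (Finset.eq_univ_iff_forall.mpr h)
  -- the refinement sets of the free legs
  set Ref : Fin L → Finset (Fin (sectorCount n')) := fun m =>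
    Finset.univ.filter (fun a : Fin (sectorCount n') => sSector u e₀ n' a ⊆ sSector u e₀ n (ωt m)) with hRef
  have hRefcard : ∀ m, (Ref m).card ≤ 3 * 2 ^ (n' - n) := fun m => card_refinements_le hD hn (hωt m)
  -- the projection forgetting the leg `f₀`
  set c₀ : Fin (sectorCount n') := ⟨0, sectorCount_pos n'⟩ with hc₀
  set proj : (Fin L → Fin (sectorCount n')) → (Fin L → Fin (sectorCount n')) := fun ω => Function.update ω f₀ c₀ with hproj
  set tf : Fin L → Finset (Fin (sectorCount n')) := fun m => if m = f₀ then {c₀} else if m ∈ E then {τ m} else Ref m with htf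
  set A := Fintype.piFinset tf with hA
  have hmaps : Set.MapsTo proj (S.toFinset : Set (Fin L → Fin (sectorCount n'))) (A : Set (Fin L → Fin (sectorCount n'))) := by
    intro ω hω
    have hω' : ω ∈ S := by simpa using hω
    obtain ⟨hωτ, hωref, -⟩ := hω'
    rw [Finset.mem_coe, hA, Fintype.mem_piFinset]
    intro m
    simp only [htf, hproj]
    by_cases hm : m = f₀
    · subst hm; rw [if_pos rfl, Function.update_self, Finset.mem_singleton]
    · rw [if_neg hm, Function.update_of_ne hm]
      by_cases hmE : m ∈ E
      · rw [if_pos hmE, Finset.mem_singleton]; exact hωτ m hmE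
      · rw [if_neg hmE, hRef, Finset.mem_filter]; exact ⟨Finset.mem_univ _, hωref m hmE⟩
  -- the fibres: one-leg determination
  have hfib : ∀ ρ ∈ A, ((S.toFinset).filter (fun ω => proj ω = ρ)).card ≤ ⌊B₁⌋₊ := by
    intro ρ _
    apply Nat.le_floor
    have hone := card_oneLeg_le hD h73 hcu hu n' f₀ ρ
    set S₁ := {ω : Fin L → Fin (sectorCount n') | (∀ i, i ≠ f₀ → ω i = ρ i) ∧
        ∃ k : Fin L → (Fin 2 → ℝ), (∀ i, k i ∈ sSector u e₀ n' (ω i : ℕ)) ∧ ∑ i, k i = 0} with hS₁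
    have hsub : (S.toFinset).filter (fun ω => proj ω = ρ) ⊆ S₁.toFinset := by
      intro ω hω
      rw [Finset.mem_filter, Set.mem_toFinset] at hω
      rw [Set.mem_toFinset]
      obtain ⟨⟨-, -, hk⟩, hρ⟩ := hω
      refine ⟨fun i hi => ?_, hk⟩
      rw [← hρ]; simp only [hproj]; rw [Function.update_of_ne hi]
    have hcard₁ : Nat.card S₁ = S₁.toFinset.card := Nat.card_eq_card_toFinset S₁
    calc (((S.toFinset).filter (fun ω => proj ω = ρ)).card : ℝ) ≤ S₁.toFinset.card := by exact_mod_cast Finset.card_le_card hsub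
      _ = Nat.card S₁ := by rw [hcard₁]
      _ ≤ B₁ := hone
  -- the size of the target `A`: one refinement factor per free leg other than `f₀`
  have hAcard : A.card ≤ (3 * 2 ^ (n' - n)) ^ (L - E.card - 1) := by
    rw [hA, Fintype.card_piFinset]
    have hle : ∀ m, (tf m).card ≤ if m = f₀ ∨ m ∈ E then 1 else 3 * 2 ^ (n' - n) := by
      intro m
      simp only [htf]
      by_cases hm : m = f₀
      · rw [if_pos hm, if_pos (Or.inl hm), Finset.card_singleton]
      · rw [if_neg hm]
        by_cases hmE : m ∈ E
        · rw [if_pos hmE, if_pos (Or.inr hmE), Finset.card_singleton]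
        · rw [if_neg hmE, if_neg (by tauto)]; exact hRefcard m
    calc ∏ m, (tf m).card ≤ ∏ m : Fin L, (if m = f₀ ∨ m ∈ E then 1 else 3 * 2 ^ (n' - n)) := Finset.prod_le_prod' fun m _ => hle m
      _ = (3 * 2 ^ (n' - n)) ^ (Finset.univ.filter (fun m : Fin L => ¬(m = f₀ ∨ m ∈ E))).card := by
          rw [Finset.prod_ite, Finset.prod_const_one, one_mul, Finset.prod_const]
      _ = (3 * 2 ^ (n' - n)) ^ (L - E.card - 1) := by
          congr 1
          have h3 : (Finset.univ.filter (fun m : Fin L => m = f₀ ∨ m ∈ E)).card = E.card + 1 := by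
            have hset : Finset.univ.filter (fun m : Fin L => m = f₀ ∨ m ∈ E) = insert f₀ E := by
              ext m; simp [Finset.mem_insert]
            rw [hset, Finset.card_insert_of_notMem hf₀]
          have := Finset.card_filter_add_card_filter_not (s := (Finset.univ : Finset (Fin L))) (fun m : Fin L => m = f₀ ∨ m ∈ E)
          rw [h3, Finset.card_univ, Fintype.card_fin] at this
          omega
  -- assemble
  have hTle := Finset.card_le_mul_card_image_of_maps_to hmaps (⌊B₁⌋₊) hfib
  have h1 : ((S.toFinset).card : ℝ) ≤ (⌊B₁⌋₊ : ℝ) * (A.card : ℝ) := by exact_mod_cast hTle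
  have h2 : (⌊B₁⌋₊ : ℝ) ≤ B₁ := Nat.floor_le hB₁0
  have h3 : (A.card : ℝ) ≤ (3 * (2 : ℝ) ^ (n' - n)) ^ (L - E.card - 1) := by exact_mod_cast hAcard
  rw [hcardS]
  calc ((S.toFinset).card : ℝ) ≤ (⌊B₁⌋₊ : ℝ) * (A.card : ℝ) := h1
    _ ≤ B₁ * (3 * (2 : ℝ) ^ (n' - n)) ^ (L - E.card - 1) := mul_le_mul h2 h3 (by positivity) hB₁0
    _ = _ := mul_comm _ _

end RelativeCount

end BGM2003

end Literature.MathematicalPhysics.QuantumLattice.FermiRG
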